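import Mathlib
import Literature.Analysis.Fourier.DiscreteFractalUncertainty
import HarnessLib

/-!
# The discrete fractal uncertainty principle with explicit exponent (Dyatlov–Jin 2018) — proofs

Analysis/Fourier proof file, sibling of `DiscreteFractalUncertainty` (which vendors the
definition `IsDiscreteRegular` and the named facts `DyatlovJin2018_prop_4_6`, `DyatlovJin2018_prop_4_8`)
and of `DiscreteFractalUncertaintyProofs` (the printed reduction of Prop. 4.8 to Bourgain–Dyatlov).
This file PROVES `DyatlovJin2018_prop_4_6` by Dolgopyat's method (Theorem 1 of the paper):
`theorem DyatlovJin2018_prop_4_6_holds : DyatlovJin2018_prop_4_6` (at the end of the file).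
Helper definitions and lemmas live in the sub-namespace `Literature.Analysis.Fourier.DyatlovJin2018.Dolgopyat`
(the paper + the method), disjoint from the helpers of the Prop. 4.8 file.

Source: S. Dyatlov, L. Jin, *Dolgopyat's method and the fractal uncertainty principle*,
Analysis & PDE 11 (2018) 1457–1485, arXiv:1702.03619 [DyatlovJin2018]. **Numbering.** The vendored
fact's locators ("Definition 4.2, Lemma 4.3, Proposition 4.6/4.8") follow the held LaTeX-source
rendering, whose section counter starts at 0; in the published paper the same statements are
Definition 5.2, Lemma 5.3, Propositions 5.6/5.8, and the tools used below are Lemma 2.1 (tree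
regularity), Lemmas 2.3–2.4 (`𝒞_θ` spaces), Lemmas 2.6–2.8 (elementary inequalities),
Proposition 3.1 and Lemma 3.2 with Lemmas 3.3–3.7 (§3.2), §3.3 (rescaling). We cite the published
numbers together with the equation labels of the source.

## The argument (as formalised)

Proposition 5.6 is Theorem 1 of the paper for the pair of measures `N^{-δ}·#` on `N⁻¹X, N⁻¹Y`
(Lemma 5.3) with phase `Φ(x,y) = -2πxy` and amplitude `G ≡ 1`. Everything is therefore FINITE:
measures are weighted counting measures of finite point sets `S ⊂ ℝ` (`Finset ℝ`), `L²` norms are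
finite sums, and the functions `F_J` of (e:F-J) are the normalised trigonometric sums
`TS P ζ c f x = (#P)⁻¹ ∑_{y∈P} e^{ic(y-ζ)x} f(y)` with explicit derivative `TS'`.

* **A.** `RegUpTo δ C_R h w S`: Definition 1.1 for the measure `w·#(S ∩ ·)`; `regUpTo_of_isDiscreteRegular`
  is Lemma 5.3 with a general dilation `s` (this absorbs the rescaling `σ` of §3.3).
* **B.** The discretization tree of §2.1 for a finite set: the run `[loIdx·g, hiIdx·g]` of a point
  (maximal block of grid cells meeting `S`, via `sInf`/`sSup` over `ℤ`), uniqueness (`IsRun.eq_idx`),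
  nesting (`run_nested`), children as fibres of the key map; Lemma 2.1 (1)–(3):
  `IsRun.len_le` (at most `C_R' = (3C_R²)^{1/(1-δ)}` cells — every third cell carries a disjoint
  centred interval), `IsRun.mass_le/ge`, `child_card_ratio` (`≥ L^{-δ}/C_R'`), `IsRun.exists_far_children`.
* **C.** `TS`, `TS'`, recentring (e:F-J-iterative), fibre decomposition, the norm
  `normC θ F F' a b = max (sup_[a,b] |F|) (θ (b-a) sup_[a,b] |F'|)`, Lemma 2.4 (`norm_sub_le_normC`,
  from Mathlib's mean value inequality) and Lemma 2.3 (`normC_recenter_le`).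
* **D.** Lemma 2.7 with ordered pairs (`sq_wsum_eq`, `normSq_wsum_eq`, `extreme_l2` — weights
  `≥ 2√(2ε)` instead of `2√ε`), Lemma 2.8 (`extreme_l1`), Lemma 2.6 (`norm_ex_sub_one_ge`, from
  Mathlib's Jordan inequality).
* **E.** Lemma 3.3 (`noGain_bound`) and the inductive step Lemma 3.2 in abstract form
  (`main_step_abstract`: children intervals/pieces with weights `≥ p_min`, the phase condition
  (e:derbound-iteration), far children on both sides, and the numerical constraint
  `2η + 4 d_X^{hi}/(θ|I|) ≤ |c| d_X^{lo} d_Y^{lo}/π`, `η = √(2ε₁/p_min³)`), following Lemmas 3.4–3.7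
  and the final contradiction of §3.2 verbatim (the four-term triangle inequality is the identity
  `hZdecomp`).
* **F.** The step on the trees (`step_run`, `step_level`), the start (e:start-iteration) (`ES_base`),
  the iteration (`ES_induct`) and Proposition 3.1 in the unweighted form
  `∑_{x∈S_X} |∑_{y∈S_Y} e^{icxy} f(y)|² ≤ #S_X #S_Y (1-ε₁)^{K-2} ∑ |f|²` (`core_bound`), for
  `|c| = L^K`, sets regular up to scale `L^{1-K}`, `K₀ = 1`.
* **G.** Constants: `L = ⌈(512π C_R'² C_R^{4/δ})³⌉`, `p_min = L^{-δ}/C_R'`, `θ = 1/(8C_R'²)`,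
  `ε₁ = p_min³/2 · (C_R^{-4/δ} L^{-1/3}/(16π))²` (an admissible variant of (e:L-restriction),
  (e:epsilon-1); the paper's constants are not optimised either). `numerology`:
  `2ε₀ log L ≤ ε₁` for `ε₀ = (5C_R)^{-160/(δ(1-δ))}`, by crude bounds `L ≤ (5C_R)^{16+12e}`,
  `ε₁ ≥ (5C_R)^{-(70+56e)}`, `e = 1/(δ(1-δ)) ≥ 4`. Then, for `L^K ≤ 2πN < L^{K+1}`, `K ≥ 2`, the sets
  `s·X, s·Y` with `s² = 2π/(N L^K)` and `c = -L^K` satisfy the hypotheses (`stepHyp_dilate`),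
  `∑_{j∈X}|𝓕u(j)|²` is the left side of `core_bound` (`dft_eq_sum_Y`, `stdAddChar_eq_ex`), and
  `#X #Y (1-ε₁)^{K-2} ≤ C_R² N^{2δ} L³ N^{-2ε₀}` (`decay_pow_bound`); `2πN < L²` and `C_R < 1` (empty
  sets) are covered by the trivial bound `∑_j |𝓕u(j)|² ≤ N² ‖u‖²`. The constant is `C = 2 C_R L⁴`.

Deviations from print (all inessential): counting measures and the bilinear phase only (no
partition of unity, Lemma 2.5 is exact); closed real intervals throughout; ordered pairs in
Lemma 2.7; our own admissible `L, ε₁`; the dilation `s` replaces the pair `(h, σ)` of §3.3.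
Nothing here is specific to Cantor sets; Proposition 5.8 (`δ` close to 1, via Bourgain–Dyatlov) is
NOT proved here.
-/

namespace Literature.Analysis.Fourier

open scoped BigOperators
open Finset

namespace DyatlovJin2018.Dolgopyat

/-! ### A. Counting masses of finite point sets; regularity (Definition 1 of the paper) -/

/-- `pts S a b = S ∩ [a, b]`. [cite: DyatlovJin2018, Definition 1.1] -/
noncomputable def pts (S : Finset ℝ) (a b : ℝ) : Finset ℝ :=
  S.filter fun y => a ≤ y ∧ y ≤ b

/-- `cnt S a b = #(S ∩ [a, b])`. [cite: DyatlovJin2018, Definition 1.1] -/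
noncomputable def cnt (S : Finset ℝ) (a b : ℝ) : ℕ :=
  (S.filter fun y => a ≤ y ∧ y ≤ b).card

/-- `#(pts S a b) = cnt S a b`. [folklore] -/
theorem card_pts (S : Finset ℝ) (a b : ℝ) : (pts S a b).card = cnt S a b := rfl

/-- Membership in `pts`. [folklore] -/
theorem mem_pts {S : Finset ℝ} {a b y : ℝ} : y ∈ pts S a b ↔ y ∈ S ∧ a ≤ y ∧ y ≤ b := by
  simp [pts, Finset.mem_filter]

/-- `pts S a b ⊆ S`. [folklore] -/
theorem pts_subset (S : Finset ℝ) (a b : ℝ) : pts S a b ⊆ S := Finset.filter_subset _ _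

/-- `pts` is monotone in the interval. [folklore] -/
theorem pts_mono {S : Finset ℝ} {a b a' b' : ℝ} (ha : a' ≤ a) (hb : b ≤ b') :
    pts S a b ⊆ pts S a' b' := by
  intro y hy
  rw [mem_pts] at hy ⊢
  exact ⟨hy.1, ha.trans hy.2.1, hy.2.2.trans hb⟩

/-- Membership in the interval filter. [folklore] -/
theorem mem_filter_Icc {S : Finset ℝ} {a b y : ℝ} :
    y ∈ S.filter (fun y => a ≤ y ∧ y ≤ b) ↔ y ∈ S ∧ a ≤ y ∧ y ≤ b := by
  simp [Finset.mem_filter]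

/-- `cnt` is monotone in the interval. [folklore] -/
theorem cnt_mono {S : Finset ℝ} {a b a' b' : ℝ} (ha : a' ≤ a) (hb : b ≤ b') :
    cnt S a b ≤ cnt S a' b' := by
  unfold cnt
  apply Finset.card_le_card
  intro y hy
  rw [mem_filter_Icc] at hy ⊢
  exact ⟨hy.1, ha.trans hy.2.1, hy.2.2.trans hb⟩

/-- `cnt S a b ≤ #S`. [folklore] -/
theorem cnt_le_card (S : Finset ℝ) (a b : ℝ) : cnt S a b ≤ S.card :=
  Finset.card_filter_le _ _

/-- An interval containing a point of `S` has positive count. [folklore] -/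
theorem cnt_pos_of_mem {S : Finset ℝ} {a b y : ℝ} (hy : y ∈ S) (ha : a ≤ y) (hb : y ≤ b) :
    0 < cnt S a b := by
  unfold cnt
  apply Finset.card_pos.2
  exact ⟨y, mem_filter_Icc.2 ⟨hy, ha, hb⟩⟩

/-- **Definition 1** of the paper for the measure `μ = w · #(S ∩ ·)` carried by a finite point set
`S ⊂ ℝ`: `(S, μ)` is `δ`-regular up to scale `h` with constant `C_R` if `μ(I) ≤ C_R |I|^δ` for every
interval with `|I| ≥ h`, and `μ(I) ≥ C_R⁻¹ |I|^δ` if moreover `|I| ≤ 1` and `I` is centred at a point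
of `S`. [cite: DyatlovJin2018, Definition 1.1] -/
structure RegUpTo (δ CR h w : ℝ) (S : Finset ℝ) : Prop where
  upper : ∀ a b : ℝ, h ≤ b - a → w * (cnt S a b : ℝ) ≤ CR * (b - a) ^ δ
  lower : ∀ x ∈ S, ∀ ℓ : ℝ, h ≤ ℓ → ℓ ≤ 1 →
    CR⁻¹ * ℓ ^ δ ≤ w * (cnt S (x - ℓ / 2) (x + ℓ / 2) : ℝ)

/-- Regularity up to scale `h` implies regularity up to any larger scale. [cite: DyatlovJin2018, Definition 1.1] -/
theorem RegUpTo.mono_scale {δ CR h h' w : ℝ} {S : Finset ℝ} (hreg : RegUpTo δ CR h w S)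
    (hh : h ≤ h') : RegUpTo δ CR h' w S :=
  ⟨fun a b hab => hreg.upper a b (hh.trans hab),
    fun x hx ℓ h1 h2 => hreg.lower x hx ℓ (hh.trans h1) h2⟩

/-- **Lemma 5.3** of the paper (Lemma 4.3 in the vendored numbering; with a general dilation factor `s`): if `X ⊂ ℤ_N` is discretely
`δ`-regular with constant `C_R`, then `s·X ⊂ ℝ` with weight `s^δ` per point is `δ`-regular up to
scale `s`, provided `1 ≤ s N`. [cite: DyatlovJin2018, Lemma 5.3] -/
theorem regUpTo_of_isDiscreteRegular {δ CR : ℝ} {N : ℕ} {X : Finset ℕ}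
    (hreg : IsDiscreteRegular δ CR N X) {s : ℝ} (hs : 0 < s) (hsN : 1 ≤ s * N) :
    RegUpTo δ CR s (s ^ δ) (X.image fun x : ℕ => s * (x : ℝ)) := by
  have hcnt : ∀ a b : ℝ, cnt (X.image fun x : ℕ => s * (x : ℝ)) a b = countInIcc X (a / s) (b / s) := by
    intro a b
    unfold cnt countInIcc
    rw [← Finset.card_image_of_injective (X.filter fun x : ℕ => a / s ≤ (x : ℝ) ∧ (x : ℝ) ≤ b / s)
      (f := fun x : ℕ => s * (x : ℝ))]
    · congr 1
      ext y
      simp only [Finset.mem_filter, Finset.mem_image]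
      constructor
      · rintro ⟨⟨x, hx, rfl⟩, h1, h2⟩
        refine ⟨x, ⟨hx, ?_, ?_⟩, rfl⟩
        · rw [div_le_iff₀ hs]; linarith
        · rw [le_div_iff₀ hs]; linarith
      · rintro ⟨x, ⟨hx, h1, h2⟩, rfl⟩
        refine ⟨⟨x, hx, rfl⟩, ?_, ?_⟩
        · rw [div_le_iff₀ hs] at h1; linarith
        · rw [le_div_iff₀ hs] at h2; linarith
    · intro x y hxy
      have := mul_left_cancel₀ hs.ne' hxy
      exact_mod_cast this
  have hsδ : 0 < s ^ δ := Real.rpow_pos_of_pos hs δ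
  constructor
  · intro a b hab
    rw [hcnt]
    have h1 : 1 ≤ (b - a) / s := by rw [le_div_iff₀ hs]; linarith
    have := hreg.1 (a / s) ((b - a) / s) h1
    have hba : a / s + (b - a) / s = b / s := by field_simp; ring
    rw [hba] at this
    have hpow : ((b - a) / s) ^ δ = (b - a) ^ δ / s ^ δ :=
      Real.div_rpow (by linarith) hs.le δ
    rw [hpow] at this
    calc s ^ δ * (countInIcc X (a / s) (b / s) : ℝ) ≤ s ^ δ * (CR * ((b - a) ^ δ / s ^ δ)) :=
          mul_le_mul_of_nonneg_left this hsδ.le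
      _ = CR * (b - a) ^ δ := by field_simp
  · intro x hx ℓ h1 h2
    rw [Finset.mem_image] at hx
    obtain ⟨x₀, hx₀, rfl⟩ := hx
    rw [hcnt]
    have hℓ1 : 1 ≤ ℓ / s := by rw [le_div_iff₀ hs]; linarith
    have hℓ2 : ℓ / s ≤ N := by
      rw [div_le_iff₀ hs]
      calc ℓ ≤ 1 := h2
        _ ≤ s * N := hsN
        _ = N * s := mul_comm _ _
    have := hreg.2 x₀ hx₀ (ℓ / s) hℓ1 hℓ2
    have ha : (s * (x₀ : ℝ) - ℓ / 2) / s = (x₀ : ℝ) - ℓ / s / 2 := by field_simp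
    have hb : (s * (x₀ : ℝ) + ℓ / 2) / s = (x₀ : ℝ) + ℓ / s / 2 := by field_simp
    rw [ha, hb]
    have hpow : (ℓ / s) ^ δ = ℓ ^ δ / s ^ δ := Real.div_rpow (by linarith) hs.le δ
    rw [hpow] at this
    calc CR⁻¹ * ℓ ^ δ = s ^ δ * (CR⁻¹ * (ℓ ^ δ / s ^ δ)) := by field_simp
      _ ≤ s ^ δ * (countInIcc X ((x₀ : ℝ) - ℓ / s / 2) ((x₀ : ℝ) + ℓ / s / 2) : ℝ) :=
          mul_le_mul_of_nonneg_left this hsδ.le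

/-! ### B. The tree of runs (§2.1 of the paper, "discretization with base L") -/

section Runs

variable (S : Finset ℝ) (g : ℝ)

/-- The grid cell `[q g, (q+1) g]` meets `S`. [cite: DyatlovJin2018, §2.1] -/
def CellMeets (q : ℤ) : Prop := ∃ y ∈ S, (q : ℝ) * g ≤ y ∧ y ≤ ((q : ℝ) + 1) * g

/-- Above any index there is a grid cell missing the finite set `S`. [folklore] -/
theorem exists_not_cellMeets_ge (hg : 0 < g) (m : ℤ) : ∃ q : ℤ, m ≤ q ∧ ¬ CellMeets S g q := by
  obtain ⟨B, hB⟩ := S.bddAbove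
  obtain ⟨n, hn⟩ := exists_nat_gt (B / g - m)
  refine ⟨m + n, by omega, ?_⟩
  rintro ⟨y, hy, h1, -⟩
  have hyB : y ≤ B := hB hy
  have : B / g < (m : ℝ) + n := by linarith
  rw [div_lt_iff₀ hg] at this
  push_cast at h1
  linarith

/-- Below any index there is a grid cell missing the finite set `S`. [folklore] -/
theorem exists_not_cellMeets_le (hg : 0 < g) (m : ℤ) : ∃ p : ℤ, p ≤ m ∧ ¬ CellMeets S g (p - 1) := by
  obtain ⟨B, hB⟩ := S.bddBelow
  obtain ⟨n, hn⟩ := exists_nat_gt (m - B / g)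
  refine ⟨m - n, by omega, ?_⟩
  rintro ⟨y, hy, -, h2⟩
  have hyB : B ≤ y := hB hy
  have : (m : ℝ) - n < B / g := by linarith
  rw [lt_div_iff₀ hg] at this
  push_cast at h2
  linarith

/-- Right end (grid index) of the run of cells meeting `S` that contains `x`.
[cite: DyatlovJin2018, §2.1 (discretization)] -/
noncomputable def hiIdx (x : ℝ) : ℤ :=
  sInf {q : ℤ | ⌊x / g⌋ + 1 ≤ q ∧ ¬ CellMeets S g q}

/-- Left end (grid index) of the run of cells meeting `S` that contains `x`.
[cite: DyatlovJin2018, §2.1 (discretization)] -/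
noncomputable def loIdx (x : ℝ) : ℤ :=
  sSup {p : ℤ | p ≤ ⌊x / g⌋ ∧ ¬ CellMeets S g (p - 1)}

variable {S g}

/-- Defining properties of `hiIdx` (least empty cell to the right). [cite: DyatlovJin2018, §2.1 (discretization)] -/
theorem hiIdx_spec (hg : 0 < g) (x : ℝ) :
    ⌊x / g⌋ + 1 ≤ hiIdx S g x ∧ ¬ CellMeets S g (hiIdx S g x) ∧
      ∀ r : ℤ, ⌊x / g⌋ + 1 ≤ r → r < hiIdx S g x → CellMeets S g r := by
  set T : Set ℤ := {q : ℤ | ⌊x / g⌋ + 1 ≤ q ∧ ¬ CellMeets S g q} with hT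
  have hne : T.Nonempty := by
    obtain ⟨q, hq1, hq2⟩ := exists_not_cellMeets_ge S g hg (⌊x / g⌋ + 1)
    exact ⟨q, hq1, hq2⟩
  have hbdd : BddBelow T := ⟨⌊x / g⌋ + 1, fun q hq => hq.1⟩
  have hmem : sInf T ∈ T := Int.csInf_mem hne hbdd
  refine ⟨hmem.1, hmem.2, fun r hr1 hr2 => ?_⟩
  by_contra hr
  have : sInf T ≤ r := csInf_le hbdd ⟨hr1, hr⟩
  exact absurd hr2 (not_lt.2 this)

/-- Defining properties of `loIdx` (greatest empty cell to the left). [cite: DyatlovJin2018, §2.1 (discretization)] -/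
theorem loIdx_spec (hg : 0 < g) (x : ℝ) :
    loIdx S g x ≤ ⌊x / g⌋ ∧ ¬ CellMeets S g (loIdx S g x - 1) ∧
      ∀ r : ℤ, loIdx S g x ≤ r → r < ⌊x / g⌋ → CellMeets S g r := by
  set T : Set ℤ := {p : ℤ | p ≤ ⌊x / g⌋ ∧ ¬ CellMeets S g (p - 1)} with hT
  have hne : T.Nonempty := by
    obtain ⟨p, hp1, hp2⟩ := exists_not_cellMeets_le S g hg (⌊x / g⌋)
    exact ⟨p, hp1, hp2⟩
  have hbdd : BddAbove T := ⟨⌊x / g⌋, fun p hp => hp.1⟩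
  have hmem : sSup T ∈ T := Int.csSup_mem hne hbdd
  refine ⟨hmem.1, hmem.2, fun r hr1 hr2 => ?_⟩
  by_contra hr
  have h' : r + 1 ≤ loIdx S g x := le_csSup hbdd ⟨by omega, by simpa using hr⟩
  omega

/-- `x` lies in the grid cell of index `⌊x/g⌋`. [folklore] -/
theorem floor_cell (hg : 0 < g) (x : ℝ) :
    (⌊x / g⌋ : ℝ) * g ≤ x ∧ x ≤ ((⌊x / g⌋ : ℝ) + 1) * g := by
  constructor
  · have := Int.floor_le (x / g)
    rwa [le_div_iff₀ hg] at this
  · have := (Int.lt_floor_add_one (x / g)).le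
    rwa [div_le_iff₀ hg] at this

/-- A run of `S` at grid size `g`: a maximal block `[p g, q g]` of consecutive cells meeting `S`.
[cite: DyatlovJin2018, §2.1] -/
structure IsRun (S : Finset ℝ) (g : ℝ) (p q : ℤ) : Prop where
  lt : p < q
  meets : ∀ r : ℤ, p ≤ r → r < q → CellMeets S g r
  left : ¬ CellMeets S g (p - 1)
  right : ¬ CellMeets S g q

/-- `[loIdx·g, hiIdx·g]` is a run (a vertex of the discretization tree). [cite: DyatlovJin2018, §2.1 (discretization)] -/
theorem isRun_loIdx_hiIdx (hg : 0 < g) {x : ℝ} (hx : x ∈ S) :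
    IsRun S g (loIdx S g x) (hiIdx S g x) := by
  obtain ⟨h1, h2, h3⟩ := hiIdx_spec (S := S) hg x
  obtain ⟨l1, l2, l3⟩ := loIdx_spec (S := S) hg x
  refine ⟨by omega, fun r hr1 hr2 => ?_, l2, h2⟩
  rcases lt_trichotomy r ⌊x / g⌋ with hr | hr | hr
  · exact l3 r hr1 hr
  · subst hr
    exact ⟨x, hx, floor_cell hg x⟩
  · exact h3 r (by omega) hr2

/-- `loIdx x · g ≤ x`. [folklore] -/
theorem lo_le_self (hg : 0 < g) (x : ℝ) : (loIdx S g x : ℝ) * g ≤ x := by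
  have l1 := (loIdx_spec (S := S) hg x).1
  have := (floor_cell hg x).1
  have h' : (loIdx S g x : ℝ) ≤ ⌊x / g⌋ := by exact_mod_cast l1
  nlinarith

/-- `x ≤ hiIdx x · g`. [folklore] -/
theorem self_le_hi (hg : 0 < g) (x : ℝ) : x ≤ (hiIdx S g x : ℝ) * g := by
  have h1 := (hiIdx_spec (S := S) hg x).1
  have := (floor_cell hg x).2
  have h' : (⌊x / g⌋ : ℝ) + 1 ≤ hiIdx S g x := by exact_mod_cast h1
  nlinarith

/-- Points of `S` inside a run lie strictly below its right end.
[cite: DyatlovJin2018, §2.1 (discretization)] -/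
theorem IsRun.lt_right {p q : ℤ} (h : IsRun S g p q) {y : ℝ} (hy : y ∈ S)
    (h2 : y ≤ (q : ℝ) * g) (hg : 0 < g) : y < (q : ℝ) * g := by
  rcases lt_or_eq_of_le h2 with h2 | h2
  · exact h2
  · exact absurd ⟨y, hy, h2.ge, by rw [h2]; nlinarith⟩ h.right

/-- Separation: a point of `S` within distance `g` of a run lies in the run.
[cite: DyatlovJin2018, §2.1 (discretization: distinct intervals are L^{-k} apart)] -/
theorem IsRun.mem_of_near {p q : ℤ} (h : IsRun S g p q) {y : ℝ} (hy : y ∈ S)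
    (h1 : ((p : ℝ) - 1) * g ≤ y) (h2 : y ≤ ((q : ℝ) + 1) * g) :
    (p : ℝ) * g ≤ y ∧ y ≤ (q : ℝ) * g := by
  constructor
  · by_contra hlt
    push Not at hlt
    exact h.left ⟨y, hy, by push_cast; linarith, by push_cast; linarith⟩
  · by_contra hlt
    push Not at hlt
    exact h.right ⟨y, hy, hlt.le, h2⟩

/-- Uniqueness of runs: a point of `S` in a run `[p g, q g]` has that run as its own.
[cite: DyatlovJin2018, §2.1 (discretization)] -/
theorem IsRun.eq_idx {p q : ℤ} (h : IsRun S g p q) (hg : 0 < g) {y : ℝ} (hy : y ∈ S)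
    (h1 : (p : ℝ) * g ≤ y) (h2 : y ≤ (q : ℝ) * g) :
    loIdx S g y = p ∧ hiIdx S g y = q := by
  have hylt : y < (q : ℝ) * g := h.lt_right hy h2 hg
  have hm1 : p ≤ ⌊y / g⌋ := by
    rw [Int.le_floor, le_div_iff₀ hg]; exact h1
  have hm2 : ⌊y / g⌋ < q := by
    rw [Int.floor_lt, div_lt_iff₀ hg]; exact hylt
  obtain ⟨k1, k2, k3⟩ := hiIdx_spec (S := S) hg y
  obtain ⟨l1, l2, l3⟩ := loIdx_spec (S := S) hg y
  constructor
  · -- loIdx y = p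
    apply le_antisymm
    · by_contra hlt
      push Not at hlt
      -- p < lo ≤ ⌊y/g⌋, so cell lo - 1 ∈ [p, q) meets S
      exact l2 (h.meets _ (by omega) (by omega))
    · by_contra hlt
      push Not at hlt
      -- lo < p ≤ ⌊y/g⌋: cell p - 1 has lo ≤ p - 1 < ⌊y/g⌋, meets S by l3; contradiction with h.left
      exact h.left (l3 (p - 1) (by omega) (by omega))
  · apply le_antisymm
    · by_contra hlt
      push Not at hlt
      -- q < hi: cell q has ⌊y/g⌋+1 ≤ q < hi so meets
      exact h.right (k3 q (by omega) hlt)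
    · by_contra hlt
      push Not at hlt
      -- hi < q, hi ≥ ⌊y/g⌋ + 1 ≥ p + 1 > p : cell hi meets by h.meets
      exact k2 (h.meets _ (by omega) hlt)

/-- Points of `S` in the same run have the same run indices.
[cite: DyatlovJin2018, §2.1 (discretization)] -/
theorem run_idx_eq_of_mem (hg : 0 < g) {x y : ℝ} (hx : x ∈ S) (hy : y ∈ S)
    (h1 : (loIdx S g x : ℝ) * g ≤ y) (h2 : y ≤ (hiIdx S g x : ℝ) * g) :
    loIdx S g y = loIdx S g x ∧ hiIdx S g y = hiIdx S g x :=
  (isRun_loIdx_hiIdx hg hx).eq_idx hg hy h1 h2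

/-- A fine cell meeting `S` lies in a coarse cell meeting `S`. [folklore] -/
theorem cellMeets_div {L : ℕ} (hL : 0 < L) (hg : 0 < g) {r : ℤ}
    (h : CellMeets S (g / L) r) : CellMeets S g (r / (L : ℤ)) := by
  obtain ⟨y, hy, h1, h2⟩ := h
  have hL' : (0 : ℝ) < L := by exact_mod_cast hL
  have hLz : (0 : ℤ) < L := by exact_mod_cast hL
  have e1 : r / (L : ℤ) * (L : ℤ) ≤ r := Int.ediv_mul_le r hLz.ne'
  have e2 : r < (r / (L : ℤ) + 1) * (L : ℤ) := Int.lt_ediv_add_one_mul_self r hLz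
  have e1' : ((r / (L : ℤ) : ℤ) : ℝ) * L ≤ r := by exact_mod_cast e1
  have e2' : (r : ℝ) + 1 ≤ (((r / (L : ℤ) : ℤ) : ℝ) + 1) * L := by
    have : r + 1 ≤ (r / (L : ℤ) + 1) * (L : ℤ) := e2
    exact_mod_cast this
  refine ⟨y, hy, ?_, ?_⟩
  · calc ((r / (L : ℤ) : ℤ) : ℝ) * g = (((r / (L : ℤ) : ℤ) : ℝ) * L) * (g / L) := by
          field_simp
      _ ≤ (r : ℝ) * (g / L) := by
          apply mul_le_mul_of_nonneg_right e1' (by positivity)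
      _ ≤ y := h1
  · calc y ≤ ((r : ℝ) + 1) * (g / L) := h2
      _ ≤ ((((r / (L : ℤ) : ℤ) : ℝ) + 1) * L) * (g / L) := by
          apply mul_le_mul_of_nonneg_right e2' (by positivity)
      _ = (((r / (L : ℤ) : ℤ) : ℝ) + 1) * g := by field_simp

/-- Nesting: the run of `x ∈ S` at the finer grid `g / L` lies inside its run at grid `g`.
[cite: DyatlovJin2018, §2.1 (discretization: each vertex has exactly one parent)] -/
theorem run_nested {L : ℕ} (hL : 0 < L) (hg : 0 < g) {x : ℝ} (hx : x ∈ S) :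
    (loIdx S g x : ℝ) * g ≤ (loIdx S (g / L) x : ℝ) * (g / L) ∧
      (hiIdx S (g / L) x : ℝ) * (g / L) ≤ (hiIdx S g x : ℝ) * g := by
  have hL' : (0 : ℝ) < L := by exact_mod_cast hL
  have hLz : (0 : ℤ) < L := by exact_mod_cast hL
  have hg' : 0 < g / L := by positivity
  have R := isRun_loIdx_hiIdx hg hx
  have R' := isRun_loIdx_hiIdx hg' hx
  set p := loIdx S g x
  set q := hiIdx S g x
  set p' := loIdx S (g / L) x
  set q' := hiIdx S (g / L) x
  have hxq : x < (q : ℝ) * g := R.lt_right hx (self_le_hi hg x) hg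
  have hxp : (p : ℝ) * g ≤ x := lo_le_self hg x
  have hxp' : (p' : ℝ) * (g / L) ≤ x := lo_le_self hg' x
  have hxq' : x ≤ (q' : ℝ) * (g / L) := self_le_hi hg' x
  have k1 := (hiIdx_spec (S := S) hg' x).1
  have l1 := (loIdx_spec (S := S) hg' x).1
  constructor
  · by_contra hlt
    push Not at hlt
    -- p' (g/L) < p g = (p L) (g / L), so p' < p L, fine cell r := p L - 1 satisfies p' ≤ r < q'
    have hp'lt : p' < p * L := by
      by_contra hh
      push Not at hh
      have : ((p * L : ℤ) : ℝ) ≤ p' := by exact_mod_cast hh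
      have : (p : ℝ) * g ≤ (p' : ℝ) * (g / L) := by
        calc (p : ℝ) * g = ((p * L : ℤ) : ℝ) * (g / L) := by push_cast; field_simp
          _ ≤ (p' : ℝ) * (g / L) := mul_le_mul_of_nonneg_right this hg'.le
      linarith
    have hr2 : p * L - 1 < q' := by
      -- x ≥ p g > (pL - 1)(g/L) so ⌊x/(g/L)⌋ ≥ pL - 1, and q' ≥ ⌊..⌋ + 1
      have : ((p * L - 1 : ℤ) : ℝ) * (g / L) < x := by
        have : ((p * L - 1 : ℤ) : ℝ) * (g / L) = (p : ℝ) * g - g / L := by push_cast; field_simp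
        rw [this]; linarith
      have hfl : p * L - 1 ≤ ⌊x / (g / L)⌋ := by
        rw [Int.le_floor, le_div_iff₀ hg']; exact this.le
      omega
    have hm : CellMeets S (g / L) (p * L - 1) := R'.meets _ (by omega) hr2
    have := cellMeets_div hL hg hm
    have hdiv : (p * L - 1) / (L : ℤ) = p - 1 := by
      have e : p * L - 1 = ((L : ℤ) - 1) + (p - 1) * L := by ring
      rw [e, Int.add_mul_ediv_right _ _ hLz.ne', Int.ediv_eq_zero_of_lt (by omega) (by omega)]
      ring
    rw [hdiv] at this
    exact R.left this
  · by_contra hlt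
    push Not at hlt
    have hqlt : q * L < q' := by
      by_contra hh
      push Not at hh
      have : (q' : ℝ) ≤ ((q * L : ℤ) : ℝ) := by exact_mod_cast hh
      have : (q' : ℝ) * (g / L) ≤ (q : ℝ) * g := by
        calc (q' : ℝ) * (g / L) ≤ ((q * L : ℤ) : ℝ) * (g / L) :=
              mul_le_mul_of_nonneg_right this hg'.le
          _ = (q : ℝ) * g := by push_cast; field_simp
      linarith
    have hr1 : p' ≤ q * L := by
      have hfl : ⌊x / (g / L)⌋ < q * L := by
        rw [Int.floor_lt, div_lt_iff₀ hg']
        calc x < (q : ℝ) * g := hxq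
          _ = ((q * L : ℤ) : ℝ) * (g / L) := by push_cast; field_simp
      omega
    have hm : CellMeets S (g / L) (q * L) := R'.meets _ hr1 hqlt
    have := cellMeets_div hL hg hm
    rw [Int.mul_ediv_cancel _ hLz.ne'] at this
    exact R.right this

end Runs

/-! #### Run points, children, fibre sums -/

section RunPts

variable {S : Finset ℝ} {g : ℝ}

/-- The run of `x` at grid `g`, as a pair of grid indices.
[cite: DyatlovJin2018, §2.1 (discretization)] -/
noncomputable def runKey (S : Finset ℝ) (g : ℝ) (x : ℝ) : ℤ × ℤ := (loIdx S g x, hiIdx S g x)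

/-- The points of `S` in the run of `x` at grid `g`.
[cite: DyatlovJin2018, §2.1 (discretization)] -/
noncomputable def runPts (S : Finset ℝ) (g : ℝ) (x : ℝ) : Finset ℝ :=
  pts S ((loIdx S g x : ℝ) * g) ((hiIdx S g x : ℝ) * g)

/-- A point of `S` belongs to its own run. [folklore] -/
theorem mem_runPts_self (hg : 0 < g) {x : ℝ} (hx : x ∈ S) : x ∈ runPts S g x :=
  mem_pts.2 ⟨hx, lo_le_self hg x, self_le_hi hg x⟩

/-- `runPts S g x ⊆ S`. [folklore] -/
theorem runPts_subset (x : ℝ) : runPts S g x ⊆ S := pts_subset _ _ _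

/-- The run of a point of `S` is nonempty. [folklore] -/
theorem runPts_nonempty (hg : 0 < g) {x : ℝ} (hx : x ∈ S) : (runPts S g x).Nonempty :=
  ⟨x, mem_runPts_self hg hx⟩

/-- The run of `x ∈ S` is the fibre of the key map over `S`. [cite: DyatlovJin2018, §2.1 (discretization)] -/
theorem runPts_eq_filter_key (hg : 0 < g) {x : ℝ} (hx : x ∈ S) :
    runPts S g x = S.filter (fun y => runKey S g y = runKey S g x) := by
  ext y
  rw [runPts, mem_pts, Finset.mem_filter]
  constructor
  · rintro ⟨hy, h1, h2⟩
    obtain ⟨e1, e2⟩ := run_idx_eq_of_mem hg hx hy h1 h2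
    exact ⟨hy, by simp [runKey, e1, e2]⟩
  · rintro ⟨hy, hk⟩
    simp only [runKey, Prod.mk.injEq] at hk
    refine ⟨hy, ?_, ?_⟩
    · rw [← hk.1]; exact lo_le_self hg y
    · rw [← hk.2]; exact self_le_hi hg y

/-- Points of a run share its key. [cite: DyatlovJin2018, §2.1 (discretization)] -/
theorem runKey_eq_of_mem_runPts (hg : 0 < g) {x y : ℝ} (hx : x ∈ S) (hy : y ∈ runPts S g x) :
    runKey S g y = runKey S g x := by
  rw [runPts_eq_filter_key hg hx, Finset.mem_filter] at hy
  exact hy.2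

/-- Points of a run share the run. [cite: DyatlovJin2018, §2.1 (discretization)] -/
theorem runPts_eq_of_mem_runPts (hg : 0 < g) {x y : ℝ} (hx : x ∈ S) (hy : y ∈ runPts S g x) :
    runPts S g y = runPts S g x := by
  have hk := runKey_eq_of_mem_runPts hg hx hy
  simp only [runKey, Prod.mk.injEq] at hk
  rw [runPts, runPts, hk.1, hk.2]

/-- Nesting of run points: the child run (grid `g / L`) of a point lies inside its run at grid `g`.
[cite: DyatlovJin2018, §2.1 (discretization)] -/
theorem runPts_child_subset {L : ℕ} (hL : 0 < L) (hg : 0 < g) {x : ℝ} (hx : x ∈ S) :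
    runPts S (g / L) x ⊆ runPts S g x := by
  obtain ⟨h1, h2⟩ := run_nested hL hg hx
  exact pts_mono h1 h2

/-- More generally the child run of any point of a run lies inside that run.
[cite: DyatlovJin2018, §2.1 (discretization)] -/
theorem runPts_child_subset' {L : ℕ} (hL : 0 < L) (hg : 0 < g) {x y : ℝ} (hx : x ∈ S)
    (hy : y ∈ runPts S g x) : runPts S (g / L) y ⊆ runPts S g x := by
  rw [← runPts_eq_of_mem_runPts hg hx hy]
  exact runPts_child_subset hL hg (runPts_subset x hy)

/-- The fibre of the child-key map over a run is the child run.
[cite: DyatlovJin2018, §2.1 (discretization)] -/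
theorem filter_childKey_eq (L : ℕ) (hL : 0 < L) (hg : 0 < g) {x y : ℝ} (hx : x ∈ S)
    (hy : y ∈ runPts S g x) :
    (runPts S g x).filter (fun z => runKey S (g / L) z = runKey S (g / L) y) = runPts S (g / L) y := by
  have hyS : y ∈ S := runPts_subset x hy
  have hg' : 0 < g / L := by have : (0:ℝ) < L := by exact_mod_cast hL
                             positivity
  rw [runPts_eq_filter_key hg' hyS]
  ext z
  simp only [Finset.mem_filter]
  constructor
  · rintro ⟨hz, hk⟩; exact ⟨runPts_subset x hz, hk⟩
  · rintro ⟨hz, hk⟩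
    refine ⟨?_, hk⟩
    have : z ∈ runPts S (g / L) y := by
      rw [runPts_eq_filter_key hg' hyS, Finset.mem_filter]; exact ⟨hz, hk⟩
    exact runPts_child_subset' hL hg hx hy this

/-- Fibre decomposition of a sum over a run into sums over its children.
[cite: DyatlovJin2018, §2.1, (e:tree-measure-sum)] -/
theorem sum_runPts_eq_sum_kids (L : ℕ) (x : ℝ) (φ : ℝ → ℝ) :
    ∑ y ∈ runPts S g x, φ y =
      ∑ b ∈ (runPts S g x).image (runKey S (g / L)),
        ∑ y ∈ (runPts S g x).filter (fun z => runKey S (g / L) z = b), φ y := by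
  classical
  rw [Finset.sum_fiberwise_of_maps_to]
  intro y hy
  exact Finset.mem_image_of_mem _ hy

end RunPts

/-! #### Lemma 2.1 of the paper (tree regularity): properties of runs of a regular set -/

section TreeReg

variable {S : Finset ℝ} {g : ℝ} {δ CR h₀ w : ℝ}

/-- The constant `C_R' = (3 C_R²)^{1/(1-δ)}` of the tree-regularity lemma.
[cite: DyatlovJin2018, Lemma 2.1] -/
noncomputable def CR' (δ CR : ℝ) : ℝ := (3 * CR ^ 2) ^ (1 / (1 - δ))

/-- `1 ≤ C_R'`. [folklore] -/
theorem one_le_CR' (hδ : δ < 1) (hCR : 1 ≤ CR) : 1 ≤ CR' δ CR := by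
  unfold CR'
  apply Real.one_le_rpow
  · nlinarith
  · have : 0 < 1 - δ := by linarith
    positivity

/-- Separation for runs, Finset form: points of `S` in the `g`-neighbourhood of a run are in it.
[cite: DyatlovJin2018, §2.1 (discretization)] -/
theorem IsRun.pts_widen {p q : ℤ} (h : IsRun S g p q) :
    pts S (((p : ℝ) - 1) * g) (((q : ℝ) + 1) * g) = pts S ((p : ℝ) * g) ((q : ℝ) * g) := by
  ext y
  simp only [mem_pts]
  constructor
  · rintro ⟨hy, h1, h2⟩
    exact ⟨hy, h.mem_of_near hy h1 h2⟩
  · rintro ⟨hy, h1, h2⟩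
    have hg1 : ((p : ℝ) - 1) * g ≤ (p : ℝ) * g ∨ g < 0 := by
      by_cases hg : 0 ≤ g
      · left; nlinarith
      · right; linarith
    rcases hg1 with hg1 | hg1
    · refine ⟨hy, hg1.trans h1, h2.trans ?_⟩
      nlinarith [hg1]
    · -- g < 0 is impossible for a run with a point inside, but handle it: then p g ≤ y ≤ q g with p<q
      have : (q : ℝ) * g < (p : ℝ) * g := by
        have hpq : (p : ℝ) < q := by exact_mod_cast h.lt
        nlinarith
      linarith

/-- A run contains a point of `S` (in its first cell).
[cite: DyatlovJin2018, §2.1 (discretization)] -/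
theorem IsRun.exists_mem {p q : ℤ} (h : IsRun S g p q) (hg : 0 < g) :
    ∃ x ∈ S, (p : ℝ) * g ≤ x ∧ x ≤ (q : ℝ) * g := by
  obtain ⟨y, hy, h1, h2⟩ := h.meets p le_rfl h.lt
  refine ⟨y, hy, h1, h2.trans ?_⟩
  have : (p : ℝ) + 1 ≤ q := by exact_mod_cast h.lt
  nlinarith

/-- **Lemma 2.1(1)**, size of runs: a run at grid `g` of a `δ`-regular set (up to scale `h₀ ≤ g`,
`g ≤ 1`) consists of at most `C_R'` cells. [cite: DyatlovJin2018, Lemma 2.1(1), (e:regtree-1)] -/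
theorem IsRun.len_le {p q : ℤ} (h : IsRun S g p q) (hreg : RegUpTo δ CR h₀ w S)
    (hδ0 : 0 < δ) (hδ1 : δ < 1) (hCR : 1 ≤ CR) (hw : 0 < w) (hg : 0 < g) (hh : h₀ ≤ g)
    (hg1 : g ≤ 1) : ((q - p : ℤ) : ℝ) ≤ CR' δ CR := by
  -- M = q - p consecutive cells; every third one carries a disjoint centred interval of size g
  set M : ℤ := q - p with hM
  have hM1 : 1 ≤ M := by have := h.lt; omega
  set n : ℕ := (M.toNat - 1) / 3 + 1 with hn
  have hn3 : (M : ℝ) ≤ 3 * n := by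
    have : M.toNat ≤ 3 * n := by omega
    have hMM : (M.toNat : ℤ) = M := Int.toNat_of_nonneg (by omega)
    have : (M : ℤ) ≤ 3 * (n : ℤ) := by omega
    exact_mod_cast this
  have hnM : ∀ i : ℕ, i < n → p + 3 * (i : ℤ) < q := by
    intro i hi
    have : 3 * i ≤ M.toNat - 1 := by omega
    have hMM : (M.toNat : ℤ) = M := Int.toNat_of_nonneg (by omega)
    omega
  -- the blocks B_i
  let a : ℕ → ℝ := fun i => ((p : ℝ) + 3 * i) * g - g / 2
  let b : ℕ → ℝ := fun i => ((p : ℝ) + 3 * i + 1) * g + g / 2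
  have hblock : ∀ i : ℕ, i < n → CR⁻¹ * g ^ δ ≤ w * (cnt S (a i) (b i) : ℝ) := by
    intro i hi
    obtain ⟨y, hy, h1, h2⟩ := h.meets (p + 3 * i) (by omega) (hnM i hi)
    have hlow := hreg.lower y hy g hh hg1
    refine hlow.trans ?_
    apply mul_le_mul_of_nonneg_left _ hw.le
    exact_mod_cast cnt_mono (S := S) (a := y - g / 2) (b := y + g / 2) (a' := a i) (b' := b i)
      (by simp only [a]; push_cast at h1; linarith) (by simp only [b]; push_cast at h2; linarith)
  have hdisj : ∀ i ∈ Finset.range n, ∀ j ∈ Finset.range n, i ≠ j →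
      Disjoint (pts S (a i) (b i)) (pts S (a j) (b j)) := by
    intro i _ j _ hij
    rw [Finset.disjoint_left]
    intro y hyi hyj
    rw [mem_pts] at hyi hyj
    simp only [a, b] at hyi hyj
    rcases lt_or_gt_of_ne hij with hij | hij
    · have : (i : ℝ) + 1 ≤ j := by exact_mod_cast hij
      nlinarith [hyi.2.2, hyj.2.1]
    · have : (j : ℝ) + 1 ≤ i := by exact_mod_cast hij
      nlinarith [hyj.2.2, hyi.2.1]
  have hunion : (Finset.range n).biUnion (fun i => pts S (a i) (b i)) ⊆
      pts S ((p : ℝ) * g) ((q : ℝ) * g) := by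
    rw [← h.pts_widen]
    intro y hy
    rw [Finset.mem_biUnion] at hy
    obtain ⟨i, hi, hyi⟩ := hy
    rw [Finset.mem_range] at hi
    rw [mem_pts] at hyi ⊢
    simp only [a, b] at hyi
    refine ⟨hyi.1, ?_, ?_⟩
    · have : (0 : ℝ) ≤ 3 * i * g := by positivity
      nlinarith [hyi.2.1]
    · have hq : (p : ℝ) + 3 * i + 1 ≤ q := by exact_mod_cast hnM i hi
      nlinarith [hyi.2.2]
  have hcard : ∑ i ∈ Finset.range n, (cnt S (a i) (b i) : ℝ) ≤ cnt S ((p : ℝ) * g) ((q : ℝ) * g) := by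
    have := Finset.card_le_card hunion
    rw [Finset.card_biUnion hdisj] at this
    simp only [card_pts] at this
    exact_mod_cast this
  have hup : w * (cnt S ((p : ℝ) * g) ((q : ℝ) * g) : ℝ) ≤ CR * ((M : ℝ) * g) ^ δ := by
    have := hreg.upper ((p : ℝ) * g) ((q : ℝ) * g) (by
      have : (1 : ℝ) ≤ (q : ℝ) - p := by exact_mod_cast (show (1 : ℤ) ≤ q - p by omega)
      nlinarith)
    have e : (q : ℝ) * g - (p : ℝ) * g = (M : ℝ) * g := by simp only [hM]; push_cast; ring
    rwa [e] at this
  -- combine: n CR⁻¹ g^δ ≤ CR M^δ g^δ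
  have hsum : (n : ℝ) * (CR⁻¹ * g ^ δ) ≤ CR * ((M : ℝ) * g) ^ δ := by
    calc (n : ℝ) * (CR⁻¹ * g ^ δ) = ∑ i ∈ Finset.range n, CR⁻¹ * g ^ δ := by simp
      _ ≤ ∑ i ∈ Finset.range n, w * (cnt S (a i) (b i) : ℝ) :=
          Finset.sum_le_sum fun i hi => hblock i (Finset.mem_range.1 hi)
      _ = w * ∑ i ∈ Finset.range n, (cnt S (a i) (b i) : ℝ) := by rw [Finset.mul_sum]
      _ ≤ w * (cnt S ((p : ℝ) * g) ((q : ℝ) * g) : ℝ) := mul_le_mul_of_nonneg_left hcard hw.le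
      _ ≤ CR * ((M : ℝ) * g) ^ δ := hup
  have hMpos : (0 : ℝ) < M := by exact_mod_cast (show (0:ℤ) < M by omega)
  have hgδ : 0 < g ^ δ := Real.rpow_pos_of_pos hg δ
  have hCR0 : 0 < CR := by linarith
  rw [Real.mul_rpow hMpos.le hg.le] at hsum
  -- M ≤ 3 n ≤ 3 CR² M^δ
  have h3 : (M : ℝ) ≤ 3 * CR ^ 2 * (M : ℝ) ^ δ := by
    have : (n : ℝ) ≤ CR ^ 2 * (M : ℝ) ^ δ := by
      have h' : (n : ℝ) * (CR⁻¹ * g ^ δ) ≤ (CR ^ 2 * (M : ℝ) ^ δ) * (CR⁻¹ * g ^ δ) := by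
        calc (n : ℝ) * (CR⁻¹ * g ^ δ) ≤ CR * ((M : ℝ) ^ δ * g ^ δ) := hsum
          _ = (CR ^ 2 * (M : ℝ) ^ δ) * (CR⁻¹ * g ^ δ) := by field_simp
      exact le_of_mul_le_mul_right h' (by positivity)
    linarith
  -- hence M^{1-δ} ≤ 3 CR², M ≤ (3 CR²)^{1/(1-δ)}
  have hM1δ : (M : ℝ) ^ (1 - δ) ≤ 3 * CR ^ 2 := by
    have e : (M : ℝ) ^ (1 - δ) = (M : ℝ) / (M : ℝ) ^ δ := by
      rw [Real.rpow_sub hMpos, Real.rpow_one]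
    rw [e, div_le_iff₀ (Real.rpow_pos_of_pos hMpos δ)]
    exact h3
  have h1δ : 0 < 1 - δ := by linarith
  calc ((q - p : ℤ) : ℝ) = (M : ℝ) := by simp [hM]
    _ = ((M : ℝ) ^ (1 - δ)) ^ (1 / (1 - δ)) := by
        rw [← Real.rpow_mul hMpos.le, mul_one_div_cancel h1δ.ne', Real.rpow_one]
    _ ≤ (3 * CR ^ 2) ^ (1 / (1 - δ)) := by
        apply Real.rpow_le_rpow (Real.rpow_nonneg hMpos.le _) hM1δ
        positivity
    _ = CR' δ CR := rfl

/-- `C_R'^{1-δ} = 3 C_R²`. [folklore] -/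
theorem CR'_rpow_one_sub (hδ : δ < 1) (hCR : 1 ≤ CR) : (CR' δ CR) ^ (1 - δ) = 3 * CR ^ 2 := by
  unfold CR'
  have h1 : 0 < 1 - δ := by linarith
  rw [← Real.rpow_mul (by positivity), one_div_mul_cancel h1.ne', Real.rpow_one]

/-- `C_R² C_R'^δ ≤ C_R'`, used in Lemma 2.1(2). [cite: DyatlovJin2018, Lemma 2.1 (proof of part 2)] -/
theorem CR_sq_mul_le_CR' (hδ : δ < 1) (hCR : 1 ≤ CR) : CR ^ 2 * (CR' δ CR) ^ δ ≤ CR' δ CR := by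
  have hC : 0 < CR' δ CR := lt_of_lt_of_le one_pos (one_le_CR' hδ hCR)
  have hCδ : 0 ≤ (CR' δ CR) ^ δ := Real.rpow_nonneg hC.le _
  calc CR ^ 2 * (CR' δ CR) ^ δ ≤ (3 * CR ^ 2) * (CR' δ CR) ^ δ := by
        apply mul_le_mul_of_nonneg_right _ hCδ
        nlinarith
    _ = (CR' δ CR) ^ (1 - δ) * (CR' δ CR) ^ δ := by rw [CR'_rpow_one_sub hδ hCR]
    _ = CR' δ CR := by
        rw [← Real.rpow_add hC]; simp

/-- **Lemma 2.1(1)**, upper mass bound of a run. [cite: DyatlovJin2018, Lemma 2.1(1), (e:regtree-2)] -/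
theorem IsRun.mass_le {p q : ℤ} (h : IsRun S g p q) (hreg : RegUpTo δ CR h₀ w S)
    (hδ0 : 0 < δ) (hδ1 : δ < 1) (hCR : 1 ≤ CR) (hw : 0 < w) (hg : 0 < g) (hh : h₀ ≤ g)
    (hg1 : g ≤ 1) :
    w * (cnt S ((p : ℝ) * g) ((q : ℝ) * g) : ℝ) ≤ CR * (CR' δ CR) ^ δ * g ^ δ := by
  have hlen := h.len_le hreg hδ0 hδ1 hCR hw hg hh hg1
  have h1 : (1 : ℝ) ≤ (q : ℝ) - p := by exact_mod_cast (show (1 : ℤ) ≤ q - p by have := h.lt; omega)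
  have hup := hreg.upper ((p : ℝ) * g) ((q : ℝ) * g) (by nlinarith)
  refine hup.trans ?_
  have e : (q : ℝ) * g - (p : ℝ) * g = ((q : ℝ) - p) * g := by ring
  rw [e, Real.mul_rpow (by linarith) hg.le, ← mul_assoc]
  apply mul_le_mul_of_nonneg_right _ (Real.rpow_nonneg hg.le _)
  apply mul_le_mul_of_nonneg_left _ (by linarith)
  apply Real.rpow_le_rpow (by linarith) _ hδ0.le
  have : ((q - p : ℤ) : ℝ) = (q : ℝ) - p := by push_cast; ring
  linarith

/-- **Lemma 2.1(1)**, lower mass bound of a run. [cite: DyatlovJin2018, Lemma 2.1(1), (e:regtree-2)] -/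
theorem IsRun.mass_ge {p q : ℤ} (h : IsRun S g p q) (hreg : RegUpTo δ CR h₀ w S)
    (hw : 0 < w) (hg : 0 < g) (hh : h₀ ≤ g) (hg1 : g ≤ 1) {x : ℝ} (hx : x ∈ S)
    (h1 : (p : ℝ) * g ≤ x) (h2 : x ≤ (q : ℝ) * g) :
    CR⁻¹ * g ^ δ ≤ w * (cnt S ((p : ℝ) * g) ((q : ℝ) * g) : ℝ) := by
  have hlow := hreg.lower x hx g hh hg1
  refine hlow.trans (mul_le_mul_of_nonneg_left ?_ hw.le)
  have hsub : pts S (x - g / 2) (x + g / 2) ⊆ pts S ((p : ℝ) * g) ((q : ℝ) * g) := by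
    rw [← h.pts_widen]
    apply pts_mono
    · have : ((p : ℝ) - 1) * g = (p : ℝ) * g - g := by ring
      rw [this]; linarith
    · have : ((q : ℝ) + 1) * g = (q : ℝ) * g + g := by ring
      rw [this]; linarith
  exact_mod_cast Finset.card_le_card hsub

/-- **Lemma 2.1(2)**: a child carries at least the fraction `L^{-δ}/C_R'` of the points of its
parent. [cite: DyatlovJin2018, Lemma 2.1(2), (e:convex-coeff-bound)] -/
theorem child_card_ratio (hreg : RegUpTo δ CR h₀ w S) (hδ0 : 0 < δ) (hδ1 : δ < 1) (hCR : 1 ≤ CR)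
    (hw : 0 < w) (hg : 0 < g) {L : ℕ} (hL : 0 < L) (hh : h₀ ≤ g / L) (hg1 : g ≤ 1)
    {x : ℝ} (hx : x ∈ S) :
    (L : ℝ) ^ (-δ) / CR' δ CR ≤ ((runPts S (g / L) x).card : ℝ) / (runPts S g x).card := by
  have hL' : (0 : ℝ) < L := by exact_mod_cast hL
  have hL1 : (1 : ℝ) ≤ L := by exact_mod_cast hL
  have hg' : 0 < g / L := by positivity
  have hhg : h₀ ≤ g := hh.trans (div_le_self hg.le hL1)
  have hg1' : g / L ≤ 1 := (div_le_self hg.le hL1).trans hg1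
  have R := isRun_loIdx_hiIdx hg hx
  have R' := isRun_loIdx_hiIdx hg' hx
  have hup := R.mass_le hreg hδ0 hδ1 hCR hw hg hhg hg1
  have hlo := R'.mass_ge hreg hw hg' hh hg1' hx (lo_le_self hg' x) (self_le_hi hg' x)
  have hC : 0 < CR' δ CR := lt_of_lt_of_le one_pos (one_le_CR' hδ1 hCR)
  have hCR0 : 0 < CR := by linarith
  have hcard_pos : (0 : ℝ) < (runPts S g x).card := by
    exact_mod_cast Finset.card_pos.2 (runPts_nonempty hg hx)
  rw [div_le_div_iff₀ hC hcard_pos]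
  -- L^{-δ} * #parent ≤ CR' * #child
  have e1 : (g / L) ^ δ = g ^ δ * (L : ℝ) ^ (-δ) := by
    rw [Real.div_rpow hg.le hL'.le, Real.rpow_neg hL'.le, div_eq_mul_inv]
  have hpar : w * ((runPts S g x).card : ℝ) ≤ CR * (CR' δ CR) ^ δ * g ^ δ := hup
  have hchi : CR⁻¹ * (g ^ δ * (L : ℝ) ^ (-δ)) ≤ w * ((runPts S (g / L) x).card : ℝ) := by
    rw [← e1]; exact hlo
  have hgδ : 0 < g ^ δ := Real.rpow_pos_of_pos hg δ
  have hLδ : 0 < (L : ℝ) ^ (-δ) := Real.rpow_pos_of_pos hL' _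
  have key := CR_sq_mul_le_CR' hδ1 hCR
  -- multiply through
  have h3 : (L : ℝ) ^ (-δ) * (w * ((runPts S g x).card : ℝ)) ≤
      CR' δ CR * (w * ((runPts S (g / L) x).card : ℝ)) := by
    calc (L : ℝ) ^ (-δ) * (w * ((runPts S g x).card : ℝ))
        ≤ (L : ℝ) ^ (-δ) * (CR * (CR' δ CR) ^ δ * g ^ δ) :=
          mul_le_mul_of_nonneg_left hpar hLδ.le
      _ = (CR ^ 2 * (CR' δ CR) ^ δ) * (CR⁻¹ * (g ^ δ * (L : ℝ) ^ (-δ))) := by field_simp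
      _ ≤ CR' δ CR * (CR⁻¹ * (g ^ δ * (L : ℝ) ^ (-δ))) :=
          mul_le_mul_of_nonneg_right key (by positivity)
      _ ≤ CR' δ CR * (w * ((runPts S (g / L) x).card : ℝ)) :=
          mul_le_mul_of_nonneg_left hchi hC.le
  have h4 : w * ((L : ℝ) ^ (-δ) * ((runPts S g x).card : ℝ)) ≤
      w * (((runPts S (g / L) x).card : ℝ) * CR' δ CR) := by
    calc w * ((L : ℝ) ^ (-δ) * ((runPts S g x).card : ℝ))
        = (L : ℝ) ^ (-δ) * (w * ((runPts S g x).card : ℝ)) := by ring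
      _ ≤ CR' δ CR * (w * ((runPts S (g / L) x).card : ℝ)) := h3
      _ = w * (((runPts S (g / L) x).card : ℝ) * CR' δ CR) := by ring
  exact le_of_mul_le_mul_left h4 hw

/-- Length of the run of a point, real form. [cite: DyatlovJin2018, Lemma 2.1(1), (e:regtree-1)] -/
theorem run_len_le (hreg : RegUpTo δ CR h₀ w S) (hδ0 : 0 < δ) (hδ1 : δ < 1) (hCR : 1 ≤ CR)
    (hw : 0 < w) (hg : 0 < g) (hh : h₀ ≤ g) (hg1 : g ≤ 1) {x : ℝ} (hx : x ∈ S) :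
    (hiIdx S g x : ℝ) * g - (loIdx S g x : ℝ) * g ≤ CR' δ CR * g := by
  have := (isRun_loIdx_hiIdx hg hx).len_le hreg hδ0 hδ1 hCR hw hg hh hg1
  have e : ((hiIdx S g x - loIdx S g x : ℤ) : ℝ) = (hiIdx S g x : ℝ) - loIdx S g x := by push_cast; ring
  rw [e] at this
  nlinarith

/-- Centre of the run of `y` at grid `g`. [cite: DyatlovJin2018, §2.1] -/
noncomputable def ctr (S : Finset ℝ) (g : ℝ) (y : ℝ) : ℝ :=
  ((loIdx S g y : ℝ) * g + (hiIdx S g y : ℝ) * g) / 2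

/-- Points of a run interval are within `C_R' g/2` of its centre. [cite: DyatlovJin2018, Lemma 2.1(1), (e:regtree-1)] -/
theorem abs_sub_ctr_le (hreg : RegUpTo δ CR h₀ w S) (hδ0 : 0 < δ) (hδ1 : δ < 1) (hCR : 1 ≤ CR)
    (hw : 0 < w) (hg : 0 < g) (hh : h₀ ≤ g) (hg1 : g ≤ 1) {y : ℝ} (hy : y ∈ S) {x' : ℝ}
    (h1 : (loIdx S g y : ℝ) * g ≤ x') (h2 : x' ≤ (hiIdx S g y : ℝ) * g) :
    |x' - ctr S g y| ≤ CR' δ CR * g / 2 := by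
  have hlen := run_len_le hreg hδ0 hδ1 hCR hw hg hh hg1 hy
  rw [abs_le, ctr]
  constructor <;> linarith

/-- **Lemma 2.1(3)**: once `L^{1/3} ≥ 4 C_R' C_R^{2/δ}`, every run `I` at grid `g` has two children
`I', I''` (runs at grid `g/L` of points of `I`) with
`½ C_R^{-2/δ} g L^{-2/3} ≤ x' - x'' ≤ 2 g L^{-2/3}` for all `x' ∈ I'`, `x'' ∈ I''`.
[cite: DyatlovJin2018, Lemma 2.1(3), (e:tree-L-bound)] -/
theorem IsRun.exists_far_children {p q : ℤ} (h : IsRun S g p q) (hreg : RegUpTo δ CR h₀ w S)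
    (hδ0 : 0 < δ) (hδ1 : δ < 1) (hCR : 1 ≤ CR) (hw : 0 < w) (hg : 0 < g) {L : ℕ} (hL : 0 < L)
    (hh : h₀ ≤ g / L) (hg1 : g ≤ 1)
    (hLbig : 4 * CR' δ CR * CR ^ (2 / δ) ≤ (L : ℝ) ^ (1 / 3 : ℝ)) :
    ∃ x₁ ∈ pts S ((p : ℝ) * g) ((q : ℝ) * g), ∃ x₂ ∈ pts S ((p : ℝ) * g) ((q : ℝ) * g),
      ∀ x' : ℝ, (loIdx S (g / L) x₁ : ℝ) * (g / L) ≤ x' → x' ≤ (hiIdx S (g / L) x₁ : ℝ) * (g / L) →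
      ∀ x'' : ℝ, (loIdx S (g / L) x₂ : ℝ) * (g / L) ≤ x'' →
        x'' ≤ (hiIdx S (g / L) x₂ : ℝ) * (g / L) →
        CR ^ (-(2 / δ)) / 2 * (g * (L : ℝ) ^ (-(2 / 3 : ℝ))) ≤ x' - x'' ∧
          x' - x'' ≤ 2 * (g * (L : ℝ) ^ (-(2 / 3 : ℝ))) := by
  have hL' : (0 : ℝ) < L := by exact_mod_cast hL
  have hL1 : (1 : ℝ) ≤ L := by exact_mod_cast hL
  have hg' : 0 < g / L := by positivity
  have hhg : h₀ ≤ g := hh.trans (div_le_self hg.le hL1)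
  have hg1' : g / L ≤ 1 := (div_le_self hg.le hL1).trans hg1
  have hC1 : 1 ≤ CR' δ CR := one_le_CR' hδ1 hCR
  have hC : 0 < CR' δ CR := lt_of_lt_of_le one_pos hC1
  have hCR0 : 0 < CR := by linarith
  set ρ : ℝ := g * (L : ℝ) ^ (-(2 / 3 : ℝ)) with hρ
  set g₁ : ℝ := g / L with hg₁
  -- basic facts on ρ
  have hL23 : (L : ℝ) ^ (-(2 / 3 : ℝ)) ≤ 1 :=
    Real.rpow_le_one_of_one_le_of_nonpos hL1 (by norm_num)
  have hL23' : (L : ℝ)⁻¹ ≤ (L : ℝ) ^ (-(2 / 3 : ℝ)) := by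
    rw [← Real.rpow_neg_one]
    exact Real.rpow_le_rpow_of_exponent_le hL1 (by norm_num)
  have hρpos : 0 < ρ := by positivity
  have hρg : ρ ≤ g := by simpa using mul_le_mul_of_nonneg_left hL23 hg.le
  have hρ1 : ρ ≤ 1 := hρg.trans hg1
  have hg₁ρ : g₁ ≤ ρ := by
    have : g / L = g * (L : ℝ)⁻¹ := div_eq_mul_inv _ _
    rw [hg₁, this]; exact mul_le_mul_of_nonneg_left hL23' hg.le
  have hhρ : h₀ ≤ ρ := hh.trans hg₁ρ
  -- the key numerical consequence of hLbig : 4 CR' g₁ ≤ CR^{-2/δ} ρ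
  have hA : 0 < CR ^ (-(2 / δ)) := Real.rpow_pos_of_pos hCR0 _
  have hA1 : CR ^ (-(2 / δ)) ≤ 1 := Real.rpow_le_one_of_one_le_of_nonpos hCR (by
    have : 0 < 2 / δ := by positivity
    linarith)
  have hkey : 4 * CR' δ CR * g₁ ≤ CR ^ (-(2 / δ)) * ρ := by
    -- multiply hLbig by g * L^{-1} * CR^{-2/δ}
    have e1 : (L : ℝ) ^ (1 / 3 : ℝ) * (L : ℝ)⁻¹ = (L : ℝ) ^ (-(2 / 3 : ℝ)) := by
      rw [← Real.rpow_neg_one, ← Real.rpow_add hL']; norm_num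
    have e2 : CR ^ (2 / δ) * CR ^ (-(2 / δ)) = 1 := by
      rw [← Real.rpow_add hCR0]; simp
    have := mul_le_mul_of_nonneg_right hLbig (show 0 ≤ g * (L : ℝ)⁻¹ * CR ^ (-(2 / δ)) by positivity)
    calc 4 * CR' δ CR * g₁ = 4 * CR' δ CR * g₁ * (CR ^ (2 / δ) * CR ^ (-(2 / δ))) := by rw [e2, mul_one]
      _ = 4 * CR' δ CR * CR ^ (2 / δ) * (g * (L : ℝ)⁻¹ * CR ^ (-(2 / δ))) := by
          rw [hg₁, div_eq_mul_inv]; ring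
      _ ≤ (L : ℝ) ^ (1 / 3 : ℝ) * (g * (L : ℝ)⁻¹ * CR ^ (-(2 / δ))) := this
      _ = CR ^ (-(2 / δ)) * (g * ((L : ℝ) ^ (1 / 3 : ℝ) * (L : ℝ)⁻¹)) := by ring
      _ = CR ^ (-(2 / δ)) * ρ := by rw [e1]
  -- a point x of the run and the small interval J around it
  obtain ⟨x, hxS, hx1, hx2⟩ := h.exists_mem hg
  set J : Finset ℝ := pts S (x - ρ / 2) (x + ρ / 2) with hJ
  have hxJ : x ∈ J := mem_pts.2 ⟨hxS, by linarith, by linarith⟩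
  have hJsub : J ⊆ pts S ((p : ℝ) * g) ((q : ℝ) * g) := by
    rw [← h.pts_widen]
    apply pts_mono <;> linarith
  -- extreme centres
  obtain ⟨y₁, hy₁J, hy₁max⟩ := Finset.exists_max_image J (ctr S g₁) ⟨x, hxJ⟩
  obtain ⟨y₂, hy₂J, hy₂min⟩ := Finset.exists_min_image J (ctr S g₁) ⟨x, hxJ⟩
  have hy₁S : y₁ ∈ S := pts_subset _ _ _ hy₁J
  have hy₂S : y₂ ∈ S := pts_subset _ _ _ hy₂J
  have hnear : ∀ y ∈ S, ∀ x' : ℝ, (loIdx S g₁ y : ℝ) * g₁ ≤ x' → x' ≤ (hiIdx S g₁ y : ℝ) * g₁ →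
      |x' - ctr S g₁ y| ≤ CR' δ CR * g₁ / 2 := fun y hy x' h1 h2 =>
    abs_sub_ctr_le hreg hδ0 hδ1 hCR hw hg' hh hg1' hy h1 h2
  have hself : ∀ y ∈ S, |y - ctr S g₁ y| ≤ CR' δ CR * g₁ / 2 := fun y hy =>
    hnear y hy y (lo_le_self hg' y) (self_le_hi hg' y)
  set D : ℝ := ctr S g₁ y₁ - ctr S g₁ y₂ with hD
  -- upper bound on D
  have hDup : D ≤ ρ + CR' δ CR * g₁ := by
    have a1 := hself y₁ hy₁S
    have a2 := hself y₂ hy₂S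
    rw [abs_le] at a1 a2
    have b1 := (mem_pts.1 hy₁J).2.2
    have b2 := (mem_pts.1 hy₂J).2.1
    simp only [hD]; linarith
  -- lower bound on D via regularity
  have hJsub2 : J ⊆ pts S (ctr S g₁ y₂ - CR' δ CR * g₁ / 2) (ctr S g₁ y₁ + CR' δ CR * g₁ / 2) := by
    intro y hy
    have hyS : y ∈ S := pts_subset _ _ _ hy
    have a := hself y hyS
    rw [abs_le] at a
    have m1 := hy₁max y hy
    have m2 := hy₂min y hy
    exact mem_pts.2 ⟨hyS, by linarith, by linarith⟩
  have hlowJ : CR⁻¹ * ρ ^ δ ≤ w * (J.card : ℝ) := by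
    have := hreg.lower x hxS ρ hhρ hρ1
    simpa [hJ, card_pts] using this
  have hD0 : 0 ≤ D := by have := hy₁max y₂ hy₂J; simp only [hD]; linarith
  have hupJ : w * (J.card : ℝ) ≤ CR * (D + CR' δ CR * g₁) ^ δ := by
    have hlen : h₀ ≤ (ctr S g₁ y₁ + CR' δ CR * g₁ / 2) - (ctr S g₁ y₂ - CR' δ CR * g₁ / 2) := by
      have : g₁ ≤ CR' δ CR * g₁ := by nlinarith
      linarith [hh]
    have := hreg.upper _ _ hlen
    have e : (ctr S g₁ y₁ + CR' δ CR * g₁ / 2) - (ctr S g₁ y₂ - CR' δ CR * g₁ / 2) =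
        D + CR' δ CR * g₁ := by simp only [hD]; ring
    rw [e] at this
    refine le_trans ?_ this
    apply mul_le_mul_of_nonneg_left _ hw.le
    exact_mod_cast Finset.card_le_card hJsub2
  have hDlow : CR ^ (-(2 / δ)) * ρ ≤ D + CR' δ CR * g₁ := by
    have h1 : (CR ^ (-(2 / δ)) * ρ) ^ δ ≤ (D + CR' δ CR * g₁) ^ δ := by
      have e : (CR ^ (-(2 / δ)) * ρ) ^ δ = CR⁻¹ * (CR⁻¹ * ρ ^ δ) := by
        rw [Real.mul_rpow hA.le hρpos.le, ← Real.rpow_mul hCR0.le]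
        have : -(2 / δ) * δ = -2 := by field_simp
        rw [this, Real.rpow_neg hCR0.le, Real.rpow_two]; field_simp
      rw [e]
      have h2 : CR⁻¹ * (CR⁻¹ * ρ ^ δ) ≤ CR⁻¹ * (CR * (D + CR' δ CR * g₁) ^ δ) :=
        mul_le_mul_of_nonneg_left (hlowJ.trans hupJ) (by positivity)
      calc CR⁻¹ * (CR⁻¹ * ρ ^ δ) ≤ CR⁻¹ * (CR * (D + CR' δ CR * g₁) ^ δ) := h2
        _ = (D + CR' δ CR * g₁) ^ δ := by field_simp
    exact (Real.rpow_le_rpow_iff (by positivity) (by positivity) hδ0).1 h1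
  refine ⟨y₁, hJsub hy₁J, y₂, hJsub hy₂J, fun x' h1' h2' x'' h1'' h2'' => ?_⟩
  have c1 := hnear y₁ hy₁S x' h1' h2'
  have c2 := hnear y₂ hy₂S x'' h1'' h2''
  rw [abs_le] at c1 c2
  have hAρ : CR ^ (-(2 / δ)) * ρ ≤ ρ := mul_le_of_le_one_left hρpos.le hA1
  constructor
  · -- x' - x'' ≥ D - CR' g₁ ≥ CR^{-2/δ} ρ - 2 CR' g₁ ≥ ½ CR^{-2/δ} ρ
    linarith [hkey, hDlow, c1.1, c2.2, hD]
  · linarith [hkey, hDup, c1.2, c2.1, hAρ, hD]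

end TreeReg

/-! ### C. Trigonometric sums and the `𝒞_θ` norms -/

/-- `ex t = e^{it}`. [folklore] -/
noncomputable def ex (t : ℝ) : ℂ := Complex.exp ((t : ℂ) * Complex.I)

/-- `|e^{it}| = 1`. [folklore] -/
theorem norm_ex (t : ℝ) : ‖ex t‖ = 1 := Complex.norm_exp_ofReal_mul_I t

/-- `e^{i(s+t)} = e^{is} e^{it}`. [folklore] -/
theorem ex_add (s t : ℝ) : ex (s + t) = ex s * ex t := by
  unfold ex; rw [← Complex.exp_add]; push_cast; ring_nf

/-- `|e^{it} - 1| = |2 sin(t/2)|`. [folklore] -/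
theorem norm_ex_sub_one (t : ℝ) : ‖ex t - 1‖ = |2 * Real.sin (t / 2)| := by
  have h := Complex.norm_exp_I_mul_ofReal_sub_one t
  rw [Real.norm_eq_abs] at h
  rw [ex, mul_comm]
  exact h

/-- **Lemma 2.6** (`|e^{iτ}-1| ≥ 2|τ|/π` for `|τ| ≤ π`). [cite: DyatlovJin2018, Lemma 2.6] -/
theorem norm_ex_sub_one_ge {τ : ℝ} (hτ : |τ| ≤ Real.pi) : 2 / Real.pi * |τ| ≤ ‖ex τ - 1‖ := by
  rw [norm_ex_sub_one]
  have h2 : |τ / 2| ≤ Real.pi / 2 := by rw [abs_div, abs_two]; linarith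
  have h := Real.mul_abs_le_abs_sin h2
  rw [abs_div, abs_two] at h
  rw [abs_mul, abs_two]
  linarith

/-- The normalised trigonometric sum `(#P)⁻¹ ∑_{y ∈ P} e^{i c (y-ζ) x} f(y)` (the functions `F_J`
of the paper, (e:F-J), for the counting measure and the bilinear phase).
[cite: DyatlovJin2018, (e:F-J)] -/
noncomputable def TS (P : Finset ℝ) (ζ c : ℝ) (f : ℝ → ℂ) (x : ℝ) : ℂ :=
  (P.card : ℂ)⁻¹ * ∑ y ∈ P, ex (c * (y - ζ) * x) * f y

/-- The derivative of `TS P ζ c f`. [cite: DyatlovJin2018, (e:F-J)] -/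
noncomputable def TS' (P : Finset ℝ) (ζ c : ℝ) (f : ℝ → ℂ) (x : ℝ) : ℂ :=
  (P.card : ℂ)⁻¹ * ∑ y ∈ P, (((c * (y - ζ) : ℝ) : ℂ) * Complex.I * ex (c * (y - ζ) * x)) * f y

/-- `d/dx e^{iκx} = iκ e^{iκx}`. [folklore] -/
theorem hasDerivAt_ex_mul (κ x : ℝ) :
    HasDerivAt (fun x : ℝ => ex (κ * x)) ((κ : ℂ) * Complex.I * ex (κ * x)) x := by
  have h1 : HasDerivAt (fun w : ℂ => w * ((κ : ℂ) * Complex.I)) ((κ : ℂ) * Complex.I) (x : ℂ) := by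
    simpa using (hasDerivAt_id (x : ℂ)).mul_const ((κ : ℂ) * Complex.I)
  have h2 := h1.cexp.comp_ofReal
  have e : (fun x : ℝ => ex (κ * x)) = fun y : ℝ => Complex.exp ((y : ℂ) * ((κ : ℂ) * Complex.I)) := by
    funext y; unfold ex; push_cast; ring_nf
  rw [e]
  convert h2 using 1
  unfold ex; push_cast; ring_nf

/-- `TS'` is the derivative of `TS`. [folklore] -/
theorem hasDerivAt_TS (P : Finset ℝ) (ζ c : ℝ) (f : ℝ → ℂ) (x : ℝ) :
    HasDerivAt (TS P ζ c f) (TS' P ζ c f x) x := by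
  unfold TS TS'
  apply HasDerivAt.const_mul
  apply HasDerivAt.fun_sum
  intro y _
  exact (hasDerivAt_ex_mul (c * (y - ζ)) x).mul_const (f y)

/-- `ex` is continuous. [folklore] -/
theorem continuous_ex : Continuous ex := by
  unfold ex; fun_prop

/-- `TS` is continuous. [folklore] -/
theorem continuous_TS (P : Finset ℝ) (ζ c : ℝ) (f : ℝ → ℂ) : Continuous (TS P ζ c f) := by
  unfold TS
  have := continuous_ex
  fun_prop

/-- `TS'` is continuous. [folklore] -/
theorem continuous_TS' (P : Finset ℝ) (ζ c : ℝ) (f : ℝ → ℂ) : Continuous (TS' P ζ c f) := by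
  unfold TS'
  have := continuous_ex
  fun_prop

/-- `|F_J(x)| ≤` the average of `|f|` over `J` (Hölder in (e:F-J)). [cite: DyatlovJin2018, Proposition 3.1 (proof, start of iteration)] -/
theorem norm_TS_le (P : Finset ℝ) (ζ c : ℝ) (f : ℝ → ℂ) (x : ℝ) :
    ‖TS P ζ c f x‖ ≤ (P.card : ℝ)⁻¹ * ∑ y ∈ P, ‖f y‖ := by
  unfold TS
  rw [norm_mul, norm_inv, Complex.norm_natCast]
  apply mul_le_mul_of_nonneg_left _ (by positivity)
  refine (norm_sum_le _ _).trans ?_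
  apply Finset.sum_le_sum
  intro y _
  rw [norm_mul, norm_ex, one_mul]

/-- `|F_J'(x)| ≤ |c| ρ ·` average of `|f|`, when the frequencies are within `ρ` of the centre. [cite: DyatlovJin2018, Proposition 3.1 (proof, start of iteration)] -/
theorem norm_TS'_le (P : Finset ℝ) (ζ c : ℝ) (f : ℝ → ℂ) (x : ℝ) {ρ : ℝ}
    (hρ : ∀ y ∈ P, |y - ζ| ≤ ρ) :
    ‖TS' P ζ c f x‖ ≤ |c| * ρ * ((P.card : ℝ)⁻¹ * ∑ y ∈ P, ‖f y‖) := by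
  unfold TS'
  rw [norm_mul, norm_inv, Complex.norm_natCast]
  have : ‖∑ y ∈ P, (((c * (y - ζ) : ℝ) : ℂ) * Complex.I * ex (c * (y - ζ) * x)) * f y‖ ≤
      ∑ y ∈ P, |c| * ρ * ‖f y‖ := by
    refine (norm_sum_le _ _).trans (Finset.sum_le_sum fun y hy => ?_)
    rw [norm_mul, norm_mul, norm_mul, norm_ex, Complex.norm_I, Complex.norm_real, Real.norm_eq_abs,
      abs_mul, mul_one, mul_one]
    apply mul_le_mul_of_nonneg_right _ (norm_nonneg _)
    exact mul_le_mul_of_nonneg_left (hρ y hy) (abs_nonneg _)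
  calc (P.card : ℝ)⁻¹ * ‖∑ y ∈ P, (((c * (y - ζ) : ℝ) : ℂ) * Complex.I * ex (c * (y - ζ) * x)) * f y‖
      ≤ (P.card : ℝ)⁻¹ * ∑ y ∈ P, |c| * ρ * ‖f y‖ := mul_le_mul_of_nonneg_left this (by positivity)
    _ = |c| * ρ * ((P.card : ℝ)⁻¹ * ∑ y ∈ P, ‖f y‖) := by rw [← Finset.mul_sum]; ring

/-- Recentring a trigonometric sum multiplies it by a linear phase.
[cite: DyatlovJin2018, (e:F-J-iterative)] -/
theorem TS_recenter (P : Finset ℝ) (ζ ζ' c : ℝ) (f : ℝ → ℂ) (x : ℝ) :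
    TS P ζ c f x = ex (c * (ζ' - ζ) * x) * TS P ζ' c f x := by
  unfold TS
  rw [Finset.mul_sum, Finset.mul_sum, Finset.mul_sum]
  apply Finset.sum_congr rfl
  intro y _
  have : c * (y - ζ) * x = c * (ζ' - ζ) * x + c * (y - ζ') * x := by ring
  rw [this, ex_add]; ring

/-- Recentring formula for the derivative `TS'`. [folklore] -/
theorem TS'_recenter (P : Finset ℝ) (ζ ζ' c : ℝ) (f : ℝ → ℂ) (x : ℝ) :
    TS' P ζ c f x = ((c * (ζ' - ζ) : ℝ) : ℂ) * Complex.I * ex (c * (ζ' - ζ) * x) * TS P ζ' c f x +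
      ex (c * (ζ' - ζ) * x) * TS' P ζ' c f x := by
  unfold TS TS'
  rw [Finset.mul_sum, Finset.mul_sum, Finset.mul_sum, Finset.mul_sum, Finset.mul_sum,
    ← Finset.sum_add_distrib]
  apply Finset.sum_congr rfl
  intro y _
  have : c * (y - ζ) * x = c * (ζ' - ζ) * x + c * (y - ζ') * x := by ring
  rw [this, ex_add]
  push_cast
  ring

/-- Recentring does not change `|TS|`. [folklore] -/
theorem norm_TS_recenter (P : Finset ℝ) (ζ ζ' c : ℝ) (f : ℝ → ℂ) (x : ℝ) :
    ‖TS P ζ c f x‖ = ‖TS P ζ' c f x‖ := by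
  rw [TS_recenter P ζ ζ' c f x, norm_mul, norm_ex, one_mul]

/-- Recentring changes `|TS'|` by at most `|c||ζ'-ζ||TS|` (product rule, cf. Lemma 2.3). [cite: DyatlovJin2018, Lemma 2.3 (proof)] -/
theorem norm_TS'_recenter_le (P : Finset ℝ) (ζ ζ' c : ℝ) (f : ℝ → ℂ) (x : ℝ) :
    ‖TS' P ζ c f x‖ ≤ |c| * |ζ' - ζ| * ‖TS P ζ' c f x‖ + ‖TS' P ζ' c f x‖ := by
  rw [TS'_recenter P ζ ζ' c f x]
  refine (norm_add_le _ _).trans ?_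
  rw [norm_mul, norm_mul, norm_mul, norm_ex, Complex.norm_I, Complex.norm_real, Real.norm_eq_abs,
    abs_mul, norm_mul, norm_ex]
  simp

/-- Fibre decomposition of a trigonometric sum along a key map (children of a run):
`F_J = ∑_b q_b e^{iΨ_b} F_{J_b}` in the form with the parent centre.
[cite: DyatlovJin2018, (e:F-J-iterative)] -/
theorem TS_fiberwise {ι : Type*} [DecidableEq ι] (P : Finset ℝ) (key : ℝ → ι) (ζ c : ℝ)
    (f : ℝ → ℂ) (x : ℝ) (hP : P.Nonempty) :
    TS P ζ c f x = ∑ b ∈ P.image key,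
      (((P.filter (fun y => key y = b)).card : ℂ) / (P.card : ℂ)) *
        TS (P.filter (fun y => key y = b)) ζ c f x := by
  unfold TS
  have hP0 : (P.card : ℂ) ≠ 0 := by exact_mod_cast (Finset.card_pos.2 hP).ne'
  have : ∀ b ∈ P.image key,
      (((P.filter (fun y => key y = b)).card : ℂ) / (P.card : ℂ)) *
        ((((P.filter (fun y => key y = b)).card : ℂ))⁻¹ *
          ∑ y ∈ P.filter (fun y => key y = b), ex (c * (y - ζ) * x) * f y) =
      (P.card : ℂ)⁻¹ * ∑ y ∈ P.filter (fun y => key y = b), ex (c * (y - ζ) * x) * f y := by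
    intro b hb
    have hne : ((P.filter (fun y => key y = b)).card : ℂ) ≠ 0 := by
      rw [Finset.mem_image] at hb
      obtain ⟨y, hy, rfl⟩ := hb
      have hmem : y ∈ P.filter (fun z => key z = key y) := Finset.mem_filter.2 ⟨hy, rfl⟩
      exact_mod_cast (Finset.card_pos.2 ⟨y, hmem⟩).ne'
    rw [← mul_assoc]
    congr 1
    field_simp
  rw [Finset.sum_congr rfl this, ← Finset.mul_sum, Finset.sum_fiberwise_of_maps_to]
  intro y hy; exact Finset.mem_image_of_mem _ hy

/-- Fibre decomposition of `TS'` along a key map. [folklore] -/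
theorem TS'_fiberwise {ι : Type*} [DecidableEq ι] (P : Finset ℝ) (key : ℝ → ι) (ζ c : ℝ)
    (f : ℝ → ℂ) (x : ℝ) (hP : P.Nonempty) :
    TS' P ζ c f x = ∑ b ∈ P.image key,
      (((P.filter (fun y => key y = b)).card : ℂ) / (P.card : ℂ)) *
        TS' (P.filter (fun y => key y = b)) ζ c f x := by
  unfold TS'
  have hP0 : (P.card : ℂ) ≠ 0 := by exact_mod_cast (Finset.card_pos.2 hP).ne'
  have : ∀ b ∈ P.image key,
      (((P.filter (fun y => key y = b)).card : ℂ) / (P.card : ℂ)) *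
        ((((P.filter (fun y => key y = b)).card : ℂ))⁻¹ *
          ∑ y ∈ P.filter (fun y => key y = b),
            (((c * (y - ζ) : ℝ) : ℂ) * Complex.I * ex (c * (y - ζ) * x)) * f y) =
      (P.card : ℂ)⁻¹ * ∑ y ∈ P.filter (fun y => key y = b),
            (((c * (y - ζ) : ℝ) : ℂ) * Complex.I * ex (c * (y - ζ) * x)) * f y := by
    intro b hb
    have hne : ((P.filter (fun y => key y = b)).card : ℂ) ≠ 0 := by
      rw [Finset.mem_image] at hb
      obtain ⟨y, hy, rfl⟩ := hb
      have hmem : y ∈ P.filter (fun z => key z = key y) := Finset.mem_filter.2 ⟨hy, rfl⟩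
      exact_mod_cast (Finset.card_pos.2 ⟨y, hmem⟩).ne'
    rw [← mul_assoc]
    congr 1
    field_simp
  rw [Finset.sum_congr rfl this, ← Finset.mul_sum, Finset.sum_fiberwise_of_maps_to]
  intro y hy; exact Finset.mem_image_of_mem _ hy

/-! #### Sup norms on intervals and the `𝒞_θ` norm -/

/-- `supN F a b = sup_{[a,b]} |F|`. [cite: DyatlovJin2018, §2.2] -/
noncomputable def supN (F : ℝ → ℂ) (a b : ℝ) : ℝ := sSup ((fun x => ‖F x‖) '' Set.Icc a b)

section SupN

variable {F : ℝ → ℂ} {a b : ℝ}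

/-- The image of a compact interval under `|F|` is bounded above. [folklore] -/
theorem supN_bddAbove (hF : Continuous F) (a b : ℝ) :
    BddAbove ((fun x => ‖F x‖) '' Set.Icc a b) :=
  (isCompact_Icc.image (continuous_norm.comp hF)).bddAbove

/-- `|F x| ≤ supN F a b` for `x ∈ [a,b]`. [folklore] -/
theorem le_supN (hF : Continuous F) {x : ℝ} (hx : x ∈ Set.Icc a b) : ‖F x‖ ≤ supN F a b :=
  le_csSup (supN_bddAbove hF a b) ⟨x, hx, rfl⟩

/-- `supN F a b ≤ M` from a pointwise bound. [folklore] -/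
theorem supN_le (hab : a ≤ b) {M : ℝ} (h : ∀ x ∈ Set.Icc a b, ‖F x‖ ≤ M) : supN F a b ≤ M :=
  csSup_le ((Set.nonempty_Icc.2 hab).image _) (by rintro _ ⟨x, hx, rfl⟩; exact h x hx)

/-- `0 ≤ supN F a b`. [folklore] -/
theorem supN_nonneg (hab : a ≤ b) (hF : Continuous F) : 0 ≤ supN F a b :=
  (norm_nonneg (F a)).trans (le_supN hF ⟨le_rfl, hab⟩)

/-- The sup of `|F|` over a compact interval is attained. [folklore] -/
theorem exists_eq_supN (hab : a ≤ b) (hF : Continuous F) :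
    ∃ x ∈ Set.Icc a b, ‖F x‖ = supN F a b := by
  obtain ⟨x, hx, hmax⟩ := isCompact_Icc.exists_isMaxOn (Set.nonempty_Icc.2 hab)
    (continuous_norm.comp hF).continuousOn
  exact ⟨x, hx, le_antisymm (le_supN hF hx) (supN_le hab fun y hy => hmax hy)⟩

/-- `supN` is monotone in the interval. [folklore] -/
theorem supN_mono (hF : Continuous F) {a' b' : ℝ} (ha : a ≤ a') (hb : b' ≤ b) (hab' : a' ≤ b') :
    supN F a' b' ≤ supN F a b :=
  supN_le hab' fun _ hx => le_supN hF ⟨ha.trans hx.1, hx.2.trans hb⟩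

end SupN

/-- The norm `‖F‖_{𝒞_θ([a,b])} = max(sup |F|, θ |I| sup |F'|)` of §2.2 of the paper, for a pair
`(F, F')` (function, derivative). [cite: DyatlovJin2018, §2.2] -/
noncomputable def normC (θ : ℝ) (F F' : ℝ → ℂ) (a b : ℝ) : ℝ :=
  max (supN F a b) (θ * (b - a) * supN F' a b)

section NormC

variable {θ : ℝ} {F F' : ℝ → ℂ} {a b : ℝ}

/-- `sup |F| ≤ ‖F‖_{𝒞_θ}`. [cite: DyatlovJin2018, §2.2] -/
theorem supN_le_normC : supN F a b ≤ normC θ F F' a b := le_max_left _ _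

/-- `θ|I| sup |F'| ≤ ‖F‖_{𝒞_θ}`. [cite: DyatlovJin2018, §2.2] -/
theorem der_le_normC : θ * (b - a) * supN F' a b ≤ normC θ F F' a b := le_max_right _ _

/-- `0 ≤ ‖F‖_{𝒞_θ}`. [cite: DyatlovJin2018, §2.2] -/
theorem normC_nonneg (hab : a ≤ b) (hF : Continuous F) : 0 ≤ normC θ F F' a b :=
  (supN_nonneg hab hF).trans supN_le_normC

/-- `|F(x)| ≤ ‖F‖_{𝒞_θ(I)}` for `x ∈ I`. [cite: DyatlovJin2018, §2.2] -/
theorem norm_le_normC (hF : Continuous F) {x : ℝ} (hx : x ∈ Set.Icc a b) :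
    ‖F x‖ ≤ normC θ F F' a b :=
  (le_supN hF hx).trans supN_le_normC

/-- Bounding the derivative part of the `𝒞_θ` norm pointwise. [cite: DyatlovJin2018, §2.2] -/
theorem der_part_le (hab : a ≤ b) (hθ : 0 ≤ θ) {M : ℝ} (hM : 0 ≤ M)
    (h2 : ∀ x ∈ Set.Icc a b, θ * (b - a) * ‖F' x‖ ≤ M) : θ * (b - a) * supN F' a b ≤ M := by
  by_cases hba : b - a = 0
  · rw [hba]; simpa using hM
  have hpos : 0 < θ * (b - a) ∨ θ * (b - a) = 0 := by
    rcases eq_or_lt_of_le hθ with h | h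
    · right; rw [← h]; simp
    · left; exact mul_pos h (lt_of_le_of_ne (by linarith) (Ne.symm hba))
  rcases hpos with hpos | hzero
  · have : supN F' a b ≤ M / (θ * (b - a)) := by
      apply supN_le hab
      intro x hx
      rw [le_div_iff₀ hpos]
      have := h2 x hx
      linarith
    calc θ * (b - a) * supN F' a b ≤ θ * (b - a) * (M / (θ * (b - a))) :=
          mul_le_mul_of_nonneg_left this hpos.le
      _ = M := mul_div_cancel₀ M hpos.ne'
  · rw [hzero]; simpa using hM

/-- Bounding `‖F‖_{𝒞_θ(I)}` from pointwise bounds on `F` and `F'`. [cite: DyatlovJin2018, §2.2] -/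
theorem normC_le (hab : a ≤ b) {M : ℝ} (h1 : ∀ x ∈ Set.Icc a b, ‖F x‖ ≤ M)
    (h2 : ∀ x ∈ Set.Icc a b, θ * (b - a) * ‖F' x‖ ≤ M) (hθ : 0 ≤ θ) : normC θ F F' a b ≤ M := by
  have hM : 0 ≤ M := (norm_nonneg _).trans (h1 a ⟨le_rfl, hab⟩)
  exact max_le (supN_le hab h1) (der_part_le hab hθ hM h2)

/-- `‖F‖_{𝒞_θ(I)} ≤ max(sup_I |F|, M)` from a pointwise bound on the derivative part ((e:panda-1)). [cite: DyatlovJin2018, Lemma 3.5 (proof, (e:panda-1))] -/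
theorem normC_le_max (hab : a ≤ b) (hθ : 0 ≤ θ) {M : ℝ} (hM : 0 ≤ M)
    (h2 : ∀ x ∈ Set.Icc a b, θ * (b - a) * ‖F' x‖ ≤ M) :
    normC θ F F' a b ≤ max (supN F a b) M :=
  max_le_max le_rfl (der_part_le hab hθ hM h2)

/-- **Lemma 2.4** (mean value bound with the sup of the derivative). [cite: DyatlovJin2018, Lemma 2.4, (e:mvt-theta)] -/
theorem norm_sub_le_supN (hder : ∀ x, HasDerivAt F (F' x) x) (hF' : Continuous F') {x x' : ℝ}
    (hx : x ∈ Set.Icc a b) (hx' : x' ∈ Set.Icc a b) :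
    ‖F x - F x'‖ ≤ supN F' a b * |x - x'| := by
  have := Convex.norm_image_sub_le_of_norm_hasDerivWithin_le (f := F) (f' := F') (s := Set.Icc a b)
    (fun y _ => (hder y).hasDerivWithinAt) (fun y hy => le_supN hF' hy) (convex_Icc a b) hx' hx
  rwa [Real.norm_eq_abs] at this

/-- **Lemma 2.4**: `|F(x) - F(x')| ≤ |x-x'|/(θ|I|) · ‖F‖_{𝒞_θ(I)}`. [cite: DyatlovJin2018, Lemma 2.4, (e:mvt-theta)] -/
theorem norm_sub_le_normC (hder : ∀ x, HasDerivAt F (F' x) x) (hF' : Continuous F') (hθ : 0 < θ)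
    (hab : a < b) {x x' : ℝ} (hx : x ∈ Set.Icc a b) (hx' : x' ∈ Set.Icc a b) :
    ‖F x - F x'‖ ≤ |x - x'| / (θ * (b - a)) * normC θ F F' a b := by
  have h1 := norm_sub_le_supN hder hF' hx hx'
  have hpos : 0 < θ * (b - a) := mul_pos hθ (by linarith)
  have h2 : supN F' a b ≤ normC θ F F' a b / (θ * (b - a)) := by
    rw [le_div_iff₀ hpos]; have := der_le_normC (θ := θ) (F := F) (F' := F') (a := a) (b := b)
    linarith
  calc ‖F x - F x'‖ ≤ supN F' a b * |x - x'| := h1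
    _ ≤ normC θ F F' a b / (θ * (b - a)) * |x - x'| :=
        mul_le_mul_of_nonneg_right h2 (abs_nonneg _)
    _ = |x - x'| / (θ * (b - a)) * normC θ F F' a b := by field_simp

end NormC

/-- **Lemma 2.3** (phase multiplication / recentring, (e:derbound)) for trigonometric sums: on a
subinterval `[a', b'] ⊂ [a, b]` with `|I'| ≤ |I|/4` and `4 θ |I'| |c| |ζ' - ζ| ≤ 1`, recentring from
`ζ'` to `ζ` does not increase the `𝒞_θ` norm, and the derivative part is at most half of it.
[cite: DyatlovJin2018, Lemma 2.3, (e:derbound)] -/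
theorem normC_recenter_le (P : Finset ℝ) (ζ ζ' c : ℝ) (f : ℝ → ℂ) {θ a b a' b' : ℝ} (hθ : 0 < θ)
    (hab : a < b) (ha : a ≤ a') (hb : b' ≤ b) (hab' : a' ≤ b') (hsmall : b' - a' ≤ (b - a) / 4)
    (hphase : 4 * θ * (b' - a') * (|c| * |ζ' - ζ|) ≤ 1) :
    normC θ (TS P ζ c f) (TS' P ζ c f) a' b' ≤ normC θ (TS P ζ' c f) (TS' P ζ' c f) a b ∧
      θ * (b' - a') * supN (TS' P ζ c f) a' b' ≤ normC θ (TS P ζ' c f) (TS' P ζ' c f) a b / 2 := by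
  set N := normC θ (TS P ζ' c f) (TS' P ζ' c f) a b with hN
  have hN0 : 0 ≤ N := normC_nonneg hab.le (continuous_TS _ _ _ _)
  have hF : ∀ x ∈ Set.Icc a' b', ‖TS P ζ c f x‖ ≤ N := by
    intro x hx
    rw [norm_TS_recenter P ζ ζ' c f x]
    exact norm_le_normC (continuous_TS _ _ _ _) ⟨ha.trans hx.1, hx.2.trans hb⟩
  have hF' : ∀ x ∈ Set.Icc a' b', θ * (b' - a') * ‖TS' P ζ c f x‖ ≤ N / 2 := by
    intro x hx
    have hxab : x ∈ Set.Icc a b := ⟨ha.trans hx.1, hx.2.trans hb⟩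
    have h1 := norm_TS'_recenter_le P ζ ζ' c f x
    have h2 : ‖TS P ζ' c f x‖ ≤ N := norm_le_normC (continuous_TS _ _ _ _) hxab
    have h3 : θ * (b - a) * ‖TS' P ζ' c f x‖ ≤ N :=
      (mul_le_mul_of_nonneg_left (le_supN (continuous_TS' _ _ _ _) hxab)
        (by nlinarith)).trans der_le_normC
    have hθI : 0 ≤ θ * (b' - a') := by nlinarith
    calc θ * (b' - a') * ‖TS' P ζ c f x‖
        ≤ θ * (b' - a') * (|c| * |ζ' - ζ| * ‖TS P ζ' c f x‖ + ‖TS' P ζ' c f x‖) :=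
          mul_le_mul_of_nonneg_left h1 hθI
      _ = (4 * θ * (b' - a') * (|c| * |ζ' - ζ|)) / 4 * ‖TS P ζ' c f x‖ +
            θ * (b' - a') * ‖TS' P ζ' c f x‖ := by ring
      _ ≤ 1 / 4 * N + θ * ((b - a) / 4) * ‖TS' P ζ' c f x‖ := by
          gcongr
      _ = 1 / 4 * N + (θ * (b - a) * ‖TS' P ζ' c f x‖) / 4 := by ring
      _ ≤ 1 / 4 * N + N / 4 := by linarith
      _ = N / 2 := by ring
  constructor
  · exact normC_le hab' hF (fun x hx => (hF' x hx).trans (by linarith)) hθ.le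
  · exact der_part_le hab' hθ.le (by linarith) hF'

/-! ### D. Convexity lemmas (§2.3 of the paper) -/

/-- The identity (e:basic-inner-product) of **Lemma 2.7**, real case with ordered pairs:
`(∑ p_j a_j)² = ∑ p_j a_j² - ½ ∑_{j,l} p_j p_l (a_j - a_l)²` when `∑ p_j = 1`.
[cite: DyatlovJin2018, Lemma 2.7, (e:basic-inner-product)] -/
theorem sq_wsum_eq {ι : Type*} (s : Finset ι) (p a : ι → ℝ) (hp : ∑ j ∈ s, p j = 1) :
    (∑ j ∈ s, p j * a j) ^ 2 =
      ∑ j ∈ s, p j * a j ^ 2 - (1 / 2) * ∑ j ∈ s, ∑ l ∈ s, p j * p l * (a j - a l) ^ 2 := by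
  have hA : (∑ j ∈ s, p j * a j) ^ 2 = ∑ j ∈ s, ∑ l ∈ s, (p j * a j) * (p l * a l) := by
    rw [sq, Finset.sum_mul_sum]
  have hB : ∑ j ∈ s, p j * a j ^ 2 = ∑ j ∈ s, ∑ l ∈ s, (p j * a j ^ 2) * p l := by
    rw [← Finset.sum_mul_sum, hp, mul_one]
  have hC : ∑ j ∈ s, ∑ l ∈ s, p j * p l * (a j - a l) ^ 2 =
      ∑ j ∈ s, ∑ l ∈ s, (p j * a j ^ 2) * p l + ∑ j ∈ s, ∑ l ∈ s, p j * (p l * a l ^ 2) -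
        2 * ∑ j ∈ s, ∑ l ∈ s, (p j * a j) * (p l * a l) := by
    rw [Finset.mul_sum, ← Finset.sum_add_distrib, ← Finset.sum_sub_distrib]
    apply Finset.sum_congr rfl; intro j _
    rw [Finset.mul_sum, ← Finset.sum_add_distrib, ← Finset.sum_sub_distrib]
    apply Finset.sum_congr rfl; intro l _
    ring
  have hD : ∑ j ∈ s, ∑ l ∈ s, p j * (p l * a l ^ 2) = ∑ j ∈ s, ∑ l ∈ s, (p j * a j ^ 2) * p l := by
    rw [Finset.sum_comm]
    apply Finset.sum_congr rfl; intro j _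
    apply Finset.sum_congr rfl; intro l _
    ring
  rw [hA, hB, hC, hD]; ring

/-- Complex (Hilbert-space `ℂ`) case of (e:basic-inner-product).
[cite: DyatlovJin2018, Lemma 2.7, (e:basic-inner-product)] -/
theorem normSq_wsum_eq {ι : Type*} (s : Finset ι) (p : ι → ℝ) (g : ι → ℂ)
    (hp : ∑ j ∈ s, p j = 1) :
    ‖∑ j ∈ s, (p j : ℂ) * g j‖ ^ 2 =
      ∑ j ∈ s, p j * ‖g j‖ ^ 2 -
        (1 / 2) * ∑ j ∈ s, ∑ l ∈ s, p j * p l * ‖g j - g l‖ ^ 2 := by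
  have hre : (∑ j ∈ s, (p j : ℂ) * g j).re = ∑ j ∈ s, p j * (g j).re := by
    rw [Complex.re_sum]; simp
  have him : (∑ j ∈ s, (p j : ℂ) * g j).im = ∑ j ∈ s, p j * (g j).im := by
    rw [Complex.im_sum]; simp
  have hn : ∀ z : ℂ, ‖z‖ ^ 2 = z.re ^ 2 + z.im ^ 2 := by
    intro z; rw [Complex.sq_norm, Complex.normSq_apply]; ring
  rw [hn, hre, him, sq_wsum_eq s p _ hp, sq_wsum_eq s p _ hp]
  simp_rw [hn, Complex.sub_re, Complex.sub_im]
  rw [show ∀ (A B C D : ℝ), A - B + (C - D) = (A + C) - (B + D) from fun _ _ _ _ => by ring,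
    ← Finset.sum_add_distrib, ← mul_add, ← Finset.sum_add_distrib]
  congr 1
  · apply Finset.sum_congr rfl; intro j _; ring
  · congr 1; apply Finset.sum_congr rfl; intro j _
    rw [← Finset.sum_add_distrib]
    apply Finset.sum_congr rfl; intro l _; ring

/-- From (e:basic-inner-product): a single pair is controlled by the defect.
[cite: DyatlovJin2018, Lemma 2.7 (proof of (e:extreme-l2))] -/
theorem pair_le_defect {ι : Type*} [DecidableEq ι] (s : Finset ι) (T : ι → ι → ℝ)
    (hT : ∀ j ∈ s, ∀ l ∈ s, 0 ≤ T j l) (hsymm : ∀ j l, T j l = T l j) {j l : ι} (hj : j ∈ s)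
    (hl : l ∈ s) (hjl : j ≠ l) : T j l ≤ (1 / 2) * ∑ j' ∈ s, ∑ l' ∈ s, T j' l' := by
  have h1 : ∀ j' ∈ s, T j' l + T j' j ≤ ∑ l' ∈ s, T j' l' := by
    intro j' hj'
    have : ∑ l' ∈ ({l, j} : Finset ι), T j' l' ≤ ∑ l' ∈ s, T j' l' :=
      Finset.sum_le_sum_of_subset_of_nonneg (by
        intro i hi; simp only [Finset.mem_insert, Finset.mem_singleton] at hi
        rcases hi with rfl | rfl <;> assumption) (fun i hi _ => hT j' hj' i hi)
    rwa [Finset.sum_pair (Ne.symm hjl)] at this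
  have h2 : (∑ l' ∈ s, T j l') + (∑ l' ∈ s, T l l') ≤ ∑ j' ∈ s, ∑ l' ∈ s, T j' l' := by
    have : ∑ j' ∈ ({j, l} : Finset ι), ∑ l' ∈ s, T j' l' ≤ ∑ j' ∈ s, ∑ l' ∈ s, T j' l' :=
      Finset.sum_le_sum_of_subset_of_nonneg (by
        intro i hi; simp only [Finset.mem_insert, Finset.mem_singleton] at hi
        rcases hi with rfl | rfl <;> assumption)
        (fun i hi _ => Finset.sum_nonneg fun l' hl' => hT i hi l' hl')
    rwa [Finset.sum_pair hjl] at this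
  have h3 := h1 j hj
  have h4 := h1 l hl
  have := hsymm l j
  nlinarith [hT j hj j hj, hT l hl l hl]

/-- **Lemma 2.7**, (e:extreme-l2): near-extremal convex combinations have comparable members.
Weights `p_j ≥ 2√(2ε)` (the paper has `2√ε`; the extra `√2` comes from using ordered pairs).
[cite: DyatlovJin2018, Lemma 2.7, (e:extreme-l2)] -/
theorem extreme_l2 {ι : Type*} [DecidableEq ι] (s : Finset ι) (hs : s.Nonempty) (p n : ι → ℝ)
    (hp0 : ∀ j ∈ s, 0 < p j) (hp : ∑ j ∈ s, p j = 1) (hn : ∀ j ∈ s, 0 ≤ n j) {ε R : ℝ}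
    (hε : 0 < ε) (hR : ∑ j ∈ s, p j * n j ^ 2 = R) (hnear : (1 - ε) * R ≤ (∑ j ∈ s, p j * n j) ^ 2)
    (hpmin : ∀ j ∈ s, 2 * Real.sqrt (2 * ε) ≤ p j) :
    ∀ j ∈ s, Real.sqrt R / 2 ≤ n j ∧ n j ≤ 2 * Real.sqrt R := by
  have hR0 : 0 ≤ R := by
    rw [← hR]; exact Finset.sum_nonneg fun j hj => by have := hp0 j hj; positivity
  set T : ι → ι → ℝ := fun j l => p j * p l * (n j - n l) ^ 2 with hT
  have hdef : (1 / 2) * ∑ j ∈ s, ∑ l ∈ s, T j l ≤ ε * R := by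
    have := sq_wsum_eq s p n hp
    rw [hR] at this
    simp only [hT]
    linarith
  -- pairwise closeness
  have hpair : ∀ j ∈ s, ∀ l ∈ s, (n j - n l) ^ 2 ≤ R / 4 := by
    intro j hj l hl
    by_cases hjl : j = l
    · subst hjl; simp; positivity
    have h1 : T j l ≤ ε * R := by
      refine le_trans (pair_le_defect s T (fun j hj l hl => ?_) (fun j l => ?_) hj hl hjl) hdef
      · simp only [hT]; have := hp0 j hj; have := hp0 l hl; positivity
      · simp only [hT]; ring
    simp only [hT] at h1
    have hpj := hpmin j hj
    have hpl := hpmin l hl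
    have hs2 : 0 ≤ Real.sqrt (2 * ε) := Real.sqrt_nonneg _
    have hsq : Real.sqrt (2 * ε) ^ 2 = 2 * ε := Real.sq_sqrt (by linarith)
    have hprod : 8 * ε ≤ p j * p l := by nlinarith
    by_contra hcon
    push Not at hcon
    have : ε * R < p j * p l * (n j - n l) ^ 2 := by nlinarith
    linarith
  obtain ⟨jmax, hjmax, hmax⟩ := Finset.exists_max_image s n hs
  obtain ⟨jmin, hjmin, hmin⟩ := Finset.exists_min_image s n hs
  have hmax2 : R ≤ n jmax ^ 2 := by
    rw [← hR]
    calc ∑ j ∈ s, p j * n j ^ 2 ≤ ∑ j ∈ s, p j * n jmax ^ 2 := by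
          apply Finset.sum_le_sum; intro j hj
          apply mul_le_mul_of_nonneg_left _ (hp0 j hj).le
          exact pow_le_pow_left₀ (hn j hj) (hmax j hj) 2
      _ = n jmax ^ 2 := by rw [← Finset.sum_mul, hp, one_mul]
  have hmin2 : n jmin ^ 2 ≤ R := by
    rw [← hR]
    calc n jmin ^ 2 = ∑ j ∈ s, p j * n jmin ^ 2 := by rw [← Finset.sum_mul, hp, one_mul]
      _ ≤ ∑ j ∈ s, p j * n j ^ 2 := by
          apply Finset.sum_le_sum; intro j hj
          apply mul_le_mul_of_nonneg_left _ (hp0 j hj).le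
          exact pow_le_pow_left₀ (hn jmin hjmin) (hmin j hj) 2
  have hmax' : Real.sqrt R ≤ n jmax := by
    calc Real.sqrt R ≤ Real.sqrt (n jmax ^ 2) := Real.sqrt_le_sqrt hmax2
      _ = n jmax := Real.sqrt_sq (hn jmax hjmax)
  have hmin' : n jmin ≤ Real.sqrt R := by
    calc n jmin = Real.sqrt (n jmin ^ 2) := (Real.sqrt_sq (hn jmin hjmin)).symm
      _ ≤ Real.sqrt R := Real.sqrt_le_sqrt hmin2
  have hR4 : ∀ j ∈ s, ∀ l ∈ s, |n j - n l| ≤ Real.sqrt R / 2 := by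
    intro j hj l hl
    rw [← Real.sqrt_sq_eq_abs]
    calc Real.sqrt ((n j - n l) ^ 2) ≤ Real.sqrt (R / 4) := Real.sqrt_le_sqrt (hpair j hj l hl)
      _ = Real.sqrt R / 2 := by
        rw [show R / 4 = R / 2 ^ 2 by norm_num, Real.sqrt_div hR0, Real.sqrt_sq (by norm_num)]
  intro j hj
  have b1 := hR4 j hj jmax hjmax
  have b2 := hR4 j hj jmin hjmin
  rw [abs_le] at b1 b2
  constructor <;> linarith

/-- **Lemma 2.8**, (e:extreme-l1). [cite: DyatlovJin2018, Lemma 2.8, (e:extreme-l1)] -/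
theorem extreme_l1 {ι : Type*} (s : Finset ι) (p α : ι → ℝ) (hp0 : ∀ j ∈ s, 0 ≤ p j)
    (hp : ∑ j ∈ s, p j = 1) {ε R : ℝ} (hε : 0 < ε) (hsum : (1 - ε) * R ≤ ∑ j ∈ s, p j * α j)
    (hmax : ∀ j ∈ s, α j ≤ R) (hpmin : ∀ j ∈ s, 2 * ε ≤ p j) : ∀ j ∈ s, R / 2 ≤ α j := by
  intro j hj
  have h1 : ∑ l ∈ s, p l * (R - α l) ≤ ε * R := by
    have : ∑ l ∈ s, p l * (R - α l) = R * ∑ l ∈ s, p l - ∑ l ∈ s, p l * α l := by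
      rw [Finset.mul_sum, ← Finset.sum_sub_distrib]; apply Finset.sum_congr rfl; intro l _; ring
    rw [this, hp]; linarith
  have h2 : p j * (R - α j) ≤ ∑ l ∈ s, p l * (R - α l) :=
    Finset.single_le_sum (f := fun l => p l * (R - α l))
      (fun l hl => mul_nonneg (hp0 l hl) (by linarith [hmax l hl])) hj
  have h3 : p j * (R - α j) ≤ ε * R := h2.trans h1
  have h4 := hpmin j hj
  nlinarith [hmax j hj]

/-! ### E. The inductive step (Lemma 3.2 / §3.2 of the paper), abstract form

We fix a parent `Y`-piece (points `P`, centre `ζ`) decomposed into children `b ∈ B` (points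
`Pb b`, centres `ζb b`, weights `q b`), a parent `X`-interval `[α, β]` with children intervals
`[αa a, βa a]`, `a ∈ A`, weights `p a`, and prove (e:boston-1). -/

section MainStep

variable {κ ι : Type*} [DecidableEq ι]
variable {A : Finset κ} {B : Finset ι} {αa βa p : κ → ℝ} {Pb : ι → Finset ℝ} {ζb q : ι → ℝ}
variable {P : Finset ℝ} {ζ c θ α β : ℝ} {f : ℝ → ℂ}

omit [DecidableEq ι] in
/-- Norm of a real-weighted sum of complex numbers. [folklore] -/
theorem norm_wsum_le (s : Finset ι) (w : ι → ℝ) (hw : ∀ b ∈ s, 0 ≤ w b) (z : ι → ℂ) :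
    ‖∑ b ∈ s, (w b : ℂ) * z b‖ ≤ ∑ b ∈ s, w b * ‖z b‖ := by
  refine (norm_sum_le _ _).trans (le_of_eq (Finset.sum_congr rfl fun b hb => ?_))
  rw [norm_mul, Complex.norm_real, Real.norm_eq_abs, abs_of_nonneg (hw b hb)]

omit [DecidableEq ι] in
/-- **Lemma 3.3** of the paper, pointwise form ((e:ideas-bound-1), first inequality, and
(e:panda-1)): on a child interval `I_a`, `‖F_J‖_{𝒞_θ(I_a)} ≤ ∑_b q_b ‖F_{J_b}‖_{𝒞_θ(I)}` and the
derivative part is at most half of that. [cite: DyatlovJin2018, Lemma 3.3 (ideas-bound)] -/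
theorem noGain_bound (hθ : 0 < θ) (hαβ : α < β) {a : κ}
    (ha : α ≤ αa a ∧ αa a ≤ βa a ∧ βa a ≤ β ∧ βa a - αa a ≤ (β - α) / 4)
    (hq0 : ∀ b ∈ B, 0 ≤ q b)
    (hF : ∀ x, TS P ζ c f x = ∑ b ∈ B, (q b : ℂ) * TS (Pb b) ζ c f x)
    (hF' : ∀ x, TS' P ζ c f x = ∑ b ∈ B, (q b : ℂ) * TS' (Pb b) ζ c f x)
    (hphase : ∀ b ∈ B, 4 * θ * (βa a - αa a) * (|c| * |ζb b - ζ|) ≤ 1) :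
    normC θ (TS P ζ c f) (TS' P ζ c f) (αa a) (βa a) ≤
        ∑ b ∈ B, q b * normC θ (TS (Pb b) (ζb b) c f) (TS' (Pb b) (ζb b) c f) α β ∧
      θ * (βa a - αa a) * supN (TS' P ζ c f) (αa a) (βa a) ≤
        (∑ b ∈ B, q b * normC θ (TS (Pb b) (ζb b) c f) (TS' (Pb b) (ζb b) c f) α β) / 2 := by
  obtain ⟨h1, h2, h3, h4⟩ := ha
  set M₁ := ∑ b ∈ B, q b * normC θ (TS (Pb b) (ζb b) c f) (TS' (Pb b) (ζb b) c f) α β with hM₁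
  have hrec : ∀ b ∈ B,
      normC θ (TS (Pb b) ζ c f) (TS' (Pb b) ζ c f) (αa a) (βa a) ≤
          normC θ (TS (Pb b) (ζb b) c f) (TS' (Pb b) (ζb b) c f) α β ∧
        θ * (βa a - αa a) * supN (TS' (Pb b) ζ c f) (αa a) (βa a) ≤
          normC θ (TS (Pb b) (ζb b) c f) (TS' (Pb b) (ζb b) c f) α β / 2 :=
    fun b hb => normC_recenter_le (Pb b) ζ (ζb b) c f hθ hαβ h1 h3 h2 h4 (hphase b hb)
  have hM₁0 : 0 ≤ M₁ := Finset.sum_nonneg fun b hb =>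
    mul_nonneg (hq0 b hb) (normC_nonneg hαβ.le (continuous_TS _ _ _ _))
  have hFx : ∀ x ∈ Set.Icc (αa a) (βa a), ‖TS P ζ c f x‖ ≤ M₁ := by
    intro x hx
    rw [hF x]
    refine (norm_wsum_le B q hq0 _).trans (Finset.sum_le_sum fun b hb => ?_)
    apply mul_le_mul_of_nonneg_left _ (hq0 b hb)
    exact (norm_le_normC (continuous_TS _ _ _ _) hx).trans (hrec b hb).1
  have hF'x : ∀ x ∈ Set.Icc (αa a) (βa a), θ * (βa a - αa a) * ‖TS' P ζ c f x‖ ≤ M₁ / 2 := by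
    intro x hx
    rw [hF' x]
    have hθI : 0 ≤ θ * (βa a - αa a) := mul_nonneg hθ.le (by linarith)
    calc θ * (βa a - αa a) * ‖∑ b ∈ B, (q b : ℂ) * TS' (Pb b) ζ c f x‖
        ≤ θ * (βa a - αa a) * ∑ b ∈ B, q b * ‖TS' (Pb b) ζ c f x‖ :=
          mul_le_mul_of_nonneg_left (norm_wsum_le B q hq0 _) hθI
      _ = ∑ b ∈ B, q b * (θ * (βa a - αa a) * ‖TS' (Pb b) ζ c f x‖) := by
          rw [Finset.mul_sum]; apply Finset.sum_congr rfl; intro b _; ring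
      _ ≤ ∑ b ∈ B, q b * (normC θ (TS (Pb b) (ζb b) c f) (TS' (Pb b) (ζb b) c f) α β / 2) := by
          apply Finset.sum_le_sum; intro b hb
          apply mul_le_mul_of_nonneg_left _ (hq0 b hb)
          refine le_trans ?_ (hrec b hb).2
          exact mul_le_mul_of_nonneg_left (le_supN (continuous_TS' _ _ _ _) hx) hθI
      _ = M₁ / 2 := by rw [hM₁, Finset.sum_div]; apply Finset.sum_congr rfl; intro b _; ring
  constructor
  · exact normC_le h2 hFx (fun x hx => (hF'x x hx).trans (by linarith)) hθ.le
  · exact der_part_le h2 hθ.le (by linarith) hF'x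

/-- **Lemma 3.2** of the paper (the inductive step (e:boston-1)), abstract form.
[cite: DyatlovJin2018, Lemma 3.2 / §3.2] -/
theorem main_step_abstract (hB : B.Nonempty) (hθ : 0 < θ) (hαβ : α < β)
    (hsub : ∀ a ∈ A, α ≤ αa a ∧ αa a ≤ βa a ∧ βa a ≤ β ∧ βa a - αa a ≤ (β - α) / 4)
    {pmin ε₁ dXlo dXhi dYlo dYhi : ℝ} (hpmin : 0 < pmin)
    (hp0 : ∀ a ∈ A, pmin ≤ p a) (hp1 : ∑ a ∈ A, p a = 1)
    (hq0 : ∀ b ∈ B, pmin ≤ q b) (hq1 : ∑ b ∈ B, q b = 1)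
    (hF : ∀ x, TS P ζ c f x = ∑ b ∈ B, (q b : ℂ) * TS (Pb b) ζ c f x)
    (hF' : ∀ x, TS' P ζ c f x = ∑ b ∈ B, (q b : ℂ) * TS' (Pb b) ζ c f x)
    (hphase : ∀ a ∈ A, ∀ b ∈ B, 4 * θ * (βa a - αa a) * (|c| * |ζb b - ζ|) ≤ 1)
    (hfarX : ∃ a₁ ∈ A, ∃ a₂ ∈ A, ∀ x' ∈ Set.Icc (αa a₁) (βa a₁), ∀ x'' ∈ Set.Icc (αa a₂) (βa a₂),
      dXlo ≤ x' - x'' ∧ x' - x'' ≤ dXhi)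
    (hfarY : ∃ b₁ ∈ B, ∃ b₂ ∈ B, dYlo ≤ ζb b₁ - ζb b₂ ∧ ζb b₁ - ζb b₂ ≤ dYhi)
    (hdX : 0 < dXlo) (hdY : 0 < dYlo) (hτπ : |c| * dXhi * dYhi ≤ Real.pi)
    (hε₁ : 0 < ε₁) (hε₁a : 2 * Real.sqrt (2 * ε₁) ≤ pmin) (hε₁b : 4 * ε₁ ≤ pmin)
    (hη : Real.sqrt (2 * ε₁ / pmin ^ 3) ≤ 1 / 8)
    (hgain : 2 * Real.sqrt (2 * ε₁ / pmin ^ 3) + 4 * dXhi / (θ * (β - α)) ≤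
      |c| * dXlo * dYlo / Real.pi) :
    ∑ a ∈ A, p a * (normC θ (TS P ζ c f) (TS' P ζ c f) (αa a) (βa a)) ^ 2 ≤
      (1 - ε₁) * ∑ b ∈ B, q b *
        (normC θ (TS (Pb b) (ζb b) c f) (TS' (Pb b) (ζb b) c f) α β) ^ 2 := by
  -- notation
  set nB : ι → ℝ := fun b => normC θ (TS (Pb b) (ζb b) c f) (TS' (Pb b) (ζb b) c f) α β with hnB
  set nA : κ → ℝ := fun a => normC θ (TS P ζ c f) (TS' P ζ c f) (αa a) (βa a) with hnA
  set R : ℝ := ∑ b ∈ B, q b * nB b ^ 2 with hR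
  set M₁ : ℝ := ∑ b ∈ B, q b * nB b with hM₁
  have hp0' : ∀ a ∈ A, 0 < p a := fun a ha => hpmin.trans_le (hp0 a ha)
  have hq0' : ∀ b ∈ B, 0 < q b := fun b hb => hpmin.trans_le (hq0 b hb)
  have hq0'' : ∀ b ∈ B, 0 ≤ q b := fun b hb => (hq0' b hb).le
  have hnB0 : ∀ b ∈ B, 0 ≤ nB b := fun b _ => normC_nonneg hαβ.le (continuous_TS _ _ _ _)
  have hnA0 : ∀ a ∈ A, 0 ≤ nA a := fun a ha => normC_nonneg (hsub a ha).2.1 (continuous_TS _ _ _ _)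
  have hR0 : 0 ≤ R := Finset.sum_nonneg fun b hb => by have := hq0' b hb; have := hnB0 b hb; positivity
  have hM₁0 : 0 ≤ M₁ := Finset.sum_nonneg fun b hb => mul_nonneg (hq0'' b hb) (hnB0 b hb)
  -- Lemma 3.3: no-gain bounds
  have hng : ∀ a ∈ A, nA a ≤ M₁ ∧
      θ * (βa a - αa a) * supN (TS' P ζ c f) (αa a) (βa a) ≤ M₁ / 2 := fun a ha =>
    noGain_bound hθ hαβ (hsub a ha) hq0'' hF hF' (hphase a ha)
  -- Jensen: M₁² ≤ R
  have hJensen : M₁ ^ 2 ≤ R := by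
    have := sq_wsum_eq B q nB hq1
    have hdef : 0 ≤ ∑ j ∈ B, ∑ l ∈ B, q j * q l * (nB j - nB l) ^ 2 :=
      Finset.sum_nonneg fun j hj => Finset.sum_nonneg fun l hl => by
        have := hq0' j hj; have := hq0' l hl; positivity
    simp only [hM₁, hR]; linarith
  -- argue by contradiction
  by_contra hcon
  push Not at hcon
  -- hcon : (1 - ε₁) * R < ∑ a ∈ A, p a * nA a ^ 2
  have hLHS_le : ∑ a ∈ A, p a * nA a ^ 2 ≤ M₁ ^ 2 := by
    calc ∑ a ∈ A, p a * nA a ^ 2 ≤ ∑ a ∈ A, p a * M₁ ^ 2 := by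
          apply Finset.sum_le_sum; intro a ha
          apply mul_le_mul_of_nonneg_left _ (hp0' a ha).le
          exact pow_le_pow_left₀ (hnA0 a ha) (hng a ha).1 2
      _ = M₁ ^ 2 := by rw [← Finset.sum_mul, hp1, one_mul]
  have hRpos : 0 < R := by
    by_contra hR0'
    have hR00 : R = 0 := le_antisymm (not_lt.1 hR0') hR0
    have : ∑ a ∈ A, p a * nA a ^ 2 ≤ 0 := hLHS_le.trans (hR00 ▸ hJensen)
    rw [hR00] at hcon
    linarith
  have hsR : 0 < Real.sqrt R := Real.sqrt_pos.2 hRpos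
  have hsR2 : Real.sqrt R ^ 2 = R := Real.sq_sqrt hR0
  -- Lemma 3.4 (F-J-b-lower): all nB b are comparable to √R
  have h24 : ∀ b ∈ B, Real.sqrt R / 2 ≤ nB b ∧ nB b ≤ 2 * Real.sqrt R :=
    extreme_l2 B hB q nB hq0' hq1 hnB0 hε₁ hR.symm (by linarith [hcon, hLHS_le])
      (fun b hb => hε₁a.trans (hq0 b hb))
  -- Lemma 3.5: points x_a almost realising the sup
  have hxs : ∀ a ∈ A, ∃ x ∈ Set.Icc (αa a) (βa a),
      ‖TS P ζ c f x‖ = supN (TS P ζ c f) (αa a) (βa a) :=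
    fun a ha => exists_eq_supN (hsub a ha).2.1 (continuous_TS _ _ _ _)
  choose! xs hxsI hxsEq using hxs
  have hxsI' : ∀ a ∈ A, xs a ∈ Set.Icc α β := fun a ha =>
    ⟨(hsub a ha).1.trans (hxsI a ha).1, (hxsI a ha).2.trans (hsub a ha).2.2.1⟩
  have h25 : (1 - 2 * ε₁) * R < ∑ a ∈ A, p a * ‖TS P ζ c f (xs a)‖ ^ 2 := by
    have hhalf : ∀ a ∈ A, nA a ^ 2 ≤ (R + ‖TS P ζ c f (xs a)‖ ^ 2) / 2 := by
      intro a ha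
      have hle : nA a ≤ max (supN (TS P ζ c f) (αa a) (βa a)) (M₁ / 2) :=
        normC_le_max (hsub a ha).2.1 hθ.le (by linarith) (fun x hx => by
          have := (hng a ha).2
          have h' := mul_le_mul_of_nonneg_left (le_supN (continuous_TS' P ζ c f) hx)
            (show 0 ≤ θ * (βa a - αa a) by have := (hsub a ha).2.1; nlinarith)
          linarith)
      rw [← hxsEq a ha] at hle
      have hs0 : 0 ≤ ‖TS P ζ c f (xs a)‖ := norm_nonneg _
      have hsle : ‖TS P ζ c f (xs a)‖ ≤ nA a := by
        rw [hxsEq a ha]; exact supN_le_normC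
      have hs2 : ‖TS P ζ c f (xs a)‖ ^ 2 ≤ R := by
        have : ‖TS P ζ c f (xs a)‖ ≤ M₁ := hsle.trans (hng a ha).1
        calc ‖TS P ζ c f (xs a)‖ ^ 2 ≤ M₁ ^ 2 := pow_le_pow_left₀ hs0 this 2
          _ ≤ R := hJensen
      rcases le_total (‖TS P ζ c f (xs a)‖) (M₁ / 2) with hcase | hcase
      · have : nA a ≤ M₁ / 2 := hle.trans (max_le hcase le_rfl)
        have : nA a ^ 2 ≤ (M₁ / 2) ^ 2 := pow_le_pow_left₀ (hnA0 a ha) this 2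
        nlinarith
      · have : nA a ≤ ‖TS P ζ c f (xs a)‖ := hle.trans (max_le le_rfl hcase)
        have : nA a ^ 2 ≤ ‖TS P ζ c f (xs a)‖ ^ 2 := pow_le_pow_left₀ (hnA0 a ha) this 2
        nlinarith
    have : ∑ a ∈ A, p a * nA a ^ 2 ≤ ∑ a ∈ A, p a * ((R + ‖TS P ζ c f (xs a)‖ ^ 2) / 2) :=
      Finset.sum_le_sum fun a ha => mul_le_mul_of_nonneg_left (hhalf a ha) (hp0' a ha).le
    have e : ∑ a ∈ A, p a * ((R + ‖TS P ζ c f (xs a)‖ ^ 2) / 2) =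
        R / 2 + (∑ a ∈ A, p a * ‖TS P ζ c f (xs a)‖ ^ 2) / 2 := by
      have h' : ∀ a ∈ A, p a * ((R + ‖TS P ζ c f (xs a)‖ ^ 2) / 2) =
          p a * (R / 2) + p a * ‖TS P ζ c f (xs a)‖ ^ 2 / 2 := fun a _ => by ring
      rw [Finset.sum_congr rfl h', Finset.sum_add_distrib, ← Finset.sum_mul, hp1, one_mul,
        ← Finset.sum_div]
    rw [e] at this
    linarith
  -- the values F_ab and g_ab = e^{iω_ab} F_ab
  set Fv : κ → ι → ℂ := fun a b => TS (Pb b) (ζb b) c f (xs a) with hFv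
  set g : κ → ι → ℂ := fun a b => TS (Pb b) ζ c f (xs a) with hg
  set u : κ → ι → ℂ := fun a b => ex (c * (ζb b - ζ) * xs a) with hu
  have hgu : ∀ a b, g a b = u a b * Fv a b := fun a b => TS_recenter (Pb b) ζ (ζb b) c f (xs a)
  have hnu : ∀ a b, ‖u a b‖ = 1 := fun a b => norm_ex _
  have hng_eq : ∀ a b, ‖g a b‖ = ‖Fv a b‖ := fun a b => by rw [hgu, norm_mul, hnu, one_mul]
  set Df : κ → ℝ := fun a => ∑ b ∈ B, ∑ b' ∈ B, q b * q b' * ‖g a b - g a b'‖ ^ 2 with hDf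
  have hDf0 : ∀ a, 0 ≤ Df a := fun a => Finset.sum_nonneg fun b hb => Finset.sum_nonneg fun b' hb' => by
    have := hq0' b hb; have := hq0' b' hb'; positivity
  -- (e:contrastep-4)
  have h3a : ∀ a ∈ A, ‖TS P ζ c f (xs a)‖ ^ 2 = ∑ b ∈ B, q b * ‖Fv a b‖ ^ 2 - (1 / 2) * Df a := by
    intro a _
    rw [hF (xs a), normSq_wsum_eq B q (fun b => TS (Pb b) ζ c f (xs a)) hq1]
    have e : ∀ b, ‖TS (Pb b) ζ c f (xs a)‖ = ‖Fv a b‖ := fun b => hng_eq a b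
    simp only [e]
    rfl
  -- (e:F-convex-up)
  have hFv_le : ∀ a ∈ A, ∀ b ∈ B, ‖Fv a b‖ ≤ nB b := fun a ha b _ =>
    norm_le_normC (continuous_TS _ _ _ _) (hxsI' a ha)
  have h3b : ∀ a ∈ A, ∑ b ∈ B, q b * ‖Fv a b‖ ^ 2 ≤ R := fun a ha =>
    Finset.sum_le_sum fun b hb => mul_le_mul_of_nonneg_left
      (pow_le_pow_left₀ (norm_nonneg _) (hFv_le a ha b hb) 2) (hq0'' b hb)
  have h3c : (1 / 2) * ∑ a ∈ A, p a * Df a < 2 * ε₁ * R := by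
    have e1 : ∑ a ∈ A, p a * ‖TS P ζ c f (xs a)‖ ^ 2 =
        ∑ a ∈ A, p a * (∑ b ∈ B, q b * ‖Fv a b‖ ^ 2) - (1 / 2) * ∑ a ∈ A, p a * Df a := by
      rw [Finset.mul_sum, ← Finset.sum_sub_distrib]
      apply Finset.sum_congr rfl; intro a ha; rw [h3a a ha]; ring
    have e2 : ∑ a ∈ A, p a * (∑ b ∈ B, q b * ‖Fv a b‖ ^ 2) ≤ R := by
      calc ∑ a ∈ A, p a * (∑ b ∈ B, q b * ‖Fv a b‖ ^ 2) ≤ ∑ a ∈ A, p a * R :=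
            Finset.sum_le_sum fun a ha => mul_le_mul_of_nonneg_left (h3b a ha) (hp0' a ha).le
        _ = R := by rw [← Finset.sum_mul, hp1, one_mul]
    linarith [h25]
  have h3d : (1 - 2 * ε₁) * R < ∑ a ∈ A, p a * (∑ b ∈ B, q b * ‖Fv a b‖ ^ 2) := by
    have e1 : ∑ a ∈ A, p a * ‖TS P ζ c f (xs a)‖ ^ 2 ≤
        ∑ a ∈ A, p a * (∑ b ∈ B, q b * ‖Fv a b‖ ^ 2) := by
      apply Finset.sum_le_sum; intro a ha
      apply mul_le_mul_of_nonneg_left _ (hp0' a ha).le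
      rw [h3a a ha]; linarith [hDf0 a]
    linarith [h25]
  -- (e:amplitudes-are-near)
  set η : ℝ := Real.sqrt (2 * ε₁ / pmin ^ 3) with hη_def
  have hη0 : 0 < η := Real.sqrt_pos.2 (by positivity)
  have hnear : ∀ a ∈ A, ∀ b ∈ B, ∀ b' ∈ B, ‖g a b - g a b'‖ < η * Real.sqrt R := by
    intro a ha b hb b' hb'
    by_cases hbb : b = b'
    · subst hbb; simp; positivity
    have hT : q b * q b' * ‖g a b - g a b'‖ ^ 2 ≤ (1 / 2) * Df a :=
      pair_le_defect B (fun j l => q j * q l * ‖g a j - g a l‖ ^ 2)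
        (fun j hj l hl => by have := hq0' j hj; have := hq0' l hl; positivity)
        (fun j l => by rw [norm_sub_rev]; ring) hb hb' hbb
    have hT2 : p a * ((1 / 2) * Df a) ≤ (1 / 2) * ∑ a ∈ A, p a * Df a := by
      have h := Finset.single_le_sum (f := fun a' => p a' * Df a')
        (fun a' ha' => mul_nonneg (hp0' a' ha').le (hDf0 a')) ha
      have e : p a * ((1 / 2) * Df a) = (1 / 2) * (p a * Df a) := by ring
      rw [e]
      exact mul_le_mul_of_nonneg_left h (by norm_num)
    have hT3 : p a * (q b * q b' * ‖g a b - g a b'‖ ^ 2) < 2 * ε₁ * R :=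
      lt_of_le_of_lt ((mul_le_mul_of_nonneg_left hT (hp0' a ha).le).trans hT2) h3c
    have hw : pmin ^ 3 ≤ p a * (q b * q b') := by
      have h1 := hp0 a ha; have h2 := hq0 b hb; have h3 := hq0 b' hb'
      calc pmin ^ 3 = pmin * (pmin * pmin) := by ring
        _ ≤ p a * (q b * q b') := by
          apply mul_le_mul h1 (mul_le_mul h2 h3 hpmin.le (hq0'' b hb)) (by positivity) (hp0' a ha).le
    have hsq : ‖g a b - g a b'‖ ^ 2 < (η * Real.sqrt R) ^ 2 := by
      have e : (η * Real.sqrt R) ^ 2 = 2 * ε₁ * R / pmin ^ 3 := by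
        rw [mul_pow, hsR2, hη_def, Real.sq_sqrt (by positivity)]; ring
      rw [e, lt_div_iff₀ (by positivity)]
      calc ‖g a b - g a b'‖ ^ 2 * pmin ^ 3 ≤ ‖g a b - g a b'‖ ^ 2 * (p a * (q b * q b')) :=
            mul_le_mul_of_nonneg_left hw (by positivity)
        _ = p a * (q b * q b' * ‖g a b - g a b'‖ ^ 2) := by ring
        _ < 2 * ε₁ * R := hT3
    exact lt_of_pow_lt_pow_left₀ 2 (by positivity) hsq
  -- Lemma 3.6 (F-lower)
  have h26a : ∀ a ∈ A, R / 2 ≤ ∑ b ∈ B, q b * ‖Fv a b‖ ^ 2 :=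
    extreme_l1 A p (fun a => ∑ b ∈ B, q b * ‖Fv a b‖ ^ 2) (fun a ha => (hp0' a ha).le) hp1
      (by positivity) h3d.le h3b (fun a ha => by linarith [hp0 a ha])
  have h26 : ∀ a ∈ A, ∀ b ∈ B, Real.sqrt R / 2 ≤ ‖Fv a b‖ := by
    intro a ha b hb
    -- some b* with ‖Fv a b*‖² ≥ R/2
    obtain ⟨bs, hbs, hbig⟩ : ∃ bs ∈ B, R / 2 ≤ ‖Fv a bs‖ ^ 2 := by
      by_contra hno
      push Not at hno
      have : ∑ b ∈ B, q b * ‖Fv a b‖ ^ 2 < ∑ b ∈ B, q b * (R / 2) :=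
        Finset.sum_lt_sum_of_nonempty hB fun b hb => mul_lt_mul_of_pos_left (hno b hb) (hq0' b hb)
      rw [← Finset.sum_mul, hq1, one_mul] at this
      linarith [h26a a ha]
    have h7 : 7 / 10 * Real.sqrt R ≤ ‖Fv a bs‖ := by
      apply le_of_pow_le_pow_left₀ two_ne_zero (norm_nonneg _)
      rw [mul_pow, hsR2]; linarith
    have hn := hnear a ha bs hbs b hb
    have htri : ‖Fv a bs‖ - ‖Fv a b‖ ≤ ‖g a bs - g a b‖ := by
      rw [← hng_eq a bs, ← hng_eq a b]; exact norm_sub_norm_le _ _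
    have hηR : η * Real.sqrt R ≤ 1 / 8 * Real.sqrt R := mul_le_mul_of_nonneg_right hη hsR.le
    linarith
  -- Lemma 3.7 (FAB-upper)
  have h27 : ∀ a ∈ A, ∀ a' ∈ A, ∀ b ∈ B,
      ‖Fv a b - Fv a' b‖ ≤ |xs a - xs a'| / (θ * (β - α)) * (2 * Real.sqrt R) := by
    intro a ha a' ha' b hb
    refine (norm_sub_le_normC (fun x => hasDerivAt_TS (Pb b) (ζb b) c f x) (continuous_TS' _ _ _ _)
      hθ hαβ (hxsI' a ha) (hxsI' a' ha')).trans ?_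
    exact mul_le_mul_of_nonneg_left (h24 b hb).2 (by positivity)
  -- the contradiction
  obtain ⟨a₁, ha₁, a₂, ha₂, hfar⟩ := hfarX
  obtain ⟨b₁, hb₁, b₂, hb₂, hY1, hY2⟩ := hfarY
  obtain ⟨hX1, hX2⟩ := hfar (xs a₁) (hxsI a₁ ha₁) (xs a₂) (hxsI a₂ ha₂)
  set τ : ℝ := c * (xs a₁ - xs a₂) * (ζb b₁ - ζb b₂) with hτ
  have hτabs : |τ| = |c| * (xs a₁ - xs a₂) * (ζb b₁ - ζb b₂) := by
    rw [hτ, abs_mul, abs_mul, abs_of_pos (show (0 : ℝ) < xs a₁ - xs a₂ by linarith),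
      abs_of_pos (show (0 : ℝ) < ζb b₁ - ζb b₂ by linarith)]
  have hτle : |τ| ≤ Real.pi := by
    rw [hτabs]
    refine le_trans ?_ hτπ
    have hc0 : 0 ≤ |c| := abs_nonneg c
    calc |c| * (xs a₁ - xs a₂) * (ζb b₁ - ζb b₂) ≤ |c| * dXhi * (ζb b₁ - ζb b₂) := by
          apply mul_le_mul_of_nonneg_right _ (by linarith)
          exact mul_le_mul_of_nonneg_left hX2 hc0
      _ ≤ |c| * dXhi * dYhi := by
          apply mul_le_mul_of_nonneg_left hY2
          exact mul_nonneg hc0 (by linarith)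
  have hτge : |c| * dXlo * dYlo ≤ |τ| := by
    rw [hτabs]
    have hc0 : 0 ≤ |c| := abs_nonneg c
    calc |c| * dXlo * dYlo ≤ |c| * (xs a₁ - xs a₂) * dYlo := by
          apply mul_le_mul_of_nonneg_right _ hdY.le
          exact mul_le_mul_of_nonneg_left hX1 hc0
      _ ≤ |c| * (xs a₁ - xs a₂) * (ζb b₁ - ζb b₂) := by
          apply mul_le_mul_of_nonneg_left hY1
          exact mul_nonneg hc0 (by linarith)
  -- phase identity
  have hphase_id : u a₁ b₁ * u a₂ b₂ = ex τ * (u a₁ b₂ * u a₂ b₁) := by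
    simp only [hu, hτ]
    rw [← ex_add, ← ex_add, ← ex_add]
    congr 1; ring
  set Z : ℂ := u a₁ b₁ * u a₂ b₂ * Fv a₁ b₁ - u a₁ b₂ * u a₂ b₁ * Fv a₁ b₁ with hZ
  have hZnorm : ‖Z‖ = ‖ex τ - 1‖ * ‖Fv a₁ b₁‖ := by
    have : Z = (u a₁ b₂ * u a₂ b₁) * ((ex τ - 1) * Fv a₁ b₁) := by
      rw [hZ, hphase_id]; ring
    rw [this, norm_mul, norm_mul, norm_mul, hnu, hnu, one_mul, one_mul]
  have hZdecomp : Z = u a₂ b₂ * (g a₁ b₁ - g a₁ b₂) + u a₁ b₂ * u a₂ b₂ * (Fv a₁ b₂ - Fv a₂ b₂) +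
      u a₁ b₂ * (g a₂ b₂ - g a₂ b₁) + u a₁ b₂ * u a₂ b₁ * (Fv a₂ b₁ - Fv a₁ b₁) := by
    simp only [hZ, hgu]; ring
  have hZup : ‖Z‖ < 2 * (η * Real.sqrt R) + 2 * (dXhi / (θ * (β - α)) * (2 * Real.sqrt R)) := by
    have t1 := hnear a₁ ha₁ b₁ hb₁ b₂ hb₂
    have t3 := hnear a₂ ha₂ b₂ hb₂ b₁ hb₁
    have habs : |xs a₁ - xs a₂| ≤ dXhi := by rw [abs_of_pos (by linarith)]; exact hX2
    have hθβα : 0 < θ * (β - α) := mul_pos hθ (by linarith)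
    have t2 : ‖Fv a₁ b₂ - Fv a₂ b₂‖ ≤ dXhi / (θ * (β - α)) * (2 * Real.sqrt R) :=
      (h27 a₁ ha₁ a₂ ha₂ b₂ hb₂).trans (by gcongr)
    have t4 : ‖Fv a₂ b₁ - Fv a₁ b₁‖ ≤ dXhi / (θ * (β - α)) * (2 * Real.sqrt R) := by
      have := h27 a₂ ha₂ a₁ ha₁ b₁ hb₁
      rw [abs_sub_comm] at this
      exact this.trans (by gcongr)
    rw [hZdecomp]
    calc ‖u a₂ b₂ * (g a₁ b₁ - g a₁ b₂) + u a₁ b₂ * u a₂ b₂ * (Fv a₁ b₂ - Fv a₂ b₂) +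
          u a₁ b₂ * (g a₂ b₂ - g a₂ b₁) + u a₁ b₂ * u a₂ b₁ * (Fv a₂ b₁ - Fv a₁ b₁)‖
        ≤ ‖u a₂ b₂ * (g a₁ b₁ - g a₁ b₂)‖ + ‖u a₁ b₂ * u a₂ b₂ * (Fv a₁ b₂ - Fv a₂ b₂)‖ +
          ‖u a₁ b₂ * (g a₂ b₂ - g a₂ b₁)‖ + ‖u a₁ b₂ * u a₂ b₁ * (Fv a₂ b₁ - Fv a₁ b₁)‖ := by
          refine (norm_add_le _ _).trans ?_
          refine add_le_add ((norm_add_le _ _).trans (add_le_add (norm_add_le _ _) le_rfl)) le_rfl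
      _ = ‖g a₁ b₁ - g a₁ b₂‖ + ‖Fv a₁ b₂ - Fv a₂ b₂‖ + ‖g a₂ b₂ - g a₂ b₁‖ +
          ‖Fv a₂ b₁ - Fv a₁ b₁‖ := by
          simp only [norm_mul, hnu, one_mul]
      _ < _ := by linarith
  have hZlow : |c| * dXlo * dYlo * Real.sqrt R / Real.pi ≤ ‖Z‖ := by
    rw [hZnorm]
    have h1 : 2 / Real.pi * |τ| ≤ ‖ex τ - 1‖ := norm_ex_sub_one_ge hτle
    have h2 := h26 a₁ ha₁ b₁ hb₁
    have hpi : 0 < Real.pi := Real.pi_pos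
    calc |c| * dXlo * dYlo * Real.sqrt R / Real.pi
        = (2 / Real.pi * (|c| * dXlo * dYlo)) * (Real.sqrt R / 2) := by ring
      _ ≤ (2 / Real.pi * |τ|) * (Real.sqrt R / 2) := by gcongr
      _ ≤ ‖ex τ - 1‖ * ‖Fv a₁ b₁‖ := mul_le_mul h1 h2 (by positivity) (norm_nonneg _)
  -- combine with hgain
  have hfin := mul_le_mul_of_nonneg_right hgain hsR.le
  have e1 : (2 * Real.sqrt (2 * ε₁ / pmin ^ 3) + 4 * dXhi / (θ * (β - α))) * Real.sqrt R =
      2 * (η * Real.sqrt R) + 2 * (dXhi / (θ * (β - α)) * (2 * Real.sqrt R)) := by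
    rw [hη_def]; ring
  have e2 : |c| * dXlo * dYlo / Real.pi * Real.sqrt R = |c| * dXlo * dYlo * Real.sqrt R / Real.pi := by
    ring
  rw [e1, e2] at hfin
  linarith [hZup, hZlow, hfin]

end MainStep

/-! ### F. The iteration (Proposition 3.1 of the paper) on the trees of runs -/

section Grid

/-- Grid size `L^{-k}` at level `k` of the tree.
[cite: DyatlovJin2018, §2.1 (discretization with base L)] -/
noncomputable def gr (L k : ℕ) : ℝ := ((L : ℝ) ^ k)⁻¹

variable {L : ℕ}

/-- `0 < L^{-k}`. [folklore] -/
theorem gr_pos (hL : 0 < L) (k : ℕ) : 0 < gr L k := by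
  have : (0 : ℝ) < L := by exact_mod_cast hL
  unfold gr; positivity

/-- `L^{-(k+1)} = L^{-k}/L`. [folklore] -/
theorem gr_succ (k : ℕ) : gr L (k + 1) = gr L k / L := by
  unfold gr; rw [pow_succ, mul_inv, div_eq_mul_inv]

/-- `L^{-k} ≤ 1`. [folklore] -/
theorem gr_le_one (hL : 1 ≤ L) (k : ℕ) : gr L k ≤ 1 := by
  have : (1 : ℝ) ≤ L := by exact_mod_cast hL
  unfold gr
  exact inv_le_one_of_one_le₀ (one_le_pow₀ this)

/-- `k ↦ L^{-k}` is antitone. [folklore] -/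
theorem gr_anti (hL : 1 ≤ L) {k k' : ℕ} (h : k ≤ k') : gr L k' ≤ gr L k := by
  have h1 : (1 : ℝ) ≤ L := by exact_mod_cast hL
  unfold gr
  exact inv_anti₀ (by positivity) (pow_le_pow_right₀ h1 h)

/-- `L^K L^{-k_I} L^{-k_J} = L` when `k_I + k_J + 1 = K` (`|I|·|J| ∼ L h`). [cite: DyatlovJin2018, §3.2 (setting)] -/
theorem pow_mul_gr_mul_gr (hL : 0 < L) {kI kJ K : ℕ} (h : kI + kJ + 1 = K) :
    (L : ℝ) ^ K * gr L kI * gr L kJ = L := by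
  have hL' : (0 : ℝ) < L := by exact_mod_cast hL
  unfold gr
  rw [← h, pow_add, pow_add, pow_one]
  field_simp

/-- `L^K L^{-k_X} L^{-k_J} = 1` when `k_X + k_J = K` (`|I|·|J| ∼ h`, (e:E-J)). [cite: DyatlovJin2018, (e:E-J)] -/
theorem pow_mul_gr_mul_gr' (hL : 0 < L) {kX kJ K : ℕ} (h : kX + kJ = K) :
    (L : ℝ) ^ K * gr L kX * gr L kJ = 1 := by
  have hL' : (0 : ℝ) < L := by exact_mod_cast hL
  unfold gr
  rw [← h, pow_add]
  field_simp

end Grid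

section Keys

variable {S : Finset ℝ} {g : ℝ}

/-- Points of the run with key `b` at grid `g`. [cite: DyatlovJin2018, §2.1 (discretization)] -/
noncomputable def keyPts (S : Finset ℝ) (g : ℝ) (b : ℤ × ℤ) : Finset ℝ :=
  pts S ((b.1 : ℝ) * g) ((b.2 : ℝ) * g)

/-- Centre of the run with key `b` at grid `g`. [cite: DyatlovJin2018, §2.1 (discretization)] -/
noncomputable def keyCtr (g : ℝ) (b : ℤ × ℤ) : ℝ := ((b.1 : ℝ) * g + (b.2 : ℝ) * g) / 2

/-- The run of `y` is the `keyPts` of its key. [folklore] -/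
theorem runPts_eq_keyPts (S : Finset ℝ) (g y : ℝ) : runPts S g y = keyPts S g (runKey S g y) := rfl

/-- The centre of the run of `y` is the `keyCtr` of its key. [folklore] -/
theorem ctr_eq_keyCtr (S : Finset ℝ) (g y : ℝ) : ctr S g y = keyCtr g (runKey S g y) := rfl

/-- Weighted sums over the children of a set of points, as point sums. [folklore] -/
theorem sum_image_card_mul (T : Finset ℝ) (key : ℝ → ℤ × ℤ) (Φ : ℤ × ℤ → ℝ) :
    ∑ b ∈ T.image key, ((T.filter (fun y => key y = b)).card : ℝ) * Φ b = ∑ y ∈ T, Φ (key y) := by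
  classical
  rw [← Finset.sum_fiberwise_of_maps_to (g := key) (fun y hy => Finset.mem_image_of_mem key hy)]
  apply Finset.sum_congr rfl
  intro b _
  rw [Finset.sum_congr rfl (fun y hy => by rw [(Finset.mem_filter.1 hy).2] : ∀ y ∈ T.filter (fun y => key y = b), Φ (key y) = Φ b)]
  rw [Finset.sum_const, nsmul_eq_mul]

/-- Fibre cardinalities over the image of the key map add up to `#T`. [folklore] -/
theorem sum_image_card (T : Finset ℝ) (key : ℝ → ℤ × ℤ) :
    ∑ b ∈ T.image key, ((T.filter (fun y => key y = b)).card : ℝ) = T.card := by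
  have := sum_image_card_mul T key (fun _ => 1)
  simpa using this

/-- For a child key `b` of the run of `x₀`, the fibre is `keyPts`.
[cite: DyatlovJin2018, §2.1 (discretization)] -/
theorem filter_eq_keyPts {L : ℕ} (hL : 0 < L) (hg : 0 < g) {x₀ : ℝ} (hx₀ : x₀ ∈ S) {b : ℤ × ℤ}
    (hb : b ∈ (runPts S g x₀).image (runKey S (g / L))) :
    (runPts S g x₀).filter (fun z => runKey S (g / L) z = b) = keyPts S (g / L) b := by
  rw [Finset.mem_image] at hb
  obtain ⟨y, hy, rfl⟩ := hb
  rw [filter_childKey_eq L hL hg hx₀ hy, runPts_eq_keyPts]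

/-- A child key has a representative point. [folklore] -/
theorem exists_rep {L : ℕ} {x₀ : ℝ} {b : ℤ × ℤ}
    (hb : b ∈ (runPts S g x₀).image (runKey S (g / L))) :
    ∃ y ∈ runPts S g x₀, runKey S (g / L) y = b := by
  simpa [Finset.mem_image] using hb

/-- Sum over a run of a function of the child interval, as a weighted sum over child keys.
[cite: DyatlovJin2018, §3.2 (summing (e:boston-1) over I)] -/
theorem sum_child_sq {L : ℕ} (hL : 0 < L) (hg : 0 < g) {x₀ : ℝ} (hx₀ : x₀ ∈ S) (Ψ : ℝ → ℝ → ℝ) :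
    ∑ x ∈ runPts S g x₀, Ψ ((loIdx S (g / L) x : ℝ) * (g / L)) ((hiIdx S (g / L) x : ℝ) * (g / L)) =
      ((runPts S g x₀).card : ℝ) * ∑ a ∈ (runPts S g x₀).image (runKey S (g / L)),
        ((keyPts S (g / L) a).card : ℝ) / (runPts S g x₀).card *
          Ψ ((a.1 : ℝ) * (g / L)) ((a.2 : ℝ) * (g / L)) := by
  have hI : (0 : ℝ) < (runPts S g x₀).card := by
    exact_mod_cast Finset.card_pos.2 (runPts_nonempty hg hx₀)
  have e1 := sum_image_card_mul (runPts S g x₀) (runKey S (g / L))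
    (fun a => Ψ ((a.1 : ℝ) * (g / L)) ((a.2 : ℝ) * (g / L)))
  have e0 : ∑ x ∈ runPts S g x₀, Ψ ((loIdx S (g / L) x : ℝ) * (g / L)) ((hiIdx S (g / L) x : ℝ) * (g / L)) =
      ∑ y ∈ runPts S g x₀, (fun a : ℤ × ℤ => Ψ ((a.1 : ℝ) * (g / L)) ((a.2 : ℝ) * (g / L)))
        (runKey S (g / L) y) := rfl
  rw [e0, ← e1, Finset.mul_sum]
  apply Finset.sum_congr rfl
  intro a ha
  rw [filter_eq_keyPts hL hg hx₀ ha]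
  field_simp

/-- Weighted sum over child keys of a function of (child points, child centre), as a point sum.
[cite: DyatlovJin2018, (e:tree-measure-sum)] -/
theorem sum_child_w {L : ℕ} (hL : 0 < L) (hg : 0 < g) {y₀ : ℝ} (hy₀ : y₀ ∈ S)
    (Φ : Finset ℝ → ℝ → ℝ) :
    ∑ b ∈ (runPts S g y₀).image (runKey S (g / L)),
        ((keyPts S (g / L) b).card : ℝ) / (runPts S g y₀).card * Φ (keyPts S (g / L) b) (keyCtr (g / L) b) =
      ∑ y ∈ runPts S g y₀, ((runPts S g y₀).card : ℝ)⁻¹ * Φ (runPts S (g / L) y) (ctr S (g / L) y) := by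
  have e1 := sum_image_card_mul (runPts S g y₀) (runKey S (g / L))
    (fun b => ((runPts S g y₀).card : ℝ)⁻¹ * Φ (keyPts S (g / L) b) (keyCtr (g / L) b))
  have e0 : ∑ y ∈ runPts S g y₀, ((runPts S g y₀).card : ℝ)⁻¹ * Φ (runPts S (g / L) y) (ctr S (g / L) y) =
      ∑ y ∈ runPts S g y₀, (fun b : ℤ × ℤ => ((runPts S g y₀).card : ℝ)⁻¹ *
        Φ (keyPts S (g / L) b) (keyCtr (g / L) b)) (runKey S (g / L) y) := rfl
  rw [e0, ← e1]
  apply Finset.sum_congr rfl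
  intro b hb
  rw [filter_eq_keyPts hL hg hy₀ hb]
  ring

end Keys

section Geometry

variable {S : Finset ℝ} {g δ CR h₀ w : ℝ} {L : ℕ}

/-- Geometry of a child interval inside its parent run.
[cite: DyatlovJin2018, Lemma 2.1(1) and §3.2] -/
theorem child_interval_facts (hreg : RegUpTo δ CR h₀ w S) (hδ0 : 0 < δ) (hδ1 : δ < 1) (hCR : 1 ≤ CR)
    (hw : 0 < w) (hg : 0 < g) (hL : 0 < L) (hh : h₀ ≤ g / L) (hg1 : g ≤ 1) {x₀ : ℝ} (hx₀ : x₀ ∈ S)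
    {x : ℝ} (hx : x ∈ runPts S g x₀) :
    (loIdx S g x₀ : ℝ) * g ≤ (loIdx S (g / L) x : ℝ) * (g / L) ∧
      (loIdx S (g / L) x : ℝ) * (g / L) ≤ (hiIdx S (g / L) x : ℝ) * (g / L) ∧
      (hiIdx S (g / L) x : ℝ) * (g / L) ≤ (hiIdx S g x₀ : ℝ) * g ∧
      (hiIdx S (g / L) x : ℝ) * (g / L) - (loIdx S (g / L) x : ℝ) * (g / L) ≤ CR' δ CR * (g / L) := by
  have hL' : (0 : ℝ) < L := by exact_mod_cast hL
  have hL1 : (1 : ℝ) ≤ L := by exact_mod_cast hL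
  have hg' : 0 < g / L := by positivity
  have hg1' : g / L ≤ 1 := (div_le_self hg.le hL1).trans hg1
  have hxS : x ∈ S := runPts_subset x₀ hx
  have hk := runKey_eq_of_mem_runPts hg hx₀ hx
  simp only [runKey, Prod.mk.injEq] at hk
  obtain ⟨n1, n2⟩ := run_nested hL hg hxS
  rw [hk.1] at n1; rw [hk.2] at n2
  refine ⟨n1, (lo_le_self hg' x).trans (self_le_hi hg' x), n2, ?_⟩
  exact run_len_le hreg hδ0 hδ1 hCR hw hg' hh hg1' hxS

/-- The centre of a child run is within `C_R' g / 2` of the centre of the parent run.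
[cite: DyatlovJin2018, §3.2, (e:derbound-iteration)] -/
theorem child_ctr_near (hreg : RegUpTo δ CR h₀ w S) (hδ0 : 0 < δ) (hδ1 : δ < 1) (hCR : 1 ≤ CR)
    (hw : 0 < w) (hg : 0 < g) (hL : 0 < L) (hh : h₀ ≤ g / L) (hg1 : g ≤ 1) {y₀ : ℝ} (hy₀ : y₀ ∈ S)
    {y : ℝ} (hy : y ∈ runPts S g y₀) :
    |ctr S (g / L) y - ctr S g y₀| ≤ CR' δ CR * g / 2 := by
  have hL1 : (1 : ℝ) ≤ L := by exact_mod_cast hL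
  have hhg : h₀ ≤ g := hh.trans (div_le_self hg.le hL1)
  obtain ⟨n1, n12, n2, -⟩ := child_interval_facts hreg hδ0 hδ1 hCR hw hg hL hh hg1 hy₀ hy
  have hlen := run_len_le hreg hδ0 hδ1 hCR hw hg hhg hg1 hy₀
  rw [ctr, ctr, abs_le]
  constructor <;> linarith

/-- Length of a run from below: at least one cell.
[cite: DyatlovJin2018, Lemma 2.1(1), (e:regtree-1)] -/
theorem run_len_ge (hg : 0 < g) {x₀ : ℝ} (hx₀ : x₀ ∈ S) :
    g ≤ (hiIdx S g x₀ : ℝ) * g - (loIdx S g x₀ : ℝ) * g := by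
  have h := (isRun_loIdx_hiIdx hg hx₀).lt
  have : (loIdx S g x₀ : ℝ) + 1 ≤ hiIdx S g x₀ := by exact_mod_cast h
  nlinarith

end Geometry

section Step

variable {SX SY : Finset ℝ} {c : ℝ} {f : ℝ → ℂ} {δ CR h₀ wX wY : ℝ} {L K : ℕ}

/-- The structural hypotheses of Proposition 3.1 of the paper, discrete bilinear case:
regular trees for `X` and `Y`, `|c| = L^K`, and the numerical constraints on `L`, `ε₁`.
[cite: DyatlovJin2018, Proposition 3.1 (hypotheses), (e:L-restriction), (e:epsilon-1)] -/
structure StepHyp (SX SY : Finset ℝ) (c : ℝ) (δ CR h₀ wX wY : ℝ) (L K : ℕ) (ε₁ : ℝ) : Prop where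
  hδ0 : 0 < δ
  hδ1 : δ < 1
  hCR : 1 ≤ CR
  hL : 0 < L
  hL4 : 4 * CR' δ CR ≤ L
  hLbig : 4 * CR' δ CR * CR ^ (2 / δ) ≤ (L : ℝ) ^ (1 / 3 : ℝ)
  hregX : RegUpTo δ CR h₀ wX SX
  hregY : RegUpTo δ CR h₀ wY SY
  hwX : 0 < wX
  hwY : 0 < wY
  hh : h₀ ≤ gr L (K - 1)
  hc : |c| = (L : ℝ) ^ K
  hε₁ : 0 < ε₁
  hε₁a : 2 * Real.sqrt (2 * ε₁) ≤ (L : ℝ) ^ (-δ) / CR' δ CR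
  hε₁b : 4 * ε₁ ≤ (L : ℝ) ^ (-δ) / CR' δ CR
  hη : Real.sqrt (2 * ε₁ / ((L : ℝ) ^ (-δ) / CR' δ CR) ^ 3) ≤ 1 / 8
  hnum : 2 * Real.sqrt (2 * ε₁ / ((L : ℝ) ^ (-δ) / CR' δ CR) ^ 3) +
      8 * (8 * CR' δ CR ^ 2) * (L : ℝ) ^ (-(2 / 3 : ℝ)) ≤
    CR ^ (-(4 / δ)) * (L : ℝ) ^ (-(1 / 3 : ℝ)) / (4 * Real.pi)

/-- The constant `θ = 1/(8 C_R'²)` of (e:theta-restriction).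
[cite: DyatlovJin2018, (e:theta-restriction)] -/
noncomputable def th (δ CR : ℝ) : ℝ := 1 / (8 * CR' δ CR ^ 2)

/-- `0 < θ`. [folklore] -/
theorem th_pos (hδ1 : δ < 1) (hCR : 1 ≤ CR) : 0 < th δ CR := by
  have := one_le_CR' hδ1 hCR
  unfold th; positivity
set_option maxHeartbeats 400000 in -- buildfix (bf3-g26): 160k/180k FAIL, 200k PASS at accept time; line-neutral budget line
/-- **Lemma 3.2** on the tree (inequality (e:boston-1) for one parent `X`-run): the `X`-run of
`x₀` at level `kI`, the `Y`-run of `y₀` at level `kJ`, `kI + kJ + 1 = K`.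
[cite: DyatlovJin2018, Lemma 3.2, (e:boston-1)] -/
theorem step_run {ε₁ : ℝ} (H : StepHyp SX SY c δ CR h₀ wX wY L K ε₁) {kI kJ : ℕ} (hkI : 1 ≤ kI)
    (hkJ : 1 ≤ kJ) (hK : kI + kJ + 1 = K) {gX gY θ : ℝ} (hgX : gX = gr L kI) (hgY : gY = gr L kJ)
    (hθ : θ = th δ CR) (f : ℝ → ℂ) {y₀ : ℝ} (hy₀ : y₀ ∈ SY) {x₀ : ℝ} (hx₀ : x₀ ∈ SX) :
    ∑ x ∈ runPts SX gX x₀,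
        normC θ (TS (runPts SY gY y₀) (ctr SY gY y₀) c f) (TS' (runPts SY gY y₀) (ctr SY gY y₀) c f)
          ((loIdx SX (gX / L) x : ℝ) * (gX / L)) ((hiIdx SX (gX / L) x : ℝ) * (gX / L)) ^ 2 ≤
      (1 - ε₁) * ∑ y ∈ runPts SY gY y₀, ((runPts SY gY y₀).card : ℝ)⁻¹ *
        (((runPts SX gX x₀).card : ℝ) *
          normC θ (TS (runPts SY (gY / L) y) (ctr SY (gY / L) y) c f)
            (TS' (runPts SY (gY / L) y) (ctr SY (gY / L) y) c f)
            ((loIdx SX gX x₀ : ℝ) * gX) ((hiIdx SX gX x₀ : ℝ) * gX) ^ 2) := by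
  classical
  obtain ⟨hδ0, hδ1, hCR, hL, hL4, hLbig, hregX, hregY, hwX, hwY, hh, hc, hε₁, hε₁a, hε₁b, hη, hnum⟩ := H
  have hL' : (0 : ℝ) < L := by exact_mod_cast hL
  have hL1 : 1 ≤ L := hL
  have hL1' : (1 : ℝ) ≤ L := by exact_mod_cast hL
  have hC1 : 1 ≤ CR' δ CR := one_le_CR' hδ1 hCR
  have hC0 : 0 < CR' δ CR := by linarith
  have hCR0 : 0 < CR := by linarith
  have hθ0 : 0 < θ := by rw [hθ]; exact th_pos hδ1 hCR
  have hgX0 : 0 < gX := by rw [hgX]; exact gr_pos hL _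
  have hgY0 : 0 < gY := by rw [hgY]; exact gr_pos hL _
  have hgX1 : gX ≤ 1 := by rw [hgX]; exact gr_le_one hL1 _
  have hgY1 : gY ≤ 1 := by rw [hgY]; exact gr_le_one hL1 _
  have hgX' : 0 < gX / L := by positivity
  have hgY' : 0 < gY / L := by positivity
  -- scales versus h₀
  have hhX : h₀ ≤ gX / L := by
    rw [hgX, ← gr_succ]; exact hh.trans (gr_anti hL1 (by omega))
  have hhY : h₀ ≤ gY / L := by
    rw [hgY, ← gr_succ]; exact hh.trans (gr_anti hL1 (by omega))
  have hhX' : h₀ ≤ gX := hhX.trans (div_le_self hgX0.le hL1')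
  have hhY' : h₀ ≤ gY := hhY.trans (div_le_self hgY0.le hL1')
  have hcgg : |c| * gX * gY = L := by rw [hc, hgX, hgY]; exact pow_mul_gr_mul_gr hL hK
  -- the data of the abstract step
  set I := runPts SX gX x₀ with hI
  set P := runPts SY gY y₀ with hP
  set ζ := ctr SY gY y₀ with hζ
  set α := (loIdx SX gX x₀ : ℝ) * gX with hα
  set β := (hiIdx SX gX x₀ : ℝ) * gX with hβ
  set A := I.image (runKey SX (gX / L)) with hA
  set B := P.image (runKey SY (gY / L)) with hB
  set αa : ℤ × ℤ → ℝ := fun a => (a.1 : ℝ) * (gX / L) with hαa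
  set βa : ℤ × ℤ → ℝ := fun a => (a.2 : ℝ) * (gX / L) with hβa
  set p : ℤ × ℤ → ℝ := fun a => ((keyPts SX (gX / L) a).card : ℝ) / I.card with hp
  set Pb : ℤ × ℤ → Finset ℝ := fun b => keyPts SY (gY / L) b with hPb
  set ζb : ℤ × ℤ → ℝ := fun b => keyCtr (gY / L) b with hζb
  set q : ℤ × ℤ → ℝ := fun b => ((keyPts SY (gY / L) b).card : ℝ) / P.card with hq
  set pmin : ℝ := (L : ℝ) ^ (-δ) / CR' δ CR with hpmin_def
  set ρX : ℝ := gX * (L : ℝ) ^ (-(2 / 3 : ℝ)) with hρX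
  set ρY : ℝ := gY * (L : ℝ) ^ (-(2 / 3 : ℝ)) with hρY
  have hIpos : (0 : ℝ) < I.card := by exact_mod_cast Finset.card_pos.2 (runPts_nonempty hgX0 hx₀)
  have hPpos : (0 : ℝ) < P.card := by exact_mod_cast Finset.card_pos.2 (runPts_nonempty hgY0 hy₀)
  have hPne : P.Nonempty := runPts_nonempty hgY0 hy₀
  have hpmin : 0 < pmin := by positivity
  -- representation of children
  have hArep : ∀ a ∈ A, ∃ x ∈ I, runKey SX (gX / L) x = a := fun a ha => exists_rep ha
  have hBrep : ∀ b ∈ B, ∃ y ∈ P, runKey SY (gY / L) y = b := fun b hb => exists_rep hb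
  -- geometry of X-children
  have hsub : ∀ a ∈ A, α ≤ αa a ∧ αa a ≤ βa a ∧ βa a ≤ β ∧ βa a - αa a ≤ (β - α) / 4 := by
    intro a ha
    obtain ⟨x, hx, rfl⟩ := hArep a ha
    obtain ⟨n1, n12, n2, nlen⟩ :=
      child_interval_facts hregX hδ0 hδ1 hCR hwX hgX0 hL hhX hgX1 hx₀ hx
    refine ⟨n1, n12, n2, ?_⟩
    have hlen : gX ≤ β - α := run_len_ge hgX0 hx₀
    have : CR' δ CR * (gX / L) ≤ gX / 4 := by
      rw [mul_div_assoc']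
      rw [div_le_div_iff₀ hL' (by norm_num : (0:ℝ) < 4)]
      nlinarith
    simp only [hαa, hβa, runKey] at nlen ⊢
    linarith
  -- weights
  have hp0 : ∀ a ∈ A, pmin ≤ p a := by
    intro a ha
    obtain ⟨x, hx, rfl⟩ := hArep a ha
    have hxS : x ∈ SX := runPts_subset x₀ hx
    have := child_card_ratio hregX hδ0 hδ1 hCR hwX hgX0 hL hhX hgX1 hxS
    simp only [hp]
    rw [← runPts_eq_keyPts, hI, ← runPts_eq_of_mem_runPts hgX0 hx₀ hx]
    exact this
  have hq0 : ∀ b ∈ B, pmin ≤ q b := by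
    intro b hb
    obtain ⟨y, hy, rfl⟩ := hBrep b hb
    have hyS : y ∈ SY := runPts_subset y₀ hy
    have := child_card_ratio hregY hδ0 hδ1 hCR hwY hgY0 hL hhY hgY1 hyS
    simp only [hq]
    rw [← runPts_eq_keyPts, hP, ← runPts_eq_of_mem_runPts hgY0 hy₀ hy]
    exact this
  have hp1 : ∑ a ∈ A, p a = 1 := by
    simp only [hp]
    rw [← Finset.sum_div]
    rw [div_eq_one_iff_eq hIpos.ne']
    rw [← sum_image_card I (runKey SX (gX / L))]
    apply Finset.sum_congr rfl
    intro a ha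
    rw [filter_eq_keyPts hL hgX0 hx₀ ha]
  have hq1 : ∑ b ∈ B, q b = 1 := by
    simp only [hq]
    rw [← Finset.sum_div]
    rw [div_eq_one_iff_eq hPpos.ne']
    rw [← sum_image_card P (runKey SY (gY / L))]
    apply Finset.sum_congr rfl
    intro b hb
    rw [filter_eq_keyPts hL hgY0 hy₀ hb]
  -- decomposition of F_J
  have hF : ∀ x, TS P ζ c f x = ∑ b ∈ B, (q b : ℂ) * TS (Pb b) ζ c f x := by
    intro x
    rw [TS_fiberwise P (runKey SY (gY / L)) ζ c f x hPne]
    apply Finset.sum_congr rfl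
    intro b hb
    rw [filter_eq_keyPts hL hgY0 hy₀ hb]
    simp only [hq, hPb, Complex.ofReal_div, Complex.ofReal_natCast]
  have hF' : ∀ x, TS' P ζ c f x = ∑ b ∈ B, (q b : ℂ) * TS' (Pb b) ζ c f x := by
    intro x
    rw [TS'_fiberwise P (runKey SY (gY / L)) ζ c f x hPne]
    apply Finset.sum_congr rfl
    intro b hb
    rw [filter_eq_keyPts hL hgY0 hy₀ hb]
    simp only [hq, hPb, Complex.ofReal_div, Complex.ofReal_natCast]
  -- phase condition
  have hphase : ∀ a ∈ A, ∀ b ∈ B, 4 * θ * (βa a - αa a) * (|c| * |ζb b - ζ|) ≤ 1 := by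
    intro a ha b hb
    obtain ⟨x, hx, rfl⟩ := hArep a ha
    obtain ⟨y, hy, rfl⟩ := hBrep b hb
    obtain ⟨-, n12, -, nlen⟩ := child_interval_facts hregX hδ0 hδ1 hCR hwX hgX0 hL hhX hgX1 hx₀ hx
    have hnear := child_ctr_near hregY hδ0 hδ1 hCR hwY hgY0 hL hhY hgY1 hy₀ hy
    rw [ctr_eq_keyCtr SY (gY / L) y] at hnear
    have h1 : βa (runKey SX (gX / L) x) - αa (runKey SX (gX / L) x) ≤ CR' δ CR * (gX / L) := by
      simp only [hαa, hβa, runKey]; exact nlen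
    have h0 : 0 ≤ βa (runKey SX (gX / L) x) - αa (runKey SX (gX / L) x) := by
      simp only [hαa, hβa, runKey]; linarith
    calc 4 * θ * (βa (runKey SX (gX / L) x) - αa (runKey SX (gX / L) x)) *
          (|c| * |keyCtr (gY / L) (runKey SY (gY / L) y) - ζ|)
        ≤ 4 * θ * (CR' δ CR * (gX / L)) * (|c| * (CR' δ CR * gY / 2)) := by
          apply mul_le_mul _ _ (by positivity) (by positivity)
          · exact mul_le_mul_of_nonneg_left h1 (by positivity)
          · exact mul_le_mul_of_nonneg_left hnear (abs_nonneg c)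
      _ = 2 * θ * CR' δ CR ^ 2 * (|c| * gX * gY) / L := by ring
      _ = 2 * θ * CR' δ CR ^ 2 := by rw [hcgg]; field_simp
      _ = 1 / 4 := by rw [hθ, th]; field_simp; ring
      _ ≤ 1 := by norm_num
  -- far children
  have hfarX : ∃ a₁ ∈ A, ∃ a₂ ∈ A, ∀ x' ∈ Set.Icc (αa a₁) (βa a₁), ∀ x'' ∈ Set.Icc (αa a₂) (βa a₂),
      CR ^ (-(2 / δ)) / 2 * ρX ≤ x' - x'' ∧ x' - x'' ≤ 2 * ρX := by
    obtain ⟨x₁, hx₁, x₂, hx₂, hfar⟩ := (isRun_loIdx_hiIdx hgX0 hx₀).exists_far_children hregX hδ0 hδ1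
      hCR hwX hgX0 hL hhX hgX1 hLbig
    refine ⟨runKey SX (gX / L) x₁, Finset.mem_image_of_mem _ hx₁, runKey SX (gX / L) x₂,
      Finset.mem_image_of_mem _ hx₂, fun x' hx' x'' hx'' => ?_⟩
    exact hfar x' hx'.1 hx'.2 x'' hx''.1 hx''.2
  have hfarY : ∃ b₁ ∈ B, ∃ b₂ ∈ B, CR ^ (-(2 / δ)) / 2 * ρY ≤ ζb b₁ - ζb b₂ ∧ ζb b₁ - ζb b₂ ≤ 2 * ρY := by
    obtain ⟨y₁, hy₁, y₂, hy₂, hfar⟩ := (isRun_loIdx_hiIdx hgY0 hy₀).exists_far_children hregY hδ0 hδ1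
      hCR hwY hgY0 hL hhY hgY1 hLbig
    refine ⟨runKey SY (gY / L) y₁, Finset.mem_image_of_mem _ hy₁, runKey SY (gY / L) y₂,
      Finset.mem_image_of_mem _ hy₂, ?_⟩
    have m1 := lo_le_self (S := SY) hgY' y₁; have m1' := self_le_hi (S := SY) hgY' y₁
    have m2 := lo_le_self (S := SY) hgY' y₂; have m2' := self_le_hi (S := SY) hgY' y₂
    exact hfar _ (by simp only [hζb, keyCtr, runKey]; linarith) (by simp only [hζb, keyCtr, runKey]; linarith)
      _ (by simp only [hζb, keyCtr, runKey]; linarith) (by simp only [hζb, keyCtr, runKey]; linarith)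
  -- numerics
  have hρX0 : 0 < ρX := by positivity
  have hρY0 : 0 < ρY := by positivity
  have hA0 : 0 < CR ^ (-(2 / δ)) := Real.rpow_pos_of_pos hCR0 _
  have hL13 : 4 ≤ (L : ℝ) ^ (1 / 3 : ℝ) := by
    have h1 : 1 ≤ CR ^ (2 / δ) := Real.one_le_rpow hCR (by positivity)
    have h2 : 1 ≤ CR' δ CR * CR ^ (2 / δ) := one_le_mul_of_one_le_of_one_le hC1 h1
    linarith [hLbig]
  have hL13pos : 0 < (L : ℝ) ^ (1 / 3 : ℝ) := by positivity
  have eL : (L : ℝ) ^ (-(2 / 3 : ℝ)) * (L : ℝ) ^ (-(2 / 3 : ℝ)) = (L : ℝ)⁻¹ * (L : ℝ) ^ (-(1 / 3 : ℝ)) := by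
    rw [← Real.rpow_add hL', ← Real.rpow_neg_one, ← Real.rpow_add hL']; norm_num
  have eL2 : (L : ℝ) ^ (-(1 / 3 : ℝ)) = ((L : ℝ) ^ (1 / 3 : ℝ))⁻¹ := Real.rpow_neg hL'.le _
  have hτπ : |c| * (2 * ρX) * (2 * ρY) ≤ Real.pi := by
    have e : |c| * (2 * ρX) * (2 * ρY) = 4 * (|c| * gX * gY) * ((L : ℝ) ^ (-(2 / 3 : ℝ)) * (L : ℝ) ^ (-(2 / 3 : ℝ))) := by
      simp only [hρX, hρY]; ring
    rw [e, hcgg, eL, eL2]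
    have : (4 : ℝ) * L * ((L : ℝ)⁻¹ * ((L : ℝ) ^ (1 / 3 : ℝ))⁻¹) = 4 / (L : ℝ) ^ (1 / 3 : ℝ) := by
      field_simp
    rw [this, div_le_iff₀ hL13pos]
    have h34 : (3 : ℝ) * 4 ≤ Real.pi * (L : ℝ) ^ (1 / 3 : ℝ) :=
      mul_le_mul Real.pi_gt_three.le hL13 (by norm_num) Real.pi_pos.le
    linarith
  have hgain : 2 * Real.sqrt (2 * ε₁ / pmin ^ 3) + 4 * (2 * ρX) / (θ * (β - α)) ≤
      |c| * (CR ^ (-(2 / δ)) / 2 * ρX) * (CR ^ (-(2 / δ)) / 2 * ρY) / Real.pi := by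
    have hlen : gX ≤ β - α := run_len_ge hgX0 hx₀
    have hβα : 0 < β - α := by linarith
    -- second term of the left side
    have hLr : 0 ≤ (L : ℝ) ^ (-(2 / 3 : ℝ)) := (Real.rpow_pos_of_pos hL' _).le
    have t2 : 4 * (2 * ρX) / (θ * (β - α)) ≤ 8 * (8 * CR' δ CR ^ 2) * (L : ℝ) ^ (-(2 / 3 : ℝ)) := by
      rw [div_le_iff₀ (by positivity)]
      calc 4 * (2 * ρX) = 8 * (L : ℝ) ^ (-(2 / 3 : ℝ)) * gX := by simp only [hρX]; ring
        _ ≤ 8 * (L : ℝ) ^ (-(2 / 3 : ℝ)) * (β - α) :=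
            mul_le_mul_of_nonneg_left hlen (by positivity)
        _ = 8 * (8 * CR' δ CR ^ 2) * (L : ℝ) ^ (-(2 / 3 : ℝ)) * (θ * (β - α)) := by
            rw [hθ, th]; field_simp
    -- right side
    have eR : |c| * (CR ^ (-(2 / δ)) / 2 * ρX) * (CR ^ (-(2 / δ)) / 2 * ρY) / Real.pi =
        CR ^ (-(4 / δ)) * (L : ℝ) ^ (-(1 / 3 : ℝ)) / (4 * Real.pi) := by
      have e4 : CR ^ (-(2 / δ)) * CR ^ (-(2 / δ)) = CR ^ (-(4 / δ)) := by
        rw [← Real.rpow_add hCR0]; ring_nf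
      simp only [hρX, hρY]
      calc |c| * (CR ^ (-(2 / δ)) / 2 * (gX * (L : ℝ) ^ (-(2 / 3 : ℝ)))) *
            (CR ^ (-(2 / δ)) / 2 * (gY * (L : ℝ) ^ (-(2 / 3 : ℝ)))) / Real.pi
          = (CR ^ (-(2 / δ)) * CR ^ (-(2 / δ))) * (|c| * gX * gY) *
              ((L : ℝ) ^ (-(2 / 3 : ℝ)) * (L : ℝ) ^ (-(2 / 3 : ℝ))) / (4 * Real.pi) := by ring
        _ = CR ^ (-(4 / δ)) * (L : ℝ) ^ (-(1 / 3 : ℝ)) / (4 * Real.pi) := by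
            rw [e4, hcgg, eL]; field_simp
    rw [eR]
    linarith [hnum, t2]
  -- apply the abstract step
  have key := main_step_abstract (A := A) (B := B) (αa := αa) (βa := βa) (p := p) (Pb := Pb) (ζb := ζb)
    (q := q) (P := P) (ζ := ζ) (c := c) (θ := θ) (α := α) (β := β) (f := f)
    (hPne.image _) hθ0 (by have := run_len_ge hgX0 hx₀; simp only [hα, hβ]; linarith) hsub hpmin hp0 hp1 hq0 hq1
    hF hF' hphase hfarX hfarY (by positivity) (by positivity) hτπ hε₁ hε₁a hε₁b hη hgain
  -- translate both sides to point sums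
  refine (sum_child_sq hL hgX0 hx₀
    (fun lo hi => normC θ (TS P ζ c f) (TS' P ζ c f) lo hi ^ 2)).trans_le ?_
  have key' := mul_le_mul_of_nonneg_left key hIpos.le
  refine le_trans (le_of_eq rfl) (key'.trans (le_of_eq ?_))
  have w' : (∑ b ∈ B, q b * normC θ (TS (Pb b) (ζb b) c f) (TS' (Pb b) (ζb b) c f) α β ^ 2) = _ :=
    sum_child_w hL hgY0 hy₀ (fun Q z => normC θ (TS Q z c f) (TS' Q z c f) α β ^ 2)
  rw [w']
  rw [Finset.mul_sum, Finset.mul_sum, Finset.mul_sum]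
  apply Finset.sum_congr rfl
  intro y _
  ring

end Step

section Iterate

variable {SX SY : Finset ℝ} {c : ℝ} {δ CR h₀ wX wY : ℝ} {L K : ℕ} {ε₁ : ℝ}

/-- `ES SX c f θ L kX P ζ = ∑_{x ∈ S_X} ‖F_J‖²_{𝒞_θ(I_{kX}(x))}` for the `Y`-piece `J = (P, ζ)`: the quantity
`‖E_J‖²_{L²(X)} / w_X` of (e:E-J). [cite: DyatlovJin2018, (e:E-J)] -/
noncomputable def ES (SX : Finset ℝ) (c : ℝ) (f : ℝ → ℂ) (θ : ℝ) (L kX : ℕ) (P : Finset ℝ) (ζ : ℝ) : ℝ :=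
  ∑ x ∈ SX, normC θ (TS P ζ c f) (TS' P ζ c f)
    ((loIdx SX (gr L kX) x : ℝ) * gr L kX) ((hiIdx SX (gr L kX) x : ℝ) * gr L kX) ^ 2

/-- Average of `|f|²` over a finite set of points. [folklore] -/
noncomputable def avgSq (P : Finset ℝ) (f : ℝ → ℂ) : ℝ := (P.card : ℝ)⁻¹ * ∑ y ∈ P, ‖f y‖ ^ 2

/-- `0 ≤ avgSq P f`. [folklore] -/
theorem avgSq_nonneg (P : Finset ℝ) (f : ℝ → ℂ) : 0 ≤ avgSq P f := by
  unfold avgSq; positivity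

/-- Averages of `|f|²` over children average to the average over the parent.
[cite: DyatlovJin2018, (e:tree-measure-sum)] -/
theorem avgSq_children {S : Finset ℝ} {g : ℝ} (hL : 0 < L) (hg : 0 < g) {y₀ : ℝ} (hy₀ : y₀ ∈ S)
    (f : ℝ → ℂ) :
    ∑ y ∈ runPts S g y₀, ((runPts S g y₀).card : ℝ)⁻¹ * avgSq (runPts S (g / L) y) f =
      avgSq (runPts S g y₀) f := by
  classical
  rw [← sum_child_w hL hg hy₀ (fun Q _ => avgSq Q f)]
  have hP : (0 : ℝ) < (runPts S g y₀).card := by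
    exact_mod_cast Finset.card_pos.2 (runPts_nonempty hg hy₀)
  have e : ∀ b ∈ (runPts S g y₀).image (runKey S (g / L)),
      ((keyPts S (g / L) b).card : ℝ) / (runPts S g y₀).card * avgSq (keyPts S (g / L) b) f =
        ((runPts S g y₀).card : ℝ)⁻¹ * ∑ y ∈ (runPts S g y₀).filter (fun z => runKey S (g / L) z = b),
          ‖f y‖ ^ 2 := by
    intro b hb
    rw [filter_eq_keyPts hL hg hy₀ hb]
    have hne : ((keyPts S (g / L) b).card : ℝ) ≠ 0 := by
      rw [← filter_eq_keyPts hL hg hy₀ hb]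
      obtain ⟨y, hy, rfl⟩ := exists_rep hb
      have : y ∈ (runPts S g y₀).filter (fun z => runKey S (g / L) z = runKey S (g / L) y) :=
        Finset.mem_filter.2 ⟨hy, rfl⟩
      exact_mod_cast (Finset.card_pos.2 ⟨y, this⟩).ne'
    unfold avgSq
    field_simp
  rw [Finset.sum_congr rfl e, ← Finset.mul_sum, Finset.sum_fiberwise_of_maps_to
    (fun y hy => Finset.mem_image_of_mem _ hy)]
  rfl

/-- **Lemma 3.2** summed over the `X`-runs ((e:main-step) on the tree).
[cite: DyatlovJin2018, Lemma 3.2, (e:main-step)] -/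
theorem step_level (H : StepHyp SX SY c δ CR h₀ wX wY L K ε₁) {kI kJ : ℕ} (hkI : 1 ≤ kI)
    (hkJ : 1 ≤ kJ) (hK : kI + kJ + 1 = K) {θ : ℝ} (hθ : θ = th δ CR) (f : ℝ → ℂ) {y₀ : ℝ}
    (hy₀ : y₀ ∈ SY) :
    ES SX c f θ L (kI + 1) (runPts SY (gr L kJ) y₀) (ctr SY (gr L kJ) y₀) ≤
      (1 - ε₁) * ∑ y ∈ runPts SY (gr L kJ) y₀, ((runPts SY (gr L kJ) y₀).card : ℝ)⁻¹ *
        ES SX c f θ L kI (runPts SY (gr L (kJ + 1)) y) (ctr SY (gr L (kJ + 1)) y) := by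
  classical
  have hL := H.hL
  have hgX0 : 0 < gr L kI := gr_pos hL _
  unfold ES
  rw [gr_succ kI, gr_succ kJ]
  set gX := gr L kI with hgX
  set gY := gr L kJ with hgY
  set P := runPts SY gY y₀ with hP
  -- the summands, as functions of the interval and of the child point
  set NJ : ℝ → ℝ → ℝ := fun lo hi => normC θ (TS P (ctr SY gY y₀) c f) (TS' P (ctr SY gY y₀) c f) lo hi ^ 2
    with hNJ
  set Nb : ℝ → ℝ → ℝ → ℝ := fun y lo hi => normC θ (TS (runPts SY (gY / L) y) (ctr SY (gY / L) y) c f)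
      (TS' (runPts SY (gY / L) y) (ctr SY (gY / L) y) c f) lo hi ^ 2 with hNb
  set img := SX.image (runKey SX gX) with himg
  have hmaps : ∀ x ∈ SX, runKey SX gX x ∈ img := fun x hx => Finset.mem_image_of_mem _ hx
  -- regroup both sides over X-runs at level kI
  have EL : ∑ x ∈ SX, NJ ((loIdx SX (gX / L) x : ℝ) * (gX / L)) ((hiIdx SX (gX / L) x : ℝ) * (gX / L)) =
      ∑ I ∈ img, ∑ x ∈ SX.filter (fun z => runKey SX gX z = I),
        NJ ((loIdx SX (gX / L) x : ℝ) * (gX / L)) ((hiIdx SX (gX / L) x : ℝ) * (gX / L)) :=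
    (Finset.sum_fiberwise_of_maps_to hmaps _).symm
  have ER : (1 - ε₁) * ∑ y ∈ P, (P.card : ℝ)⁻¹ *
        ∑ x ∈ SX, Nb y ((loIdx SX gX x : ℝ) * gX) ((hiIdx SX gX x : ℝ) * gX) =
      ∑ I ∈ img, (1 - ε₁) * ∑ y ∈ P, (P.card : ℝ)⁻¹ *
        ∑ x ∈ SX.filter (fun z => runKey SX gX z = I), Nb y ((loIdx SX gX x : ℝ) * gX) ((hiIdx SX gX x : ℝ) * gX) := by
    symm
    rw [← Finset.mul_sum]
    congr 1
    rw [Finset.sum_comm]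
    apply Finset.sum_congr rfl
    intro y _
    rw [← Finset.mul_sum, Finset.sum_fiberwise_of_maps_to hmaps]
  change ∑ x ∈ SX, NJ ((loIdx SX (gX / L) x : ℝ) * (gX / L)) ((hiIdx SX (gX / L) x : ℝ) * (gX / L)) ≤
    (1 - ε₁) * ∑ y ∈ P, (P.card : ℝ)⁻¹ *
        ∑ x ∈ SX, Nb y ((loIdx SX gX x : ℝ) * gX) ((hiIdx SX gX x : ℝ) * gX)
  rw [EL, ER]
  apply Finset.sum_le_sum
  intro I hI
  obtain ⟨x₀, hx₀, rfl⟩ := Finset.mem_image.1 hI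
  rw [← runPts_eq_filter_key hgX0 hx₀]
  have hst := step_run H hkI hkJ hK hgX hgY hθ f hy₀ hx₀
  refine hst.trans (le_of_eq ?_)
  congr 1
  apply Finset.sum_congr rfl
  intro y _
  congr 1
  -- the summand is constant on the run of x₀
  have hconst : ∀ x ∈ runPts SX gX x₀, Nb y ((loIdx SX gX x : ℝ) * gX) ((hiIdx SX gX x : ℝ) * gX) =
      Nb y ((loIdx SX gX x₀ : ℝ) * gX) ((hiIdx SX gX x₀ : ℝ) * gX) := by
    intro x hx
    have hk := runKey_eq_of_mem_runPts hgX0 hx₀ hx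
    simp only [runKey, Prod.mk.injEq] at hk
    rw [hk.1, hk.2]
  rw [Finset.sum_congr rfl hconst, Finset.sum_const, nsmul_eq_mul]

end Iterate

section Assemble

variable {SX SY : Finset ℝ} {c : ℝ} {δ CR h₀ wX wY : ℝ} {L K : ℕ} {ε₁ : ℝ}

/-- Under the step hypotheses `ε₁ ≤ 1/4`. [folklore] -/
theorem StepHyp.eps_le (H : StepHyp SX SY c δ CR h₀ wX wY L K ε₁) : ε₁ ≤ 1 / 4 := by
  have hL1 : (1 : ℝ) ≤ L := by exact_mod_cast H.hL
  have h1 : (L : ℝ) ^ (-δ) ≤ 1 :=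
    Real.rpow_le_one_of_one_le_of_nonpos hL1 (by linarith [H.hδ0])
  have hC := one_le_CR' H.hδ1 H.hCR
  have h2 : (L : ℝ) ^ (-δ) / CR' δ CR ≤ 1 := (div_le_self (by positivity) hC).trans h1
  linarith [H.hε₁b]

/-- The start of the iteration, (e:start-iteration): at the finest `Y`-level `K-1` (paired with the
coarsest `X`-level `1`), `‖F_J‖_{𝒞_θ(I)} ≤ (#J)⁻¹ ∑_{y∈J} |f(y)|`. [cite: DyatlovJin2018, (e:start-iteration)] -/
theorem ES_base (H : StepHyp SX SY c δ CR h₀ wX wY L K ε₁) (hK : 2 ≤ K) {θ : ℝ} (hθ : θ = th δ CR)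
    (f : ℝ → ℂ) {y₀ : ℝ} (hy₀ : y₀ ∈ SY) :
    ES SX c f θ L 1 (runPts SY (gr L (K - 1)) y₀) (ctr SY (gr L (K - 1)) y₀) ≤
      (SX.card : ℝ) * avgSq (runPts SY (gr L (K - 1)) y₀) f := by
  obtain ⟨hδ0, hδ1, hCR, hL, hL4, hLbig, hregX, hregY, hwX, hwY, hh, hc, hε₁, hε₁a, hε₁b, hη, hnum⟩ := H
  have hL1 : 1 ≤ L := hL
  have hC1 : 1 ≤ CR' δ CR := one_le_CR' hδ1 hCR
  have hθ0 : 0 < θ := by rw [hθ]; exact th_pos hδ1 hCR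
  set gY := gr L (K - 1) with hgY
  set g1 := gr L 1 with hg1
  set P := runPts SY gY y₀ with hP
  set ζ := ctr SY gY y₀ with hζ
  have hgY0 : 0 < gY := gr_pos hL _
  have hg10 : 0 < g1 := gr_pos hL _
  have hgY1 : gY ≤ 1 := gr_le_one hL1 _
  have hg11 : g1 ≤ 1 := gr_le_one hL1 _
  have hh1 : h₀ ≤ g1 := hh.trans (gr_anti hL1 (by omega))
  have hprod : (L : ℝ) ^ K * g1 * gY = 1 := pow_mul_gr_mul_gr' hL (by omega : 1 + (K - 1) = K)
  have hPpos : (0 : ℝ) < P.card := by exact_mod_cast Finset.card_pos.2 (runPts_nonempty hgY0 hy₀)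
  set avg : ℝ := (P.card : ℝ)⁻¹ * ∑ y ∈ P, ‖f y‖ with havg
  have havg0 : 0 ≤ avg := by positivity
  -- |y - ζ| ≤ C_R' gY / 2 on P
  have hρ : ∀ y ∈ P, |y - ζ| ≤ CR' δ CR * gY / 2 := by
    intro y hy
    have hyS : y ∈ SY := runPts_subset y₀ hy
    obtain ⟨-, h1, h2⟩ := mem_pts.1 hy
    have hk := runKey_eq_of_mem_runPts hgY0 hy₀ hy
    simp only [runKey, Prod.mk.injEq] at hk
    have := abs_sub_ctr_le hregY hδ0 hδ1 hCR hwY hgY0 (hh.trans le_rfl) hgY1 hy₀ h1 h2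
    exact this
  -- pointwise bound on the 𝒞_θ norm
  have hpt : ∀ x ∈ SX, normC θ (TS P ζ c f) (TS' P ζ c f) ((loIdx SX g1 x : ℝ) * g1)
      ((hiIdx SX g1 x : ℝ) * g1) ≤ avg := by
    intro x hx
    have hlohi : (loIdx SX g1 x : ℝ) * g1 ≤ (hiIdx SX g1 x : ℝ) * g1 :=
      (lo_le_self hg10 x).trans (self_le_hi hg10 x)
    have hlen := run_len_le hregX hδ0 hδ1 hCR hwX hg10 hh1 hg11 hx
    apply normC_le hlohi (fun x' _ => norm_TS_le P ζ c f x') _ hθ0.le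
    intro x' _
    have h1 := norm_TS'_le P ζ c f x' hρ
    calc θ * ((hiIdx SX g1 x : ℝ) * g1 - (loIdx SX g1 x : ℝ) * g1) * ‖TS' P ζ c f x'‖
        ≤ θ * (CR' δ CR * g1) * (|c| * (CR' δ CR * gY / 2) * avg) := by
          apply mul_le_mul (mul_le_mul_of_nonneg_left hlen hθ0.le) h1 (norm_nonneg _) (by positivity)
      _ = θ * CR' δ CR ^ 2 / 2 * ((L : ℝ) ^ K * g1 * gY) * avg := by rw [hc]; ring
      _ = 1 / 16 * avg := by rw [hprod, hθ, th]; field_simp; ring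
      _ ≤ avg := by linarith
  -- Jensen for the average
  have hJ : avg ^ 2 ≤ avgSq P f := by
    have := sq_sum_le_card_mul_sum_sq (s := P) (f := fun y => ‖f y‖)
    simp only [havg, avgSq]
    rw [mul_pow, sq, mul_assoc]
    have hP0 : (P.card : ℝ) ≠ 0 := hPpos.ne'
    calc (P.card : ℝ)⁻¹ * ((P.card : ℝ)⁻¹ * (∑ y ∈ P, ‖f y‖) ^ 2)
        ≤ (P.card : ℝ)⁻¹ * ((P.card : ℝ)⁻¹ * ((P.card : ℝ) * ∑ y ∈ P, ‖f y‖ ^ 2)) := by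
          gcongr
      _ = (P.card : ℝ)⁻¹ * ∑ y ∈ P, ‖f y‖ ^ 2 := by field_simp
  unfold ES
  calc ∑ x ∈ SX, normC θ (TS P ζ c f) (TS' P ζ c f) ((loIdx SX g1 x : ℝ) * g1)
        ((hiIdx SX g1 x : ℝ) * g1) ^ 2 ≤ ∑ x ∈ SX, avgSq P f := by
        apply Finset.sum_le_sum
        intro x hx
        have h0 : 0 ≤ normC θ (TS P ζ c f) (TS' P ζ c f) ((loIdx SX g1 x : ℝ) * g1)
            ((hiIdx SX g1 x : ℝ) * g1) :=
          normC_nonneg ((lo_le_self hg10 x).trans (self_le_hi hg10 x)) (continuous_TS _ _ _ _)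
        exact (pow_le_pow_left₀ h0 (hpt x hx) 2).trans hJ
    _ = (SX.card : ℝ) * avgSq P f := by rw [Finset.sum_const, nsmul_eq_mul]

/-- **Proposition 3.1** of the paper on the trees (the iteration): for `kX + kJ = K`,
`ES_{kX}(J) ≤ #S_X (1-ε₁)^{kX-1} avg_J |f|²`. [cite: DyatlovJin2018, Proposition 3.1 (proof)] -/
theorem ES_induct (H : StepHyp SX SY c δ CR h₀ wX wY L K ε₁) (hK : 2 ≤ K) {θ : ℝ} (hθ : θ = th δ CR)
    (f : ℝ → ℂ) : ∀ n kJ : ℕ, 1 ≤ kJ → n + 1 + kJ = K → ∀ y₀ ∈ SY,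
      ES SX c f θ L (n + 1) (runPts SY (gr L kJ) y₀) (ctr SY (gr L kJ) y₀) ≤
        (SX.card : ℝ) * (1 - ε₁) ^ n * avgSq (runPts SY (gr L kJ) y₀) f := by
  intro n
  induction n with
  | zero =>
    intro kJ hkJ hKJ y₀ hy₀
    obtain rfl : kJ = K - 1 := by omega
    simpa using ES_base H hK hθ f hy₀
  | succ m ih =>
    intro kJ hkJ hKJ y₀ hy₀
    have hL := H.hL
    have hgY0 : 0 < gr L kJ := gr_pos hL _
    have hstep := step_level H (kI := m + 1) (by omega) hkJ (by omega) hθ f hy₀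
    refine hstep.trans ?_
    have hε : 0 ≤ 1 - ε₁ := by linarith [H.eps_le]
    have hih : ∀ y ∈ runPts SY (gr L kJ) y₀,
        ES SX c f θ L (m + 1) (runPts SY (gr L (kJ + 1)) y) (ctr SY (gr L (kJ + 1)) y) ≤
          (SX.card : ℝ) * (1 - ε₁) ^ m * avgSq (runPts SY (gr L (kJ + 1)) y) f :=
      fun y hy => ih (kJ + 1) (by omega) (by omega) y (runPts_subset y₀ hy)
    calc (1 - ε₁) * ∑ y ∈ runPts SY (gr L kJ) y₀, ((runPts SY (gr L kJ) y₀).card : ℝ)⁻¹ *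
          ES SX c f θ L (m + 1) (runPts SY (gr L (kJ + 1)) y) (ctr SY (gr L (kJ + 1)) y)
        ≤ (1 - ε₁) * ∑ y ∈ runPts SY (gr L kJ) y₀, ((runPts SY (gr L kJ) y₀).card : ℝ)⁻¹ *
          ((SX.card : ℝ) * (1 - ε₁) ^ m * avgSq (runPts SY (gr L (kJ + 1)) y) f) := by
          apply mul_le_mul_of_nonneg_left _ hε
          apply Finset.sum_le_sum
          intro y hy
          exact mul_le_mul_of_nonneg_left (hih y hy) (by positivity)
      _ = (SX.card : ℝ) * (1 - ε₁) ^ (m + 1) *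
          ∑ y ∈ runPts SY (gr L kJ) y₀, ((runPts SY (gr L kJ) y₀).card : ℝ)⁻¹ *
            avgSq (runPts SY (gr L kJ / L) y) f := by
          rw [gr_succ, Finset.mul_sum, Finset.mul_sum]
          apply Finset.sum_congr rfl
          intro y _
          ring
      _ = (SX.card : ℝ) * (1 - ε₁) ^ (m + 1) * avgSq (runPts SY (gr L kJ) y₀) f := by
          rw [avgSq_children hL hgY0 hy₀ f]

/-- The trigonometric sum over a run equals `#J · e^{icζx} F_J(x)`.
[cite: DyatlovJin2018, (e:F-J-2)] -/
theorem sum_run_eq_TS (P : Finset ℝ) (hP : P.Nonempty) (ζ c : ℝ) (f : ℝ → ℂ) (x : ℝ) :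
    ∑ y ∈ P, ex (c * y * x) * f y = (P.card : ℂ) * (ex (c * ζ * x) * TS P ζ c f x) := by
  unfold TS
  have hP0 : (P.card : ℂ) ≠ 0 := by exact_mod_cast (Finset.card_pos.2 hP).ne'
  rw [← mul_assoc, mul_comm (P.card : ℂ), mul_assoc, ← mul_assoc (P.card : ℂ), mul_inv_cancel₀ hP0,
    one_mul, Finset.mul_sum]
  apply Finset.sum_congr rfl
  intro y _
  rw [← mul_assoc, ← ex_add]
  congr 2
  ring

/-- **Proposition 3.1** of the paper, discrete bilinear case (unweighted form): under `StepHyp`,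
`∑_{x∈S_X} |∑_{y∈S_Y} e^{icxy} f(y)|² ≤ #S_X #S_Y (1-ε₁)^{K-2} ∑_{y∈S_Y} |f(y)|²`.
[cite: DyatlovJin2018, Proposition 3.1] -/
theorem core_bound (H : StepHyp SX SY c δ CR h₀ wX wY L K ε₁) (hK : 2 ≤ K) (f : ℝ → ℂ) :
    ∑ x ∈ SX, ‖∑ y ∈ SY, ex (c * y * x) * f y‖ ^ 2 ≤
      (SX.card : ℝ) * SY.card * (1 - ε₁) ^ (K - 2) * ∑ y ∈ SY, ‖f y‖ ^ 2 := by
  classical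
  have hL := H.hL
  set θ := th δ CR with hθ
  set g1 := gr L 1 with hg1
  set gX := gr L (K - 1) with hgX
  have hg10 : 0 < g1 := gr_pos hL _
  have hgX0 : 0 < gX := gr_pos hL _
  set img := SY.image (runKey SY g1) with himg
  have hmaps : ∀ y ∈ SY, runKey SY g1 y ∈ img := fun y hy => Finset.mem_image_of_mem _ hy
  -- data attached to a key
  set nJ : ℤ × ℤ → ℝ := fun J => ((keyPts SY g1 J).card : ℝ) with hnJ
  set N : ℤ × ℤ → ℝ → ℝ := fun J x => normC θ (TS (keyPts SY g1 J) (keyCtr g1 J) c f)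
    (TS' (keyPts SY g1 J) (keyCtr g1 J) c f) ((loIdx SX gX x : ℝ) * gX) ((hiIdx SX gX x : ℝ) * gX) with hN
  have hfib : ∀ J ∈ img, ∃ y₀ ∈ SY, runKey SY g1 y₀ = J ∧
      SY.filter (fun y => runKey SY g1 y = J) = keyPts SY g1 J := by
    intro J hJ
    obtain ⟨y₀, hy₀, rfl⟩ := Finset.mem_image.1 hJ
    exact ⟨y₀, hy₀, rfl, by rw [← runPts_eq_filter_key hg10 hy₀]; rfl⟩
  -- pointwise bound
  have hpt : ∀ x ∈ SX, ‖∑ y ∈ SY, ex (c * y * x) * f y‖ ≤ ∑ J ∈ img, nJ J * N J x := by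
    intro x hx
    rw [← Finset.sum_fiberwise_of_maps_to hmaps]
    refine (norm_sum_le _ _).trans (Finset.sum_le_sum fun J hJ => ?_)
    obtain ⟨y₀, hy₀, hkey, hfil⟩ := hfib J hJ
    rw [hfil]
    have hne : (keyPts SY g1 J).Nonempty := by
      rw [← hkey, ← runPts_eq_keyPts]; exact runPts_nonempty hg10 hy₀
    rw [sum_run_eq_TS _ hne (keyCtr g1 J) c f x, norm_mul, norm_mul, norm_ex, one_mul,
      Complex.norm_natCast]
    apply mul_le_mul_of_nonneg_left _ (by positivity)
    exact norm_le_normC (continuous_TS _ _ _ _) ⟨lo_le_self hgX0 x, self_le_hi hgX0 x⟩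
  have hcard : ∑ J ∈ img, nJ J = SY.card := by
    rw [← sum_image_card SY (runKey SY g1)]
    apply Finset.sum_congr rfl
    intro J hJ
    obtain ⟨y₀, hy₀, hkey, hfil⟩ := hfib J hJ
    simp only [hnJ]; rw [hfil]
  -- square and Cauchy–Schwarz
  have hsq : ∀ x ∈ SX, ‖∑ y ∈ SY, ex (c * y * x) * f y‖ ^ 2 ≤ SY.card * ∑ J ∈ img, nJ J * N J x ^ 2 := by
    intro x hx
    have h0 : ∀ J ∈ img, 0 ≤ N J x := fun J _ =>
      normC_nonneg ((lo_le_self hgX0 x).trans (self_le_hi hgX0 x)) (continuous_TS _ _ _ _)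
    have h1 := hpt x hx
    have h2 : (∑ J ∈ img, nJ J * N J x) ^ 2 ≤ (∑ J ∈ img, nJ J) * ∑ J ∈ img, nJ J * N J x ^ 2 :=
      sum_sq_le_sum_mul_sum_of_sq_le_mul img (fun J _ => by positivity)
        (fun J hJ => by have := h0 J hJ; positivity) (fun J _ => by ring_nf; rfl)
    rw [hcard] at h2
    exact (pow_le_pow_left₀ (norm_nonneg _) h1 2).trans h2
  -- ES bound for each key
  have hES : ∀ J ∈ img, nJ J * ∑ x ∈ SX, N J x ^ 2 ≤
      (SX.card : ℝ) * (1 - ε₁) ^ (K - 2) * ∑ y ∈ SY.filter (fun y => runKey SY g1 y = J), ‖f y‖ ^ 2 := by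
    intro J hJ
    obtain ⟨y₀, hy₀, hkey, hfil⟩ := hfib J hJ
    have hI := ES_induct H hK hθ f (K - 2) 1 le_rfl (by omega) y₀ hy₀
    have e : K - 2 + 1 = K - 1 := by omega
    rw [e] at hI
    -- identify
    have hP : runPts SY g1 y₀ = keyPts SY g1 J := by rw [← hkey]; rfl
    have hζ : ctr SY g1 y₀ = keyCtr g1 J := by rw [← hkey]; rfl
    unfold ES at hI
    rw [hP, hζ] at hI
    rw [hfil]
    have hnpos : (0 : ℝ) < nJ J := by
      simp only [hnJ]; rw [← hP]; exact_mod_cast Finset.card_pos.2 (runPts_nonempty hg10 hy₀)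
    calc nJ J * ∑ x ∈ SX, N J x ^ 2 ≤ nJ J * ((SX.card : ℝ) * (1 - ε₁) ^ (K - 2) * avgSq (keyPts SY g1 J) f) :=
          mul_le_mul_of_nonneg_left hI hnpos.le
      _ = (SX.card : ℝ) * (1 - ε₁) ^ (K - 2) * ∑ y ∈ keyPts SY g1 J, ‖f y‖ ^ 2 := by
          have hne : ((keyPts SY g1 J).card : ℝ) ≠ 0 := by simpa [hnJ] using hnpos.ne'
          simp only [avgSq, hnJ]; field_simp
  -- assemble
  calc ∑ x ∈ SX, ‖∑ y ∈ SY, ex (c * y * x) * f y‖ ^ 2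
      ≤ ∑ x ∈ SX, (SY.card * ∑ J ∈ img, nJ J * N J x ^ 2) := Finset.sum_le_sum hsq
    _ = SY.card * ∑ J ∈ img, nJ J * ∑ x ∈ SX, N J x ^ 2 := by
        rw [← Finset.mul_sum, Finset.sum_comm]
        congr 1
        apply Finset.sum_congr rfl; intro J _; rw [Finset.mul_sum]
    _ ≤ SY.card * ∑ J ∈ img, ((SX.card : ℝ) * (1 - ε₁) ^ (K - 2) *
          ∑ y ∈ SY.filter (fun y => runKey SY g1 y = J), ‖f y‖ ^ 2) := by
        apply mul_le_mul_of_nonneg_left (Finset.sum_le_sum hES) (by positivity)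
    _ = (SX.card : ℝ) * SY.card * (1 - ε₁) ^ (K - 2) * ∑ y ∈ SY, ‖f y‖ ^ 2 := by
        rw [← Finset.mul_sum, Finset.sum_fiberwise_of_maps_to hmaps]; ring

end Assemble

/-! ### G. Constants, numerology, and the proof of Proposition 4.6 -/

section Constants

variable {δ CR : ℝ}

/-- The base quantity `512 π C_R'² C_R^{4/δ}`; the tree base `L` is at least its cube. [folklore] -/
noncomputable def bse (δ CR : ℝ) : ℝ := 512 * Real.pi * CR' δ CR ^ 2 * CR ^ (4 / δ)

/-- `Λ = (512 π C_R'² C_R^{4/δ})³`. [folklore] -/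
noncomputable def Lam (δ CR : ℝ) : ℝ := bse δ CR ^ 3

/-- The base `L = ⌈Λ⌉` of the trees (the paper takes `L ≥ (2C_R'(6C_R)^{2/δ})⁶`, (e:L-restriction);
any admissible choice works and we re-derive the constraints). [cite: DyatlovJin2018, (e:L-restriction)] -/
noncomputable def Lnat (δ CR : ℝ) : ℕ := ⌈Lam δ CR⌉₊

/-- Lower bound `p_min = L^{-δ}/C_R'` for the convex coefficients, (e:pq-bound).
[cite: DyatlovJin2018, (e:pq-bound)] -/
noncomputable def pmn (δ CR : ℝ) : ℝ := ((Lnat δ CR : ℝ)) ^ (-δ) / CR' δ CR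

/-- The gain `ε₁` per step (our admissible variant of (e:epsilon-1)).
[cite: DyatlovJin2018, (e:epsilon-1)] -/
noncomputable def eps1 (δ CR : ℝ) : ℝ :=
  pmn δ CR ^ 3 / 2 * (CR ^ (-(4 / δ)) * ((Lnat δ CR : ℝ) ^ (1 / 3 : ℝ))⁻¹ / (16 * Real.pi)) ^ 2

/-- `4 ≤ 512 π C_R'² C_R^{4/δ}`. [folklore] -/
theorem four_le_bse (hδ0 : 0 < δ) (hδ1 : δ < 1) (hCR : 1 ≤ CR) : 4 ≤ bse δ CR := by
  have hC := one_le_CR' hδ1 hCR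
  have h1 : 1 ≤ CR ^ (4 / δ) := Real.one_le_rpow hCR (by positivity)
  have h2 : 1 ≤ CR' δ CR ^ 2 := by nlinarith
  have h3 : (1 : ℝ) ≤ CR' δ CR ^ 2 * CR ^ (4 / δ) := one_le_mul_of_one_le_of_one_le h2 h1
  unfold bse
  nlinarith [Real.pi_gt_three]

/-- `0 < 512 π C_R'² C_R^{4/δ}`. [folklore] -/
theorem bse_pos (hδ0 : 0 < δ) (hδ1 : δ < 1) (hCR : 1 ≤ CR) : 0 < bse δ CR :=
  lt_of_lt_of_le (by norm_num) (four_le_bse hδ0 hδ1 hCR)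

/-- `1 ≤ Λ`. [folklore] -/
theorem one_le_Lam (hδ0 : 0 < δ) (hδ1 : δ < 1) (hCR : 1 ≤ CR) : 1 ≤ Lam δ CR := by
  have := four_le_bse hδ0 hδ1 hCR
  unfold Lam
  exact one_le_pow₀ (by linarith)

/-- `512 π C_R'² C_R^{4/δ} ≤ Λ`. [folklore] -/
theorem bse_le_Lam (hδ0 : 0 < δ) (hδ1 : δ < 1) (hCR : 1 ≤ CR) : bse δ CR ≤ Lam δ CR := by
  have := four_le_bse hδ0 hδ1 hCR
  unfold Lam
  exact le_self_pow₀ (by linarith) (by norm_num)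

/-- `Λ ≤ L`. [folklore] -/
theorem Lam_le_L (δ CR : ℝ) : Lam δ CR ≤ (Lnat δ CR : ℝ) := Nat.le_ceil _

/-- `L ≤ 2Λ`. [folklore] -/
theorem L_le_two_Lam (hδ0 : 0 < δ) (hδ1 : δ < 1) (hCR : 1 ≤ CR) : (Lnat δ CR : ℝ) ≤ 2 * Lam δ CR := by
  have h1 := one_le_Lam hδ0 hδ1 hCR
  have h2 : (Lnat δ CR : ℝ) < Lam δ CR + 1 := Nat.ceil_lt_add_one (by linarith)
  linarith

/-- `0 < L`. [folklore] -/
theorem Lnat_pos (hδ0 : 0 < δ) (hδ1 : δ < 1) (hCR : 1 ≤ CR) : 0 < Lnat δ CR := by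
  have : (0 : ℝ) < Lnat δ CR := lt_of_lt_of_le one_pos ((one_le_Lam hδ0 hδ1 hCR).trans (Lam_le_L δ CR))
  exact_mod_cast this

/-- `7 ≤ L` (so `L > 2π`). [folklore] -/
theorem seven_le_L (hδ0 : 0 < δ) (hδ1 : δ < 1) (hCR : 1 ≤ CR) : 7 ≤ (Lnat δ CR : ℝ) := by
  have h4 := four_le_bse hδ0 hδ1 hCR
  have : (64 : ℝ) ≤ Lam δ CR := by
    unfold Lam
    have := pow_le_pow_left₀ (by norm_num) h4 3
    norm_num at this
    exact this
  linarith [Lam_le_L δ CR]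

/-- `1 < L`. [folklore] -/
theorem one_lt_Lnat (hδ0 : 0 < δ) (hδ1 : δ < 1) (hCR : 1 ≤ CR) : 1 < Lnat δ CR := by
  have := seven_le_L hδ0 hδ1 hCR
  exact_mod_cast (show (1 : ℝ) < Lnat δ CR by linarith)

/-- `512 π C_R'² C_R^{4/δ} ≤ L^{1/3}`. [folklore] -/
theorem bse_le_cbrtL (hδ0 : 0 < δ) (hδ1 : δ < 1) (hCR : 1 ≤ CR) :
    bse δ CR ≤ (Lnat δ CR : ℝ) ^ (1 / 3 : ℝ) := by
  have hb := bse_pos hδ0 hδ1 hCR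
  have e : bse δ CR = (Lam δ CR) ^ (1 / 3 : ℝ) := by
    unfold Lam
    rw [show (1 / 3 : ℝ) = ((3 : ℕ) : ℝ)⁻¹ by norm_num, Real.pow_rpow_inv_natCast hb.le (by norm_num)]
  rw [e]
  exact Real.rpow_le_rpow (by linarith [one_le_Lam hδ0 hδ1 hCR]) (Lam_le_L δ CR) (by norm_num)

/-- `4 C_R' C_R^{2/δ} ≤ L^{1/3}` (our form of (e:tree-L-bound)). [cite: DyatlovJin2018, Lemma 2.1(3), (e:tree-L-bound)] -/
theorem hLbig_L (hδ0 : 0 < δ) (hδ1 : δ < 1) (hCR : 1 ≤ CR) :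
    4 * CR' δ CR * CR ^ (2 / δ) ≤ (Lnat δ CR : ℝ) ^ (1 / 3 : ℝ) := by
  refine le_trans ?_ (bse_le_cbrtL hδ0 hδ1 hCR)
  have hC := one_le_CR' hδ1 hCR
  have h1 : 1 ≤ CR ^ (2 / δ) := Real.one_le_rpow hCR (by positivity)
  have h2 : CR ^ (2 / δ) ≤ CR ^ (4 / δ) :=
    Real.rpow_le_rpow_of_exponent_le hCR (by gcongr; norm_num)
  unfold bse
  have h3 : 4 * CR' δ CR ≤ 512 * Real.pi * CR' δ CR ^ 2 := by nlinarith [Real.pi_gt_three]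
  calc 4 * CR' δ CR * CR ^ (2 / δ) ≤ (512 * Real.pi * CR' δ CR ^ 2) * CR ^ (2 / δ) :=
        mul_le_mul_of_nonneg_right h3 (by positivity)
    _ ≤ 512 * Real.pi * CR' δ CR ^ 2 * CR ^ (4 / δ) := mul_le_mul_of_nonneg_left h2 (by positivity)

/-- `4 C_R' ≤ L` (children are at most a quarter of the parent, Lemma 2.3 hypothesis). [cite: DyatlovJin2018, Lemma 3.3 (proof)] -/
theorem hL4_L (hδ0 : 0 < δ) (hδ1 : δ < 1) (hCR : 1 ≤ CR) : 4 * CR' δ CR ≤ (Lnat δ CR : ℝ) := by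
  have hC := one_le_CR' hδ1 hCR
  have h1 : 1 ≤ CR ^ (4 / δ) := Real.one_le_rpow hCR (by positivity)
  have h2 : 4 * CR' δ CR ≤ bse δ CR := by
    unfold bse
    have : 4 * CR' δ CR ≤ 512 * Real.pi * CR' δ CR ^ 2 := by nlinarith [Real.pi_gt_three]
    calc 4 * CR' δ CR ≤ (512 * Real.pi * CR' δ CR ^ 2) * 1 := by linarith
      _ ≤ 512 * Real.pi * CR' δ CR ^ 2 * CR ^ (4 / δ) := mul_le_mul_of_nonneg_left h1 (by positivity)
  exact h2.trans ((bse_le_Lam hδ0 hδ1 hCR).trans (Lam_le_L δ CR))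

/-- `0 < p_min`. [folklore] -/
theorem pmn_pos (hδ0 : 0 < δ) (hδ1 : δ < 1) (hCR : 1 ≤ CR) : 0 < pmn δ CR := by
  have hL : (0 : ℝ) < Lnat δ CR := by exact_mod_cast Lnat_pos hδ0 hδ1 hCR
  have hC := one_le_CR' hδ1 hCR
  unfold pmn; positivity

/-- `p_min ≤ 1`. [folklore] -/
theorem pmn_le_one (hδ0 : 0 < δ) (hδ1 : δ < 1) (hCR : 1 ≤ CR) : pmn δ CR ≤ 1 := by
  have hL1 : (1 : ℝ) ≤ Lnat δ CR := by exact_mod_cast Lnat_pos hδ0 hδ1 hCR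
  have h1 : (Lnat δ CR : ℝ) ^ (-δ) ≤ 1 := Real.rpow_le_one_of_one_le_of_nonpos hL1 (by linarith)
  have hC := one_le_CR' hδ1 hCR
  unfold pmn
  exact (div_le_self (by positivity) hC).trans h1

/-- The quantity `η = √(2ε₁/p_min³)` equals `C_R^{-4/δ} L^{-1/3}/(16π)` by the choice of `ε₁`.
[folklore] -/
theorem eta_eq (hδ0 : 0 < δ) (hδ1 : δ < 1) (hCR : 1 ≤ CR) :
    Real.sqrt (2 * eps1 δ CR / pmn δ CR ^ 3) =
      CR ^ (-(4 / δ)) * ((Lnat δ CR : ℝ) ^ (1 / 3 : ℝ))⁻¹ / (16 * Real.pi) := by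
  have hp := pmn_pos hδ0 hδ1 hCR
  have hL : (0 : ℝ) < Lnat δ CR := by exact_mod_cast Lnat_pos hδ0 hδ1 hCR
  have hCR0 : 0 < CR := by linarith
  have hq : 0 ≤ CR ^ (-(4 / δ)) * ((Lnat δ CR : ℝ) ^ (1 / 3 : ℝ))⁻¹ / (16 * Real.pi) := by positivity
  unfold eps1
  have e : 2 * (pmn δ CR ^ 3 / 2 * (CR ^ (-(4 / δ)) * ((Lnat δ CR : ℝ) ^ (1 / 3 : ℝ))⁻¹ / (16 * Real.pi)) ^ 2) /
      pmn δ CR ^ 3 = (CR ^ (-(4 / δ)) * ((Lnat δ CR : ℝ) ^ (1 / 3 : ℝ))⁻¹ / (16 * Real.pi)) ^ 2 := by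
    field_simp
  rw [e, Real.sqrt_sq hq]

/-- `η ≤ 1/8`. [folklore] -/
theorem eta_le (hδ0 : 0 < δ) (hδ1 : δ < 1) (hCR : 1 ≤ CR) :
    CR ^ (-(4 / δ)) * ((Lnat δ CR : ℝ) ^ (1 / 3 : ℝ))⁻¹ / (16 * Real.pi) ≤ 1 / 8 := by
  have hCR0 : 0 < CR := by linarith
  have hA : CR ^ (-(4 / δ)) ≤ 1 := Real.rpow_le_one_of_one_le_of_nonpos hCR (by
    have : 0 < 4 / δ := by positivity
    linarith)
  have ht : 4 ≤ (Lnat δ CR : ℝ) ^ (1 / 3 : ℝ) := (four_le_bse hδ0 hδ1 hCR).trans (bse_le_cbrtL hδ0 hδ1 hCR)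
  have ht' : ((Lnat δ CR : ℝ) ^ (1 / 3 : ℝ))⁻¹ ≤ 1 := inv_le_one_of_one_le₀ (by linarith)
  have hprod : CR ^ (-(4 / δ)) * ((Lnat δ CR : ℝ) ^ (1 / 3 : ℝ))⁻¹ ≤ 1 := by
    calc CR ^ (-(4 / δ)) * ((Lnat δ CR : ℝ) ^ (1 / 3 : ℝ))⁻¹ ≤ 1 * 1 :=
          mul_le_mul hA ht' (by positivity) (by norm_num)
      _ = 1 := by norm_num
  rw [div_le_iff₀ (by positivity)]
  nlinarith [Real.pi_gt_three]

/-- `0 < ε₁`. [folklore] -/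
theorem eps1_pos (hδ0 : 0 < δ) (hδ1 : δ < 1) (hCR : 1 ≤ CR) : 0 < eps1 δ CR := by
  have hp := pmn_pos hδ0 hδ1 hCR
  have hL : (0 : ℝ) < Lnat δ CR := by exact_mod_cast Lnat_pos hδ0 hδ1 hCR
  have hCR0 : 0 < CR := by linarith
  unfold eps1; positivity

/-- `ε₁ ≤ p_min³/128`. [folklore] -/
theorem eps1_le (hδ0 : 0 < δ) (hδ1 : δ < 1) (hCR : 1 ≤ CR) :
    eps1 δ CR ≤ pmn δ CR ^ 3 / 128 := by
  have hp := pmn_pos hδ0 hδ1 hCR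
  have h := eta_le hδ0 hδ1 hCR
  have h0 : 0 ≤ CR ^ (-(4 / δ)) * ((Lnat δ CR : ℝ) ^ (1 / 3 : ℝ))⁻¹ / (16 * Real.pi) := by
    have hCR0 : 0 < CR := by linarith
    have hL : (0 : ℝ) < Lnat δ CR := by exact_mod_cast Lnat_pos hδ0 hδ1 hCR
    positivity
  have hsq : (CR ^ (-(4 / δ)) * ((Lnat δ CR : ℝ) ^ (1 / 3 : ℝ))⁻¹ / (16 * Real.pi)) ^ 2 ≤ (1 / 8) ^ 2 :=
    pow_le_pow_left₀ h0 h 2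
  unfold eps1
  have : pmn δ CR ^ 3 / 2 * (CR ^ (-(4 / δ)) * ((Lnat δ CR : ℝ) ^ (1 / 3 : ℝ))⁻¹ / (16 * Real.pi)) ^ 2 ≤
      pmn δ CR ^ 3 / 2 * (1 / 8) ^ 2 := mul_le_mul_of_nonneg_left hsq (by positivity)
  linarith

/-- `2√(2ε₁) ≤ p_min` (hypothesis of the extreme-`ℓ²` lemma, cf. Lemma 3.4). [cite: DyatlovJin2018, Lemma 3.4 (proof)] -/
theorem heps1a (hδ0 : 0 < δ) (hδ1 : δ < 1) (hCR : 1 ≤ CR) :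
    2 * Real.sqrt (2 * eps1 δ CR) ≤ pmn δ CR := by
  have hp := pmn_pos hδ0 hδ1 hCR
  have hp1 := pmn_le_one hδ0 hδ1 hCR
  have he := eps1_le hδ0 hδ1 hCR
  have he0 := (eps1_pos hδ0 hδ1 hCR).le
  -- 2√(2ε₁) ≤ p ⟸ 8 ε₁ ≤ p²
  have hp3 : pmn δ CR ^ 3 ≤ pmn δ CR ^ 2 := by nlinarith
  have h8 : 8 * eps1 δ CR ≤ pmn δ CR ^ 2 := by linarith
  have : Real.sqrt (2 * eps1 δ CR) ≤ pmn δ CR / 2 := by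
    rw [Real.sqrt_le_left (by positivity)]
    nlinarith
  linarith

/-- `4ε₁ ≤ p_min` (hypothesis of the extreme-`ℓ¹` lemma, cf. Lemma 3.6). [cite: DyatlovJin2018, Lemma 3.6 (proof)] -/
theorem heps1b (hδ0 : 0 < δ) (hδ1 : δ < 1) (hCR : 1 ≤ CR) : 4 * eps1 δ CR ≤ pmn δ CR := by
  have hp := pmn_pos hδ0 hδ1 hCR
  have hp1 := pmn_le_one hδ0 hδ1 hCR
  have he := eps1_le hδ0 hδ1 hCR
  have hp2 : pmn δ CR ^ 2 ≤ 1 := by nlinarith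
  have hp3 : pmn δ CR ^ 3 ≤ pmn δ CR := by nlinarith
  linarith

/-- The final numerical constraint of the contradiction at the end of §3.2 for our `L`, `ε₁`. [cite: DyatlovJin2018, §3.2 (end of proof of Lemma 3.2)] -/
theorem hnum_L (hδ0 : 0 < δ) (hδ1 : δ < 1) (hCR : 1 ≤ CR) :
    2 * Real.sqrt (2 * eps1 δ CR / pmn δ CR ^ 3) +
        8 * (8 * CR' δ CR ^ 2) * (Lnat δ CR : ℝ) ^ (-(2 / 3 : ℝ)) ≤
      CR ^ (-(4 / δ)) * (Lnat δ CR : ℝ) ^ (-(1 / 3 : ℝ)) / (4 * Real.pi) := by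
  rw [eta_eq hδ0 hδ1 hCR]
  have hL : (0 : ℝ) < Lnat δ CR := by exact_mod_cast Lnat_pos hδ0 hδ1 hCR
  have hCR0 : 0 < CR := by linarith
  set t : ℝ := (Lnat δ CR : ℝ) ^ (1 / 3 : ℝ) with ht
  have htpos : 0 < t := by positivity
  have hbt : bse δ CR ≤ t := bse_le_cbrtL hδ0 hδ1 hCR
  have e1 : (Lnat δ CR : ℝ) ^ (-(1 / 3 : ℝ)) = t⁻¹ := by rw [ht, ← Real.rpow_neg hL.le]
  have e2 : (Lnat δ CR : ℝ) ^ (-(2 / 3 : ℝ)) = t⁻¹ * t⁻¹ := by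
    rw [← e1, ← Real.rpow_add hL]; norm_num
  rw [e1, e2]
  set A : ℝ := CR ^ (-(4 / δ)) with hA
  have hApos : 0 < A := Real.rpow_pos_of_pos hCR0 _
  have hAinv : A * CR ^ (4 / δ) = 1 := by
    rw [hA, ← Real.rpow_add hCR0]; simp
  -- the claim reduces to 512 π C_R'² t⁻¹ ≤ A, i.e. bse ≤ t
  have key : 64 * CR' δ CR ^ 2 * t⁻¹ ≤ A / (8 * Real.pi) := by
    rw [le_div_iff₀ (by positivity)]
    have : 64 * CR' δ CR ^ 2 * t⁻¹ * (8 * Real.pi) = bse δ CR * t⁻¹ * A := by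
      rw [show bse δ CR = 512 * Real.pi * CR' δ CR ^ 2 * CR ^ (4 / δ) from rfl]
      calc 64 * CR' δ CR ^ 2 * t⁻¹ * (8 * Real.pi)
          = 512 * Real.pi * CR' δ CR ^ 2 * t⁻¹ * (A * CR ^ (4 / δ)) := by rw [hAinv]; ring
        _ = 512 * Real.pi * CR' δ CR ^ 2 * CR ^ (4 / δ) * t⁻¹ * A := by ring
    rw [this]
    calc bse δ CR * t⁻¹ * A ≤ t * t⁻¹ * A := by
          apply mul_le_mul_of_nonneg_right _ hApos.le
          exact mul_le_mul_of_nonneg_right hbt (by positivity)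
      _ = A := by field_simp
  have e3 : 2 * (A * t⁻¹ / (16 * Real.pi)) = (A / (8 * Real.pi)) * t⁻¹ := by ring
  have e4 : A * t⁻¹ / (4 * Real.pi) = 2 * ((A / (8 * Real.pi)) * t⁻¹) := by ring
  rw [e3, e4]
  have : 8 * (8 * CR' δ CR ^ 2) * (t⁻¹ * t⁻¹) = (64 * CR' δ CR ^ 2 * t⁻¹) * t⁻¹ := by ring
  rw [this]
  nlinarith [mul_le_mul_of_nonneg_right key (inv_pos.2 htpos).le]

end Constants

section Numerology

variable {δ CR : ℝ}

/-- Numerical facts: `512 π ≤ 5⁵` and `512 π² ≤ 5⁶`. [folklore] -/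
theorem pi_bounds : 512 * Real.pi ≤ (5 : ℝ) ^ 5 ∧ 512 * Real.pi ^ 2 ≤ (5 : ℝ) ^ 6 := by
  have h := Real.pi_lt_d2
  constructor <;> nlinarith [Real.pi_pos]

/-- The exponent comparison behind `(e:epsilon-0)`: with our `L` and `ε₁`,
`2 ε₀ log L ≤ ε₁` for `ε₀ = (5 C_R)^{-160/(δ(1-δ))}`. [cite: DyatlovJin2018, (e:epsilon-0), §3.3] -/
theorem numerology (hδ0 : 0 < δ) (hδ1 : δ < 1) (hCR : 1 ≤ CR) :
    2 * (5 * CR) ^ (-(160 / (δ * (1 - δ)))) * Real.log (Lnat δ CR) ≤ eps1 δ CR := by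
  -- notation
  set u : ℝ := 5 * CR with hu
  have hu5 : 5 ≤ u := by rw [hu]; linarith
  have hupos : 0 < u := by linarith
  have hCR0 : 0 < CR := by linarith
  set ℓ : ℝ := Real.log u with hℓ
  have hℓpos : 0 < ℓ := Real.log_pos (by linarith)
  set E : ℝ → ℝ := fun t => Real.exp (t * ℓ) with hE
  have Epos : ∀ t, 0 < E t := fun t => Real.exp_pos _
  have Eadd : ∀ s t, E s * E t = E (s + t) := fun s t => by
    simp only [hE, ← Real.exp_add]; ring_nf
  have Emono : ∀ {s t}, s ≤ t → E s ≤ E t := fun {s t} h =>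
    Real.exp_le_exp.2 (mul_le_mul_of_nonneg_right h hℓpos.le)
  have Einv : ∀ t, (E t)⁻¹ = E (-t) := fun t => by simp only [hE, ← Real.exp_neg]; ring_nf
  have Erpow : ∀ t : ℝ, u ^ t = E t := fun t => by
    simp only [hE, hℓ]; rw [Real.rpow_def_of_pos hupos]; ring_nf
  have E1 : E 1 = u := by rw [← Erpow]; simp
  -- exponents
  set a : ℝ := 1 / δ with ha
  set b : ℝ := 1 / (1 - δ) with hb
  set e : ℝ := 1 / (δ * (1 - δ)) with he
  have h1δ : 0 < 1 - δ := by linarith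
  have hab : a + b = e := by simp only [ha, hb, he]; field_simp; ring
  have ha1 : 1 ≤ a := by rw [ha, le_div_iff₀ hδ0]; linarith
  have hb1 : 1 ≤ b := by rw [hb, le_div_iff₀ h1δ]; linarith
  have he4 : 4 ≤ e := by
    rw [he, le_div_iff₀ (by positivity)]; nlinarith [sq_nonneg (2 * δ - 1)]
  have ha0 : 0 ≤ a := by linarith
  have hb0 : 0 ≤ b := by linarith
  -- (B1) C_R^{4/δ} ≤ E(4a)
  have hB1 : CR ^ (4 / δ) ≤ E (4 * a) := by
    rw [← Erpow, show 4 / δ = 4 * a by rw [ha]; ring]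
    exact Real.rpow_le_rpow hCR0.le (by linarith) (by linarith)
  -- (B2) C_R' ≤ E(2b)
  have hB2 : CR' δ CR ≤ E (2 * b) := by
    rw [← Erpow]
    unfold CR'
    rw [show 1 / (1 - δ) = b from rfl]
    calc (3 * CR ^ 2) ^ b ≤ (u ^ 2) ^ b := by
          apply Real.rpow_le_rpow (by positivity) _ hb0
          rw [hu]; nlinarith
      _ = u ^ (2 * b) := by
          rw [show (u ^ 2 : ℝ) = u ^ (2 : ℝ) by norm_cast, ← Real.rpow_mul hupos.le]
  have hC1 := one_le_CR' hδ1 hCR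
  -- (B3) bse ≤ E(5 + 4e)
  have hB3 : bse δ CR ≤ E (5 + 4 * e) := by
    have h5 : 512 * Real.pi ≤ E 5 := by
      calc 512 * Real.pi ≤ (5 : ℝ) ^ 5 := pi_bounds.1
        _ ≤ u ^ 5 := by gcongr
        _ = E 5 := by rw [← Erpow]; norm_cast
    have h2 : CR' δ CR ^ 2 ≤ E (4 * b) := by
      calc CR' δ CR ^ 2 ≤ E (2 * b) ^ 2 := by gcongr
        _ = E (4 * b) := by rw [sq, Eadd]; ring_nf
    unfold bse
    calc 512 * Real.pi * CR' δ CR ^ 2 * CR ^ (4 / δ) ≤ E 5 * E (4 * b) * E (4 * a) := by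
          apply mul_le_mul (mul_le_mul h5 h2 (by positivity) (Epos _).le) hB1 (by positivity)
          exact (mul_pos (Epos _) (Epos _)).le
      _ = E (5 + 4 * e) := by rw [Eadd, Eadd, ← hab]; ring_nf
  -- (B4) L ≤ E(16 + 12 e)
  have hL0 : (0 : ℝ) < Lnat δ CR := by exact_mod_cast Lnat_pos hδ0 hδ1 hCR
  have hL1 : (1 : ℝ) ≤ Lnat δ CR := by exact_mod_cast Lnat_pos hδ0 hδ1 hCR
  have hB4 : (Lnat δ CR : ℝ) ≤ E (16 + 12 * e) := by
    have hLam : Lam δ CR ≤ E (15 + 12 * e) := by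
      unfold Lam
      calc bse δ CR ^ 3 ≤ E (5 + 4 * e) ^ 3 := pow_le_pow_left₀ (bse_pos hδ0 hδ1 hCR).le hB3 3
        _ = E (15 + 12 * e) := by
            rw [show E (5 + 4 * e) ^ 3 = E (5 + 4 * e) * E (5 + 4 * e) * E (5 + 4 * e) by ring,
              Eadd, Eadd]; ring_nf
    calc (Lnat δ CR : ℝ) ≤ 2 * Lam δ CR := L_le_two_Lam hδ0 hδ1 hCR
      _ ≤ u * E (15 + 12 * e) := mul_le_mul (by linarith) hLam (by linarith [one_le_Lam hδ0 hδ1 hCR]) hupos.le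
      _ = E (16 + 12 * e) := by rw [← E1, Eadd]; ring_nf
  -- (B5) log L ≤ (16 + 12 e) ℓ
  have hB5 : Real.log (Lnat δ CR) ≤ (16 + 12 * e) * ℓ := by
    rw [Real.log_le_iff_le_exp hL0]; exact hB4
  have hlog0 : 0 ≤ Real.log (Lnat δ CR) := Real.log_nonneg hL1
  -- (B6) pmn ≥ E(-(16+12e) - 2b)
  have hB6 : E (-(16 + 12 * e) - 2 * b) ≤ pmn δ CR := by
    unfold pmn
    have h1 : E (-(16 + 12 * e)) ≤ (Lnat δ CR : ℝ) ^ (-δ) := by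
      calc E (-(16 + 12 * e)) = (E (16 + 12 * e))⁻¹ := (Einv _).symm
        _ ≤ (Lnat δ CR : ℝ)⁻¹ := by
            rw [inv_le_inv₀ (Epos _) hL0]; exact hB4
        _ = (Lnat δ CR : ℝ) ^ (-(1 : ℝ)) := (Real.rpow_neg_one _).symm
        _ ≤ (Lnat δ CR : ℝ) ^ (-δ) := Real.rpow_le_rpow_of_exponent_le hL1 (by linarith)
    have h2 : E (-(2 * b)) ≤ (CR' δ CR)⁻¹ := by
      rw [← Einv, inv_le_inv₀ (Epos _) (by linarith)]; exact hB2
    calc E (-(16 + 12 * e) - 2 * b) = E (-(16 + 12 * e)) * E (-(2 * b)) := by rw [Eadd]; ring_nf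
      _ ≤ (Lnat δ CR : ℝ) ^ (-δ) * (CR' δ CR)⁻¹ :=
          mul_le_mul h1 h2 (Epos _).le (Real.rpow_nonneg hL0.le _)
      _ = (Lnat δ CR : ℝ) ^ (-δ) / CR' δ CR := (div_eq_mul_inv _ _).symm
  -- (B7) A ≥ E(-4a)
  have hB7 : E (-(4 * a)) ≤ CR ^ (-(4 / δ)) := by
    rw [Real.rpow_neg hCR0.le, ← Einv, inv_le_inv₀ (Epos _) (Real.rpow_pos_of_pos hCR0 _)]
    exact hB1
  -- (B8) (L^{1/3})⁻¹ ^ 2 ≥ E(-(16+12e))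
  have hB8 : E (-(16 + 12 * e)) ≤ (((Lnat δ CR : ℝ) ^ (1 / 3 : ℝ))⁻¹) ^ 2 := by
    have e1 : (((Lnat δ CR : ℝ) ^ (1 / 3 : ℝ))⁻¹) ^ 2 = (Lnat δ CR : ℝ) ^ (-(2 / 3 : ℝ)) := by
      rw [← Real.rpow_neg hL0.le, ← Real.rpow_natCast, ← Real.rpow_mul hL0.le]; norm_num
    rw [e1]
    calc E (-(16 + 12 * e)) = (E (16 + 12 * e))⁻¹ := (Einv _).symm
      _ ≤ (Lnat δ CR : ℝ)⁻¹ := by rw [inv_le_inv₀ (Epos _) hL0]; exact hB4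
      _ = (Lnat δ CR : ℝ) ^ (-(1 : ℝ)) := (Real.rpow_neg_one _).symm
      _ ≤ (Lnat δ CR : ℝ) ^ (-(2 / 3 : ℝ)) := Real.rpow_le_rpow_of_exponent_le hL1 (by norm_num)
  -- (B9) 1/(512 π²) ≥ E(-6)
  have hB9 : E (-6) ≤ 1 / (512 * Real.pi ^ 2) := by
    rw [← Einv, one_div, inv_le_inv₀ (Epos _) (by positivity)]
    calc 512 * Real.pi ^ 2 ≤ (5 : ℝ) ^ 6 := pi_bounds.2
      _ ≤ u ^ 6 := by gcongr
      _ = E 6 := by rw [← Erpow]; norm_cast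
  -- lower bound for ε₁
  have hpmn0 := (pmn_pos hδ0 hδ1 hCR).le
  have heps : E (-(70 + 56 * e)) ≤ eps1 δ CR := by
    have step1 : E (-(70 + 56 * e)) ≤ E (-(70 + 48 * e + 6 * b + 8 * a)) := Emono (by nlinarith)
    refine step1.trans ?_
    unfold eps1
    have eform : pmn δ CR ^ 3 / 2 * (CR ^ (-(4 / δ)) * ((Lnat δ CR : ℝ) ^ (1 / 3 : ℝ))⁻¹ / (16 * Real.pi)) ^ 2 =
        pmn δ CR ^ 3 * (CR ^ (-(4 / δ))) ^ 2 * (((Lnat δ CR : ℝ) ^ (1 / 3 : ℝ))⁻¹) ^ 2 *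
          (1 / (512 * Real.pi ^ 2)) := by
      field_simp; ring
    rw [eform]
    have hp3 : E (3 * (-(16 + 12 * e) - 2 * b)) ≤ pmn δ CR ^ 3 := by
      calc E (3 * (-(16 + 12 * e) - 2 * b)) = E (-(16 + 12 * e) - 2 * b) ^ 3 := by
            rw [show E (-(16 + 12 * e) - 2 * b) ^ 3 = E (-(16 + 12 * e) - 2 * b) *
              E (-(16 + 12 * e) - 2 * b) * E (-(16 + 12 * e) - 2 * b) by ring, Eadd, Eadd]; ring_nf
        _ ≤ pmn δ CR ^ 3 := pow_le_pow_left₀ (Epos _).le hB6 3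
    have hA2 : E (2 * (-(4 * a))) ≤ (CR ^ (-(4 / δ))) ^ 2 := by
      calc E (2 * (-(4 * a))) = E (-(4 * a)) ^ 2 := by rw [sq, Eadd]; ring_nf
        _ ≤ (CR ^ (-(4 / δ))) ^ 2 := pow_le_pow_left₀ (Epos _).le hB7 2
    calc E (-(70 + 48 * e + 6 * b + 8 * a))
        = E (3 * (-(16 + 12 * e) - 2 * b)) * E (2 * (-(4 * a))) * E (-(16 + 12 * e)) * E (-6) := by
          rw [Eadd, Eadd, Eadd]; ring_nf
      _ ≤ pmn δ CR ^ 3 * (CR ^ (-(4 / δ))) ^ 2 * (((Lnat δ CR : ℝ) ^ (1 / 3 : ℝ))⁻¹) ^ 2 *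
          (1 / (512 * Real.pi ^ 2)) := by
          apply mul_le_mul _ hB9 (Epos _).le (by positivity)
          apply mul_le_mul _ hB8 (Epos _).le (by positivity)
          exact mul_le_mul hp3 hA2 (Epos _).le (by positivity)
  -- ε₀ = E(-160 e)
  have heps0 : (5 * CR) ^ (-(160 / (δ * (1 - δ)))) = E (-(160 * e)) := by
    rw [← hu, Erpow]; congr 1; rw [he]; ring
  rw [heps0]
  refine le_trans ?_ heps
  -- 2 E(-160e) log L ≤ E(-(70+56e))
  have hfin : 2 * ((16 + 12 * e) * ℓ) ≤ E (104 * e - 70) := by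
    have h1 : (104 * e - 70) * ℓ + 1 ≤ E (104 * e - 70) := by
      simp only [hE]; exact Real.add_one_le_exp _
    nlinarith
  calc 2 * E (-(160 * e)) * Real.log (Lnat δ CR) ≤ 2 * E (-(160 * e)) * ((16 + 12 * e) * ℓ) := by
        apply mul_le_mul_of_nonneg_left hB5; have := Epos (-(160 * e)); positivity
    _ = E (-(160 * e)) * (2 * ((16 + 12 * e) * ℓ)) := by ring
    _ ≤ E (-(160 * e)) * E (104 * e - 70) := mul_le_mul_of_nonneg_left hfin (Epos _).le
    _ = E (-(70 + 56 * e)) := by rw [Eadd]; ring_nf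

/-- Consequence: the per-level loss `(1-ε₁)` beats `L^{2ε₀}`.
[cite: DyatlovJin2018, (e:epsilon-0) and Proposition 3.1 (proof)] -/
theorem decay_le_one (hδ0 : 0 < δ) (hδ1 : δ < 1) (hCR : 1 ≤ CR) :
    (1 - eps1 δ CR) * (Lnat δ CR : ℝ) ^ (2 * (5 * CR) ^ (-(160 / (δ * (1 - δ))))) ≤ 1 := by
  have hL0 : (0 : ℝ) < Lnat δ CR := by exact_mod_cast Lnat_pos hδ0 hδ1 hCR
  have hnum := numerology hδ0 hδ1 hCR
  have h1 : (Lnat δ CR : ℝ) ^ (2 * (5 * CR) ^ (-(160 / (δ * (1 - δ))))) ≤ Real.exp (eps1 δ CR) := by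
    rw [Real.rpow_def_of_pos hL0, Real.exp_le_exp]
    linarith
  have h2 : 1 - eps1 δ CR ≤ Real.exp (-eps1 δ CR) := by
    have := Real.add_one_le_exp (-eps1 δ CR); linarith
  have h3 : 0 ≤ 1 - eps1 δ CR := by
    have h4 := eps1_le hδ0 hδ1 hCR
    have h5 : pmn δ CR ^ 3 ≤ 1 := pow_le_one₀ (pmn_pos hδ0 hδ1 hCR).le (pmn_le_one hδ0 hδ1 hCR)
    linarith
  calc (1 - eps1 δ CR) * (Lnat δ CR : ℝ) ^ (2 * (5 * CR) ^ (-(160 / (δ * (1 - δ)))))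
      ≤ Real.exp (-eps1 δ CR) * Real.exp (eps1 δ CR) :=
        mul_le_mul h2 h1 (Real.rpow_nonneg hL0.le _) (Real.exp_pos _).le
    _ = 1 := by rw [← Real.exp_add]; simp

end Numerology

section DFT

open ZMod

/-- Reindex a sum over `{j : ℤ/N | j.val ∈ X}` as a sum over `X ⊂ {0,…,N-1}`. [folklore] -/
theorem sum_filter_val_mem {N : ℕ} [NeZero N] {M : Type*} [AddCommMonoid M] (X : Finset ℕ)
    (hX : ∀ x ∈ X, x < N) (G : ZMod N → M) :
    ∑ j ∈ Finset.univ.filter (fun j : ZMod N => j.val ∈ X), G j = ∑ n ∈ X, G (n : ZMod N) := by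
  classical
  have hset : Finset.univ.filter (fun j : ZMod N => j.val ∈ X) = X.image (fun n : ℕ => (n : ZMod N)) := by
    ext j
    simp only [Finset.mem_filter, Finset.mem_univ, true_and, Finset.mem_image]
    constructor
    · intro h; exact ⟨j.val, h, ZMod.natCast_zmod_val j⟩
    · rintro ⟨n, hn, rfl⟩; rwa [ZMod.val_cast_of_lt (hX n hn)]
  rw [hset, Finset.sum_image]
  intro a ha b hb hab
  have := congrArg ZMod.val hab
  rwa [ZMod.val_cast_of_lt (hX a ha), ZMod.val_cast_of_lt (hX b hb)] at this

/-- The DFT of a function supported on `Y` as a sum over `Y ⊂ {0,…,N-1}`. [folklore] -/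
theorem dft_eq_sum_Y {N : ℕ} [NeZero N] (Y : Finset ℕ) (hY : ∀ y ∈ Y, y < N) (u : ZMod N → ℂ)
    (hu : ∀ ℓ : ZMod N, ℓ.val ∉ Y → u ℓ = 0) (k : ZMod N) :
    𝓕 u k = ∑ m ∈ Y, stdAddChar (-((m : ZMod N) * k)) * u (m : ZMod N) := by
  classical
  rw [ZMod.dft_apply]
  simp only [smul_eq_mul]
  rw [← sum_filter_val_mem Y hY (fun ℓ => stdAddChar (-(ℓ * k)) * u ℓ)]
  symm
  apply Finset.sum_subset (Finset.filter_subset _ _)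
  intro ℓ _ hℓ
  simp only [Finset.mem_filter, Finset.mem_univ, true_and] at hℓ
  rw [hu ℓ hℓ, mul_zero]

/-- The DFT phase as `ex`: `e^{-2πi mn/N} = ex(c · (s m) · (s n))` when `c s² = -2π/N`.
[cite: DyatlovJin2018, Proposition 5.6 (proof: comparison with 𝓕_N)] -/
theorem stdAddChar_eq_ex {N : ℕ} [NeZero N] (m n : ℕ) {c s : ℝ} (hcs : c * s ^ 2 = -(2 * Real.pi / N)) :
    stdAddChar (-((m : ZMod N) * (n : ZMod N))) = ex (c * (s * m) * (s * n)) := by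
  have h1 : (-((m : ZMod N) * (n : ZMod N)) : ZMod N) = ((-(m * n : ℤ) : ℤ) : ZMod N) := by push_cast; ring
  rw [h1, ZMod.stdAddChar_coe]
  unfold ex
  congr 1
  have e : c * (s * m) * (s * n) = (c * s ^ 2) * m * n := by ring
  rw [e, hcs]
  have hN : (N : ℂ) ≠ 0 := by exact_mod_cast NeZero.ne N
  push_cast
  field_simp

/-- `‖stdAddChar x‖ = 1`. [folklore] -/
theorem norm_stdAddChar {N : ℕ} [NeZero N] (x : ZMod N) : ‖(stdAddChar x : ℂ)‖ = 1 := by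
  rw [ZMod.stdAddChar_apply]; exact Circle.norm_coe _

/-- The trivial bound `∑_{j∈T} |𝓕u(j)|² ≤ N² ‖u‖²`. [folklore] -/
theorem dft_trivial_bound {N : ℕ} [NeZero N] (u : ZMod N → ℂ) (T : Finset (ZMod N)) :
    ∑ j ∈ T, ‖𝓕 u j‖ ^ 2 ≤ (N : ℝ) ^ 2 * ∑ ℓ : ZMod N, ‖u ℓ‖ ^ 2 := by
  classical
  have hpt : ∀ j, ‖𝓕 u j‖ ^ 2 ≤ (N : ℝ) * ∑ ℓ : ZMod N, ‖u ℓ‖ ^ 2 := by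
    intro j
    rw [ZMod.dft_apply]
    have h1 : ‖∑ ℓ : ZMod N, stdAddChar (-(ℓ * j)) • u ℓ‖ ≤ ∑ ℓ : ZMod N, ‖u ℓ‖ := by
      refine (norm_sum_le _ _).trans (le_of_eq (Finset.sum_congr rfl fun ℓ _ => ?_))
      rw [norm_smul, norm_stdAddChar, one_mul]
    have h2 := sq_sum_le_card_mul_sum_sq (s := (Finset.univ : Finset (ZMod N))) (f := fun ℓ => ‖u ℓ‖)
    rw [Finset.card_univ, ZMod.card] at h2
    exact (pow_le_pow_left₀ (norm_nonneg _) h1 2).trans h2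
  calc ∑ j ∈ T, ‖𝓕 u j‖ ^ 2 ≤ ∑ j ∈ T, (N : ℝ) * ∑ ℓ : ZMod N, ‖u ℓ‖ ^ 2 :=
        Finset.sum_le_sum fun j _ => hpt j
    _ = T.card * ((N : ℝ) * ∑ ℓ : ZMod N, ‖u ℓ‖ ^ 2) := by rw [Finset.sum_const, nsmul_eq_mul]
    _ ≤ N * ((N : ℝ) * ∑ ℓ : ZMod N, ‖u ℓ‖ ^ 2) := by
        apply mul_le_mul_of_nonneg_right _ (by positivity)
        have : T.card ≤ N := by
          calc T.card ≤ (Finset.univ : Finset (ZMod N)).card := Finset.card_le_univ T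
            _ = N := by rw [Finset.card_univ, ZMod.card]
        exact_mod_cast this
    _ = (N : ℝ) ^ 2 * ∑ ℓ : ZMod N, ‖u ℓ‖ ^ 2 := by ring

/-- Norms of `u` on `Y` are bounded by the full `ℓ²` norm. [folklore] -/
theorem sum_Y_le_sum_univ {N : ℕ} [NeZero N] (Y : Finset ℕ) (hY : ∀ y ∈ Y, y < N) (u : ZMod N → ℂ) :
    ∑ m ∈ Y, ‖u (m : ZMod N)‖ ^ 2 ≤ ∑ ℓ : ZMod N, ‖u ℓ‖ ^ 2 := by
  classical
  rw [← sum_filter_val_mem Y hY (fun ℓ => ‖u ℓ‖ ^ 2)]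
  exact Finset.sum_le_univ_sum_of_nonneg fun ℓ => by positivity

end DFT

section Final

variable {δ CR : ℝ}

/-- `#X ≤ C_R N^δ` for a discretely regular `X ⊂ ℤ_N`. [cite: DyatlovJin2018, Definition 5.2] -/
theorem card_le_of_isDiscreteRegular {N : ℕ} {X : Finset ℕ} (hreg : IsDiscreteRegular δ CR N X)
    (hX : ∀ x ∈ X, x < N) (hN : 1 ≤ N) : (X.card : ℝ) ≤ CR * (N : ℝ) ^ δ := by
  have h := hreg.1 0 N (by exact_mod_cast hN)
  have e : countInIcc X 0 (0 + N) = X.card := by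
    unfold countInIcc
    congr 1
    apply Finset.filter_true_of_mem
    intro x hx
    refine ⟨by positivity, ?_⟩
    have := hX x hx
    rw [zero_add]
    exact_mod_cast this.le
  rw [e] at h
  exact h

/-- A nonempty discretely regular set forces `C_R ≥ 1`. [cite: DyatlovJin2018, Definition 5.2] -/
theorem one_le_CR_of_nonempty {N : ℕ} {X : Finset ℕ} (hreg : IsDiscreteRegular δ CR N X)
    (hN : 1 ≤ N) (hCR : 0 < CR) {x : ℕ} (hx : x ∈ X) : 1 ≤ CR := by
  have h := hreg.2 x hx 1 le_rfl (by exact_mod_cast hN)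
  rw [Real.one_rpow, mul_one] at h
  have key : ∀ a : ℕ, (x : ℝ) - 1 / 2 ≤ a → (a : ℝ) ≤ x + 1 / 2 → a = x := by
    intro a h1 h2
    by_contra hne
    have hne' : (a : ℤ) - x ≠ 0 := by
      rw [sub_ne_zero]; exact_mod_cast hne
    have h3 := Int.one_le_abs hne'
    have h4 : (1 : ℝ) ≤ |(a : ℝ) - x| := by
      have : ((1 : ℤ) : ℝ) ≤ ((|(a : ℤ) - x| : ℤ) : ℝ) := by exact_mod_cast h3
      simpa [Int.cast_abs] using this
    have h5 : |(a : ℝ) - x| ≤ 1 / 2 := by rw [abs_le]; constructor <;> linarith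
    linarith
  have hc : countInIcc X ((x : ℝ) - 1 / 2) ((x : ℝ) + 1 / 2) ≤ 1 := by
    unfold countInIcc
    rw [Finset.card_le_one]
    intro a ha b hb
    simp only [Finset.mem_filter] at ha hb
    rw [key a ha.2.1 ha.2.2, key b hb.2.1 hb.2.2]
  have : CR⁻¹ ≤ 1 := h.trans (by exact_mod_cast hc)
  rwa [inv_le_one₀ hCR] at this

/-- The structural hypotheses for the dilated sets `s·X`, `s·Y`, `s² = 2π/(N L^K)`, `c = -L^K`.
[cite: DyatlovJin2018, Lemma 4.3, §3.3 (rescaling)] -/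
theorem stepHyp_dilate (hδ0 : 0 < δ) (hδ1 : δ < 1) (hCR : 1 ≤ CR) {N : ℕ} (hN : 0 < N)
    {X Y : Finset ℕ} (hregX : IsDiscreteRegular δ CR N X) (hregY : IsDiscreteRegular δ CR N Y)
    {K : ℕ} (hK : 2 ≤ K) (hKle : ((Lnat δ CR : ℝ)) ^ K ≤ 2 * Real.pi * N) {s : ℝ} (hs : 0 < s)
    (hs2 : s ^ 2 = 2 * Real.pi / (N * (Lnat δ CR : ℝ) ^ K)) :
    StepHyp (X.image fun x : ℕ => s * (x : ℝ)) (Y.image fun y : ℕ => s * (y : ℝ))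
      (-((Lnat δ CR : ℝ) ^ K)) δ CR s (s ^ δ) (s ^ δ) (Lnat δ CR) K (eps1 δ CR) := by
  set L := Lnat δ CR with hLdef
  have hL0 : 0 < L := Lnat_pos hδ0 hδ1 hCR
  have hL0' : (0 : ℝ) < L := by exact_mod_cast hL0
  have hL7 : (7 : ℝ) ≤ L := seven_le_L hδ0 hδ1 hCR
  have hN' : (0 : ℝ) < N := by exact_mod_cast hN
  have hLK : (0 : ℝ) < (L : ℝ) ^ K := by positivity
  -- 1 ≤ s N
  have hsN : 1 ≤ s * N := by
    have h1 : 1 ≤ (s * N) ^ 2 := by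
      rw [mul_pow, hs2, div_mul_eq_mul_div, le_div_iff₀ (by positivity)]
      nlinarith
    by_contra hlt
    push Not at hlt
    have h0 : 0 ≤ s * N := by positivity
    have : (s * N) ^ 2 < 1 := by nlinarith
    linarith
  -- s ≤ gr L (K-1)
  obtain ⟨K', rfl⟩ : ∃ K', K = K' + 2 := ⟨K - 2, by omega⟩
  have hh : s ≤ gr L (K' + 2 - 1) := by
    rw [show K' + 2 - 1 = K' + 1 by omega]
    unfold gr
    -- s * L^{K'+1} ≤ 1
    rw [le_inv_comm₀ hs (by positivity)]
    -- L^{K'+1} ≤ s⁻¹  ⟸ (L^{K'+1})² s² ≤ 1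
    have hkey : ((L : ℝ) ^ (K' + 1)) ^ 2 * s ^ 2 ≤ 1 := by
      rw [hs2]
      rw [show ((L : ℝ) ^ (K' + 1)) ^ 2 * (2 * Real.pi / (N * (L : ℝ) ^ (K' + 2))) =
        2 * Real.pi * (L : ℝ) ^ K' / N by field_simp; ring]
      rw [div_le_one hN']
      -- from L^{K'+2} ≤ 2πN and L² ≥ 49 > 4π²
      have h1 : (L : ℝ) ^ K' * (L : ℝ) ^ 2 ≤ 2 * Real.pi * N := by rw [← pow_add]; exact hKle
      have h2 : (49 : ℝ) ≤ (L : ℝ) ^ 2 := by nlinarith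
      have hpi := Real.pi_lt_d2
      nlinarith [Real.pi_pos, pow_nonneg hL0'.le K']
    have : (L : ℝ) ^ (K' + 1) * s ≤ 1 := by
      have h0 : 0 ≤ (L : ℝ) ^ (K' + 1) * s := by positivity
      nlinarith
    calc (L : ℝ) ^ (K' + 1) = (L : ℝ) ^ (K' + 1) * s * s⁻¹ := by field_simp
      _ ≤ 1 * s⁻¹ := mul_le_mul_of_nonneg_right this (inv_pos.2 hs).le
      _ = s⁻¹ := one_mul _
  exact {
    hδ0 := hδ0
    hδ1 := hδ1
    hCR := hCR
    hL := hL0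
    hL4 := hL4_L hδ0 hδ1 hCR
    hLbig := hLbig_L hδ0 hδ1 hCR
    hregX := regUpTo_of_isDiscreteRegular hregX hs hsN
    hregY := regUpTo_of_isDiscreteRegular hregY hs hsN
    hwX := Real.rpow_pos_of_pos hs δ
    hwY := Real.rpow_pos_of_pos hs δ
    hh := hh
    hc := by rw [abs_neg, abs_of_pos hLK]
    hε₁ := eps1_pos hδ0 hδ1 hCR
    hε₁a := heps1a hδ0 hδ1 hCR
    hε₁b := heps1b hδ0 hδ1 hCR
    hη := by rw [show (L : ℝ) ^ (-δ) / CR' δ CR = pmn δ CR from rfl, eta_eq hδ0 hδ1 hCR]; exact eta_le hδ0 hδ1 hCR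
    hnum := hnum_L hδ0 hδ1 hCR }

end Final

section MainTheorem

open ZMod

variable {δ CR : ℝ}

/-- The decay factor: `(1-ε₁)^{K-2} N^{2ε₀} ≤ L³` when `N ≤ L^{K+1}`.
[cite: DyatlovJin2018, §3.3 and Proposition 5.6 (proof)] -/
theorem decay_pow_bound (hδ0 : 0 < δ) (hδ1 : δ < 1) (hCR : 1 ≤ CR) {K : ℕ} (hK : 2 ≤ K) {N : ℝ}
    (hN : 0 < N) (hNL : N ≤ (Lnat δ CR : ℝ) ^ (K + 1)) :
    (1 - eps1 δ CR) ^ (K - 2) * N ^ (2 * (5 * CR) ^ (-(160 / (δ * (1 - δ))))) ≤ (Lnat δ CR : ℝ) ^ 3 := by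
  set ε₀ : ℝ := (5 * CR) ^ (-(160 / (δ * (1 - δ)))) with hε₀
  set L : ℝ := (Lnat δ CR : ℝ) with hL
  have hL1 : (1 : ℝ) ≤ L := by rw [hL]; exact_mod_cast Lnat_pos hδ0 hδ1 hCR
  have hL0 : 0 < L := by linarith
  have hε₀pos : 0 < ε₀ := Real.rpow_pos_of_pos (by linarith) _
  have hε₀le : 2 * ε₀ ≤ 1 := by
    have h1 : ε₀ ≤ (5 * CR) ^ (-(1 : ℝ)) := by
      apply Real.rpow_le_rpow_of_exponent_le (by linarith)
      have h1δ : 0 < 1 - δ := by linarith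
      have : 1 ≤ 160 / (δ * (1 - δ)) := by
        rw [le_div_iff₀ (by positivity)]; nlinarith
      linarith
    rw [Real.rpow_neg_one] at h1
    have h2 : (5 * CR)⁻¹ ≤ 1 / 5 := by rw [inv_le_comm₀ (by linarith) (by norm_num)]; linarith
    linarith
  have hdec := decay_le_one hδ0 hδ1 hCR
  have hq0 : 0 ≤ 1 - eps1 δ CR := by
    have h4 := eps1_le hδ0 hδ1 hCR
    have h5 : pmn δ CR ^ 3 ≤ 1 := pow_le_one₀ (pmn_pos hδ0 hδ1 hCR).le (pmn_le_one hδ0 hδ1 hCR)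
    linarith
  set M : ℝ := L ^ (2 * ε₀) with hM
  have hM0 : 0 ≤ M := Real.rpow_nonneg hL0.le _
  have hM1 : M ≤ L := by
    calc M = L ^ (2 * ε₀) := rfl
      _ ≤ L ^ (1 : ℝ) := Real.rpow_le_rpow_of_exponent_le hL1 hε₀le
      _ = L := Real.rpow_one L
  -- N^{2ε₀} ≤ M^{K+1}
  have hN1 : N ^ (2 * ε₀) ≤ M ^ (K + 1) := by
    calc N ^ (2 * ε₀) ≤ (L ^ (K + 1)) ^ (2 * ε₀) :=
          Real.rpow_le_rpow hN.le hNL (by linarith)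
      _ = M ^ (K + 1) := by
          rw [hM, ← Real.rpow_natCast, ← Real.rpow_mul hL0.le, mul_comm, Real.rpow_mul hL0.le,
            Real.rpow_natCast]
  obtain ⟨K', rfl⟩ : ∃ K', K = K' + 2 := ⟨K - 2, by omega⟩
  rw [show K' + 2 - 2 = K' from by omega]
  calc (1 - eps1 δ CR) ^ K' * N ^ (2 * ε₀) ≤ (1 - eps1 δ CR) ^ K' * M ^ (K' + 2 + 1) :=
        mul_le_mul_of_nonneg_left hN1 (pow_nonneg hq0 _)
    _ = ((1 - eps1 δ CR) * M) ^ K' * M ^ 3 := by rw [mul_pow, pow_add]; ring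
    _ ≤ 1 ^ K' * L ^ 3 := by
        apply mul_le_mul (pow_le_pow_left₀ (by positivity) hdec K') (pow_le_pow_left₀ hM0 hM1 3)
          (by positivity) (by positivity)
    _ = L ^ 3 := by ring
set_option maxHeartbeats 400000 in -- buildfix (bf3-g26): 160k/180k FAIL, 200k PASS at accept time; line-neutral budget line
/-- **Dyatlov–Jin 2018, Proposition 4.6 of the vendored numbering (= Proposition 5.6 of the
published version)**, the discrete fractal uncertainty principle with the explicit exponent
`ε₀ = (5C_R)^{-160/(δ(1-δ))}`, PROVED: the named fact `DyatlovJin2018_prop_4_6` holds.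
The proof follows the paper: Lemma 5.3 (dilated counting measures are Ahlfors–David regular),
the tree discretization of §2.1 with Lemma 2.1, the `𝒞_θ` norms of §2.2 with Lemmas 2.3–2.4, the
elementary Lemmas 2.6–2.8, the iteration of Proposition 3.1 with the inductive step Lemma 3.2
(§3.2, Lemmas 3.3–3.7) and the rescaling of §3.3, all specialised to counting measures and the
bilinear phase `Φ(x,y) = -2πxy`, `G ≡ 1`; small `N` and `C_R < 1` are handled by the trivial bound.
[cite: DyatlovJin2018, Proposition 5.6 (Theorem 1, Proposition 3.1, Lemmas 2.1–2.8, 3.2–3.7, 5.3)] -/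
theorem _root_.Literature.Analysis.Fourier.DyatlovJin2018_prop_4_6_holds : DyatlovJin2018_prop_4_6 := by
  intro δ CR hδ0 hδ1 hCRpos
  classical
  by_cases hCR : 1 ≤ CR
  swap
  · -- C_R < 1: regular sets are empty and the left side vanishes
    refine ⟨1, one_pos, ?_⟩
    intro N _ X Y hX _ hregX _ u _
    have hXe : ∀ j : ZMod N, j.val ∉ X := by
      intro j hj
      exact hCR (one_le_CR_of_nonempty hregX NeZero.one_le hCRpos hj)
    have hfil : Finset.univ.filter (fun j : ZMod N => j.val ∈ X) = ∅ := by
      ext j; simp [hXe j]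
    rw [hfil, Finset.sum_empty]
    positivity
  -- main case
  set L : ℕ := Lnat δ CR with hLdef
  set ε₀ : ℝ := (5 * CR) ^ (-(160 / (δ * (1 - δ)))) with hε₀
  have hL0 : 0 < L := Lnat_pos hδ0 hδ1 hCR
  have hL1 : 1 < L := one_lt_Lnat hδ0 hδ1 hCR
  have hL0' : (0 : ℝ) < L := by exact_mod_cast hL0
  have hL1' : (1 : ℝ) ≤ L := by exact_mod_cast hL0
  have hCR0 : 0 < CR := hCRpos
  refine ⟨2 * CR * (L : ℝ) ^ 4, by positivity, ?_⟩
  intro N _ X Y hX hY hregX hregY u hu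
  have hN : 0 < N := Nat.pos_of_ne_zero (NeZero.ne N)
  have hN' : (0 : ℝ) < N := by exact_mod_cast hN
  have hN1 : (1 : ℝ) ≤ N := by exact_mod_cast hN
  have hε₀pos : 0 < ε₀ := Real.rpow_pos_of_pos (by linarith) _
  have h1δ : 0 < 1 - δ := by linarith
  have h160 : 0 < 160 / (δ * (1 - δ)) := by positivity
  have hε₀le : ε₀ ≤ 1 := Real.rpow_le_one_of_one_le_of_nonpos (by linarith) (by linarith)
  -- the right-hand side exponent
  have hexp : (N : ℝ) ^ (1 - 2 * (1 / 2 - δ + ε₀)) = (N : ℝ) ^ (2 * δ) * (N : ℝ) ^ (-(2 * ε₀)) := by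
    rw [← Real.rpow_add hN']; congr 1; ring
  rw [hexp]
  set S2 : ℝ := ∑ ℓ : ZMod N, ‖u ℓ‖ ^ 2 with hS2
  have hS2nn : 0 ≤ S2 := by positivity
  -- the left-hand side as a sum over X ⊂ ℕ
  rw [sum_filter_val_mem X hX (fun j => ‖𝓕 u j‖ ^ 2)]
  by_cases hsmall : 2 * Real.pi * N < (L : ℝ) ^ 2
  · -- small N: trivial bound
    have htriv : ∑ n ∈ X, ‖𝓕 u (n : ZMod N)‖ ^ 2 ≤ (N : ℝ) ^ 2 * S2 := by
      rw [← sum_filter_val_mem X hX (fun j => ‖𝓕 u j‖ ^ 2)]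
      exact dft_trivial_bound u _
    refine htriv.trans ?_
    have hNL : (N : ℝ) < (L : ℝ) ^ 2 := by nlinarith [Real.pi_gt_three]
    -- N² ≤ C² N^{2δ} N^{-2ε₀}
    have h1 : (N : ℝ) ^ (-(2 : ℝ)) ≤ (N : ℝ) ^ (2 * δ) * (N : ℝ) ^ (-(2 * ε₀)) := by
      rw [← Real.rpow_add hN']
      apply Real.rpow_le_rpow_of_exponent_le hN1
      nlinarith
    have h2 : (N : ℝ) ^ 2 ≤ (2 * CR * (L : ℝ) ^ 4) ^ 2 * (N : ℝ) ^ (-(2 : ℝ)) := by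
      rw [Real.rpow_neg hN'.le, show ((N : ℝ) ^ (2 : ℝ)) = (N : ℝ) ^ 2 by norm_cast]
      rw [le_mul_inv_iff₀ (by positivity)]
      have a1 : (N : ℝ) ^ 2 ≤ ((L : ℝ) ^ 2) ^ 2 := pow_le_pow_left₀ hN'.le hNL.le 2
      calc (N : ℝ) ^ 2 * (N : ℝ) ^ 2 ≤ ((L : ℝ) ^ 2) ^ 2 * ((L : ℝ) ^ 2) ^ 2 :=
            mul_le_mul a1 a1 (by positivity) (by positivity)
        _ = 1 * ((L : ℝ) ^ 4) ^ 2 := by ring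
        _ ≤ (2 * CR) ^ 2 * ((L : ℝ) ^ 4) ^ 2 := by
            apply mul_le_mul_of_nonneg_right _ (by positivity)
            nlinarith
        _ = (2 * CR * (L : ℝ) ^ 4) ^ 2 := by ring
    calc (N : ℝ) ^ 2 * S2 ≤ (2 * CR * (L : ℝ) ^ 4) ^ 2 * (N : ℝ) ^ (-(2 : ℝ)) * S2 :=
          mul_le_mul_of_nonneg_right h2 hS2nn
      _ ≤ (2 * CR * (L : ℝ) ^ 4) ^ 2 * ((N : ℝ) ^ (2 * δ) * (N : ℝ) ^ (-(2 * ε₀))) * S2 := by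
          apply mul_le_mul_of_nonneg_right _ hS2nn
          exact mul_le_mul_of_nonneg_left h1 (by positivity)
      _ = (2 * CR * (L : ℝ) ^ 4) ^ 2 * ((N : ℝ) ^ (2 * δ) * (N : ℝ) ^ (-(2 * ε₀))) *
          ∑ ℓ : ZMod N, ‖u ℓ‖ ^ 2 := by rw [hS2]
  -- large N: the tree argument
  push Not at hsmall
  set T : ℕ := ⌊2 * Real.pi * N⌋₊ with hT
  have hT0 : T ≠ 0 := by
    have : (1 : ℝ) ≤ 2 * Real.pi * N := by nlinarith [Real.pi_gt_three]
    have : 0 < T := Nat.floor_pos.2 this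
    omega
  set K : ℕ := Nat.log L T with hK
  have hKle : ((L : ℝ)) ^ K ≤ 2 * Real.pi * N := by
    have h1 : L ^ K ≤ T := Nat.pow_log_le_self L hT0
    have h2 : ((L ^ K : ℕ) : ℝ) ≤ T := by exact_mod_cast h1
    push_cast at h2
    exact h2.trans (Nat.floor_le (by positivity))
  have hKlt : 2 * Real.pi * N < (L : ℝ) ^ (K + 1) := by
    have h1 : T < L ^ (K + 1) := Nat.lt_pow_succ_log_self hL1 T
    have h2 : (T : ℝ) + 1 ≤ ((L ^ (K + 1) : ℕ) : ℝ) := by exact_mod_cast h1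
    push_cast at h2
    linarith [Nat.lt_floor_add_one (2 * Real.pi * N)]
  have hK2 : 2 ≤ K := by
    have h1 : L ^ 2 ≤ T := by
      apply Nat.le_floor; push_cast; exact hsmall
    exact Nat.le_log_of_pow_le hL1 h1
  clear_value K T
  -- the dilation
  set s : ℝ := Real.sqrt (2 * Real.pi / (N * (L : ℝ) ^ K)) with hsdef
  have hs : 0 < s := Real.sqrt_pos.2 (by positivity)
  have hs2 : s ^ 2 = 2 * Real.pi / (N * (L : ℝ) ^ K) := Real.sq_sqrt (by positivity)
  have H := stepHyp_dilate hδ0 hδ1 hCR hN hregX hregY hK2 hKle hs hs2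
  set c : ℝ := -((L : ℝ) ^ K) with hc
  have hcs : c * s ^ 2 = -(2 * Real.pi / N) := by
    rw [hs2, hc]; field_simp
  set f : ℝ → ℂ := fun y => u ((⌊y / s⌋₊ : ℕ) : ZMod N) with hf
  have hfs : ∀ m : ℕ, f (s * m) = u (m : ZMod N) := by
    intro m; simp only [hf]
    rw [mul_div_cancel_left₀ _ hs.ne', Nat.floor_natCast]
  have core := core_bound H hK2 f
  -- identify the two sides of `core`
  have hinjs : ∀ (a : ℕ), ∀ (b : ℕ), s * (a : ℝ) = s * (b : ℝ) → a = b := by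
    intro a b hab
    exact_mod_cast mul_left_cancel₀ hs.ne' hab
  have hLHS : ∑ x ∈ X.image (fun x : ℕ => s * (x : ℝ)),
      ‖∑ y ∈ Y.image (fun y : ℕ => s * (y : ℝ)), ex (c * y * x) * f y‖ ^ 2 =
      ∑ n ∈ X, ‖𝓕 u (n : ZMod N)‖ ^ 2 := by
    rw [Finset.sum_image (fun a _ b _ h => hinjs a b h)]
    apply Finset.sum_congr rfl
    intro n _
    rw [Finset.sum_image (fun a _ b _ h => hinjs a b h), dft_eq_sum_Y Y hY u hu]
    congr 2
    apply Finset.sum_congr rfl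
    intro m _
    rw [hfs, stdAddChar_eq_ex m n hcs]
  have hRHS : ∑ y ∈ Y.image (fun y : ℕ => s * (y : ℝ)), ‖f y‖ ^ 2 = ∑ m ∈ Y, ‖u (m : ZMod N)‖ ^ 2 := by
    rw [Finset.sum_image (fun a _ b _ h => hinjs a b h)]
    apply Finset.sum_congr rfl
    intro m _; rw [hfs]
  rw [hLHS, hRHS, Finset.card_image_of_injective _ (fun a b h => hinjs a b h),
    Finset.card_image_of_injective _ (fun a b h => hinjs a b h)] at core
  -- bound the constants
  have hXc : (X.card : ℝ) ≤ CR * (N : ℝ) ^ δ := card_le_of_isDiscreteRegular hregX hX hN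
  have hYc : (Y.card : ℝ) ≤ CR * (N : ℝ) ^ δ := card_le_of_isDiscreteRegular hregY hY hN
  have hSY : ∑ m ∈ Y, ‖u (m : ZMod N)‖ ^ 2 ≤ S2 := sum_Y_le_sum_univ Y hY u
  have hdecay : (1 - eps1 δ CR) ^ (K - 2) * (N : ℝ) ^ (2 * ε₀) ≤ (L : ℝ) ^ 3 :=
    decay_pow_bound hδ0 hδ1 hCR hK2 hN' (by nlinarith [Real.pi_gt_three])
  have hq0 : 0 ≤ 1 - eps1 δ CR := by
    have h4 := eps1_le hδ0 hδ1 hCR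
    have h5 : pmn δ CR ^ 3 ≤ 1 := pow_le_one₀ (pmn_pos hδ0 hδ1 hCR).le (pmn_le_one hδ0 hδ1 hCR)
    linarith
  set q : ℝ := 1 - eps1 δ CR with hq
  have hNδ : (N : ℝ) ^ (2 * δ) = (N : ℝ) ^ δ * (N : ℝ) ^ δ := by rw [← Real.rpow_add hN']; ring_nf
  have hNε : (N : ℝ) ^ (2 * ε₀) * (N : ℝ) ^ (-(2 * ε₀)) = 1 := by
    rw [← Real.rpow_add hN']; simp
  have hNε0 : 0 < (N : ℝ) ^ (-(2 * ε₀)) := Real.rpow_pos_of_pos hN' _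
  refine core.trans ?_
  calc (X.card : ℝ) * Y.card * q ^ (K - 2) * ∑ m ∈ Y, ‖u (m : ZMod N)‖ ^ 2
      ≤ (CR * (N : ℝ) ^ δ) * (CR * (N : ℝ) ^ δ) * q ^ (K - 2) * S2 := by
        apply mul_le_mul _ hSY (Finset.sum_nonneg fun _ _ => by positivity) (by positivity)
        apply mul_le_mul_of_nonneg_right _ (pow_nonneg hq0 _)
        exact mul_le_mul hXc hYc (by positivity) (by positivity)
    _ = CR ^ 2 * (N : ℝ) ^ (2 * δ) * (N : ℝ) ^ (-(2 * ε₀)) *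
          (q ^ (K - 2) * (N : ℝ) ^ (2 * ε₀)) * S2 := by
        rw [hNδ]
        calc CR * (N : ℝ) ^ δ * (CR * (N : ℝ) ^ δ) * q ^ (K - 2) * S2
            = CR ^ 2 * ((N : ℝ) ^ δ * (N : ℝ) ^ δ) * 1 * q ^ (K - 2) * S2 := by ring
          _ = _ := by rw [← hNε]; ring
    _ ≤ CR ^ 2 * (N : ℝ) ^ (2 * δ) * (N : ℝ) ^ (-(2 * ε₀)) * (L : ℝ) ^ 3 * S2 := by
        apply mul_le_mul_of_nonneg_right _ hS2nn
        exact mul_le_mul_of_nonneg_left hdecay (by positivity)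
    _ ≤ (2 * CR * (L : ℝ) ^ 4) ^ 2 * ((N : ℝ) ^ (2 * δ) * (N : ℝ) ^ (-(2 * ε₀))) * S2 := by
        apply mul_le_mul_of_nonneg_right _ hS2nn
        have hL3 : (L : ℝ) ^ 3 ≤ 4 * (L : ℝ) ^ 8 := by
          have h1 : (L : ℝ) ^ 3 ≤ (L : ℝ) ^ 8 := pow_le_pow_right₀ hL1' (by norm_num)
          have h2 : 0 ≤ (L : ℝ) ^ 8 := by positivity
          linarith
        have hpos : 0 ≤ CR ^ 2 * (N : ℝ) ^ (2 * δ) * (N : ℝ) ^ (-(2 * ε₀)) := by positivity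
        calc CR ^ 2 * (N : ℝ) ^ (2 * δ) * (N : ℝ) ^ (-(2 * ε₀)) * (L : ℝ) ^ 3
            ≤ CR ^ 2 * (N : ℝ) ^ (2 * δ) * (N : ℝ) ^ (-(2 * ε₀)) * (4 * (L : ℝ) ^ 8) :=
              mul_le_mul_of_nonneg_left hL3 hpos
          _ = (2 * CR * (L : ℝ) ^ 4) ^ 2 * ((N : ℝ) ^ (2 * δ) * (N : ℝ) ^ (-(2 * ε₀))) := by ring
    _ = (2 * CR * (L : ℝ) ^ 4) ^ 2 * ((N : ℝ) ^ (2 * δ) * (N : ℝ) ^ (-(2 * ε₀))) *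
          ∑ ℓ : ZMod N, ‖u ℓ‖ ^ 2 := by rw [hS2]

end MainTheorem

end DyatlovJin2018.Dolgopyat

end Literature.Analysis.Fourier
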